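import Literature.Probability.Percolation.TwoSetConditionalAssociation
import Literature.Probability.Percolation.ConnectivityGramMatrix
import Mathlib.LinearAlgebra.Matrix.ToLinearEquiv
import HarnessLib

/-!
# Kozma–Nitzan 2024, Theorem 11 (the harmonic coefficients at `|A| = 3` are nonnegative) — the
# `c_a ≥ 0` half, PROVED by an exact two-set-BHK certificate

Topic `Literature/Probability/Percolation`; namespace `Literature.Probability.Percolation`, machinery in
the sub-namespace `KNHarmonic` (Kozma–Nitzan's §5.2 "harmonic" coefficients).  Everything is PROVED; no
named facts, no sorries.

## The printed statement (no printed proof)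

G. Kozma, S. Nitzan, *A reduction of the θ(p_c) = 0 problem to a conjectured inequality*,
arXiv:2401.12397, §5.2 p. 33: "**Theorem 11.** Let `G` be a graph and let `A ⊂ G` with `|A| = 3`.
Assume the equations `Σ_{a∈A} c_a P(0 ↔ A, a ↔ a′) = P(0 ↔ a′) ∀ a′ ∈ A` have a unique solution.  Then
this solution satisfies `c_a ≥ 0` for all `a ∈ A` and `Σ c_a ≥ 1`.  We skip the proof of this theorem
as it is long and holds only for `|A| ≤ 3`."  With `M_{aa′} := P(0 ↔ A, a ↔ a′)` (so `M_{aa} = P(0 ↔ A)`)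
and `r_a := P(0 ↔ a)`, Cramer's rule gives `c_a · det M = det M^{(a)}`, `M^{(a)}` = `M` with column `a`
replaced by `r`; `M` is positive semidefinite (KN p. 34; tree theorem `posSemidef_connKernelMatrix`), so
under unique solvability `det M > 0` and `c_a ≥ 0 ⟺ det M^{(a)} ≥ 0`.

## What is proved here, and how

* **`KNHarmonic.detM1_nonneg`** — for bond percolation with arbitrary edge probabilities on a finite
  vertex type and ANY vertices `o, a₁, a₂, a₃`:
  `det M^{(1)} = r₁(u² − m₂₃²) − m₁₂(r₂u − m₂₃r₃) + m₁₃(r₂m₂₃ − u r₃) ≥ 0`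
  (`u = P(0↔A)`, `m_{ij} = P(0↔A, a_i↔a_j)`, `r_i = P(0↔a_i)`).  PROOF = an exact SUM-OF-PRODUCTS
  CERTIFICATE found by linear programming (ttrl2 engine `harness/ttrl/kn11_lp.py`, request
  `kn11-certificate-target`, file `run/shared/lean/ttrl/kn11/cert_kn11_C1_D3.json`, verified twice in
  exact arithmetic before transcription): writing `x_0, …, x_14` for the probabilities of the 15
  partitions of `{0, a₁, a₂, a₃}` induced by the open clusters,
  `det M^{(1)} = Σ_{r=1}^{36} λ_r · x_{m_r} · R_r + Σ_{γ} σ_γ x^γ` identically as cubic polynomials in the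
  `x`'s, where each `R_r = μ(E₃)μ(E₄) − μ(E₁)μ(E₂) ≥ 0` is an instance of the van den Berg–Häggström–Kahn
  two-set conditional association inequality (RSA 2006 Thm. 2.1 at `q = 1` = Thm. 1.5 with vertex sets;
  tree theorem `BHK2006_twoSetConditionalAssociation`) on the four points, `λ_r, σ_γ ≥ 0` rationals.
  This is, as far as we know, the first written proof of this half of Theorem 11.
* `KNHarmonic.detM2_nonneg`, `KNHarmonic.detM3_nonneg` — the same for `det M^{(2)}`, `det M^{(3)}`
  (relabellings of `detM1_nonneg`); `KNHarmonic.detM_nonneg` — `det M ≥ 0` (`M` is a principal block of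
  the positive-semidefinite connectivity kernel of `μ(· ∩ {0 ↔ A})`, tree theorem
  `posSemidef_connKernelMatrix`, KN p. 34); `KNHarmonic.cramer3` — `c_i · det M = det M^{(i)}`;
  `KNHarmonic.knMatrix_three_apply`, `KNHarmonic.mMass_self` — the masses here ARE the entries of the
  tree's `knMatrix w o {a₁, a₂, a₃}`.
* **`KozmaNitzan2024_thm11_nonneg`** — the printed `c_a ≥ 0` conclusion: if `(c₁, c₂, c₃)` solves the
  three equations and the system is uniquely solvable (`det M ≠ 0`), then `c₁, c₂, c₃ ≥ 0`;
  `KozmaNitzan2024_thm11_nonneg_of_det_pos` — the same under `det M > 0` (e.g. from the tree's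
  `posDef_knMatrix`); `KozmaNitzan2024_thm11_nonneg_of_unique` / `…_of_existsUnique` — the printed
  "unique solution" form for the `Fin 3`-matrix `KNHarmonic.knMat3` (`M c = r`, `c` the only solution ⇒
  `∀ i, 0 ≤ c i`).  (The `Σ c_a ≥ 1` half is not proved here.)

Machinery (`KNHarmonic.*`): reachability inside an edge set (`EReach`) and the bridge
`reachable_iff_eReach` (`t ↔ v` iff `v` is reachable from `t` inside `C_T = ⋃_{t∈T} C_t`); syntactic
event formulas on four terminals (`TForm`: literals `i ~ j`, `i ≁ j`, ∧, ∨, ⊤, ⊥), their "A-type" check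
for a pair `(S, T)` (`isA`: connection literals rooted in `S`, separation literals rooted in `T` — events
increasing in `C_S` and decreasing in `C_T`), and the four ROW SHAPES of the certificate as theorems:
`row_posA` (`μ(DA)μ(DA′) ≤ μ(D)μ(DAA′)`), `row_posB`, `row_neg` (`μ(D)μ(DAB) ≤ μ(DA)μ(DB)`),
`row_x4` (`μ(DA₁B₁)μ(DA₂B₂) ≤ μ(DA₁A₂)μ(DB₁B₂)`), all from `BHK2006_twoSetConditionalAssociation`;
the 15 cells (`cellPat`), the fact that the six connection literals of a configuration form one of the
15 transitive patterns (`exists_cellPat_eq`), and `real_ev_eq_sum` (the probability of a formula event is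
the sum of its cells).

## References

* [KozmaNitzan2024] G. Kozma, S. Nitzan, arXiv:2401.12397, §5.2 Theorem 11 (p. 33), Question 5 (p. 32),
  positive-semidefiniteness remark (p. 34).
* [VandenbergHaggstromKahn2005] J. van den Berg, O. Häggström, J. Kahn, *Some conditional correlation
  inequalities for percolation and related processes*, Random Structures Algorithms 29 (2006),
  Thm. 2.1 / Thm. 1.5 / Remark 1.
-/

noncomputable section

namespace Literature.Probability.Percolation

open _root_.MeasureTheory Literature.Probability.LatticeModels Set
open scoped Classical BigOperators

namespace KNHarmonic

variable {V : Type*}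

/-! ### Reachability inside an edge set, and the bridge to `C_T` -/

/-- Reachability inside a set of pairs `C` (the graph `fromEdgeSet C`). [folklore] -/
def EReach (C : Set (Sym2 V)) (x y : V) : Prop := (SimpleGraph.fromEdgeSet C).Reachable x y

/-- `EReach` is monotone in the edge set. [folklore] -/
theorem EReach.mono {C C' : Set (Sym2 V)} (h : C ⊆ C') {x y : V} (hr : EReach C x y) : EReach C' x y :=
  SimpleGraph.Reachable.mono (SimpleGraph.fromEdgeSet_mono h) hr

/-- `EReach` is symmetric. [folklore] -/
theorem EReach.symm {C : Set (Sym2 V)} {x y : V} (h : EReach C x y) : EReach C y x :=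
  SimpleGraph.Reachable.symm h

/-- **Bridge**: for `t ∈ T`, `t ↔ v` iff `v` is reachable from `t` inside the union of edge clusters
`C_T = ⋃_{t' ∈ T} C_{t'}` (every edge of an open path from `t` lies in `C_t`; conversely `C_T` consists of
open pairs).  Hence `{t ↔ v}` is an increasing event of `C_T`.
[cite: VandenbergHaggstromKahn2005, §2 p. 6 (C_S)] -/
theorem reachable_iff_eReach (ω : BondConfig V) {T : Set V} {t : V} (ht : t ∈ T) (v : V) :
    (openGraph ω).Reachable t v ↔ EReach (⋃ t' ∈ T, openEdgeCluster ω t') t v := by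
  constructor
  · rintro ⟨p⟩
    -- along the walk every edge is open with both endpoints reachable from `t`
    suffices h : ∀ (x u : V) (q : (openGraph ω).Walk x u), (openGraph ω).Reachable t x →
        EReach (⋃ t' ∈ T, openEdgeCluster ω t') t x → EReach (⋃ t' ∈ T, openEdgeCluster ω t') t u from
      h t v p (SimpleGraph.Reachable.refl t) (SimpleGraph.Reachable.refl t)
    intro x u q
    induction q with
    | nil => exact fun _ h => h
    | cons hadj q ih =>
      rename_i x y u'
      intro htx hEx
      have hxy := (openGraph_adj ω x y).1 hadj
      have hty : (openGraph ω).Reachable t y := htx.trans hadj.reachable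
      have hedge : s(x, y) ∈ ⋃ t' ∈ T, openEdgeCluster ω t' := by
        refine mem_iUnion₂.2 ⟨t, ht, (mem_openEdgeCluster_iff ω t _).2 ⟨hxy.1, ?_, ?_⟩⟩
        · rw [Sym2.mk_isDiag_iff]; exact hxy.2
        · intro z hz
          rcases Sym2.mem_iff.1 hz with rfl | rfl
          · exact htx
          · exact hty
      have hExy : EReach (⋃ t' ∈ T, openEdgeCluster ω t') x y :=
        SimpleGraph.Adj.reachable ((SimpleGraph.fromEdgeSet_adj _).2 ⟨hedge, hxy.2⟩)
      exact ih hty (hEx.trans hExy)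
  · intro h
    refine SimpleGraph.Reachable.mono ?_ h
    exact SimpleGraph.fromEdgeSet_mono (iUnion₂_subset fun t' _ => openEdgeCluster_subset ω t')

/-! ### Event formulas on four terminals -/

/-- Formulas in the connection literals of four terminals `0, 1, 2, 3`: `conn i j` (`i ~ j`),
`sep i j` (`i ≁ j`), conjunction, disjunction, `⊤`, `⊥`. [folklore] -/
inductive TForm : Type
  | conn : Fin 4 → Fin 4 → TForm
  | sep : Fin 4 → Fin 4 → TForm
  | and : TForm → TForm → TForm
  | or : TForm → TForm → TForm
  | tt : TForm
  | ff : TForm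
  deriving DecidableEq

namespace TForm

/-- Truth of a formula for a relation `R` on the terminals. [folklore] -/
def holds (R : Fin 4 → Fin 4 → Prop) : TForm → Prop
  | conn i j => R i j
  | sep i j => ¬ R i j
  | and φ ψ => φ.holds R ∧ ψ.holds R
  | or φ ψ => φ.holds R ∨ ψ.holds R
  | tt => True
  | ff => False

/-- Boolean evaluation on a literal matrix `β i j` (`true` = connected). [folklore] -/
def eval (β : Fin 4 → Fin 4 → Bool) : TForm → Bool
  | conn i j => β i j
  | sep i j => !(β i j)
  | and φ ψ => φ.eval β && ψ.eval β
  | or φ ψ => φ.eval β || ψ.eval β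
  | tt => true
  | ff => false

/-- `holds` for the relation read off a Boolean matrix is `eval`. [folklore] -/
theorem holds_iff_eval (β : Fin 4 → Fin 4 → Bool) (φ : TForm) :
    φ.holds (fun i j => β i j = true) ↔ φ.eval β = true := by
  induction φ with
  | conn i j => rfl
  | sep i j => simp [holds, eval]
  | and φ ψ ihφ ihψ => simp [holds, eval, ihφ, ihψ]
  | or φ ψ ihφ ihψ => simp [holds, eval, ihφ, ihψ]
  | tt => simp [holds, eval]
  | ff => simp [holds, eval]

/-- De Morgan negation. [folklore] -/
def neg : TForm → TForm
  | conn i j => sep i j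
  | sep i j => conn i j
  | and φ ψ => or φ.neg ψ.neg
  | or φ ψ => and φ.neg ψ.neg
  | tt => ff
  | ff => tt

/-- `holds` of the negation. [folklore] -/
theorem holds_neg (R : Fin 4 → Fin 4 → Prop) (φ : TForm) : φ.neg.holds R ↔ ¬ φ.holds R := by
  induction φ with
  | conn i j => simp [neg, holds]
  | sep i j => simp [neg, holds]
  | and φ ψ ihφ ihψ => simp only [neg, holds, ihφ, ihψ, not_and_or]
  | or φ ψ ihφ ihψ => simp only [neg, holds, ihφ, ihψ, not_or]
  | tt => simp [neg, holds]
  | ff => simp [neg, holds]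

/-- **A-type formulas for the pair `(S, T)`**: every connection literal is rooted in `S` and every
separation literal is rooted in `T` (such events are increasing in `C_S` and decreasing in `C_T`).
[folklore] -/
def isA (S T : Finset (Fin 4)) : TForm → Bool
  | conn i j => decide (i ∈ S) || decide (j ∈ S)
  | sep i j => decide (i ∈ T) || decide (j ∈ T)
  | and φ ψ => φ.isA S T && ψ.isA S T
  | or φ ψ => φ.isA S T && ψ.isA S T
  | tt => true
  | ff => true

/-- B-type = A-type for the swapped pair. [folklore] -/
abbrev isB (S T : Finset (Fin 4)) (φ : TForm) : Bool := φ.isA T S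

/-- The negation of a B-type formula is A-type. [folklore] -/
theorem isA_neg (S T : Finset (Fin 4)) (φ : TForm) (h : φ.isB S T = true) : φ.neg.isA S T = true := by
  induction φ with
  | conn i j => simpa [isB, isA, neg] using h
  | sep i j => simpa [isB, isA, neg] using h
  | and φ ψ ihφ ihψ =>
    simp only [isB, isA, neg, Bool.and_eq_true] at h ⊢
    exact ⟨ihφ h.1, ihψ h.2⟩
  | or φ ψ ihφ ihψ =>
    simp only [isB, isA, neg, Bool.and_eq_true] at h ⊢
    exact ⟨ihφ h.1, ihψ h.2⟩
  | tt => rfl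
  | ff => rfl

/-- The "up–down" interpretation of a formula on a pair of edge sets `(C, D)`: connection literals
are read as reachability inside `C`, separation literals as non-reachability inside `D`. [folklore] -/
def ud (τ : Fin 4 → V) (C D : Set (Sym2 V)) : TForm → Prop
  | conn i j => EReach C (τ i) (τ j)
  | sep i j => ¬ EReach D (τ i) (τ j)
  | and φ ψ => φ.ud τ C D ∧ ψ.ud τ C D
  | or φ ψ => φ.ud τ C D ∨ ψ.ud τ C D
  | tt => True
  | ff => False

/-- The up–down interpretation is increasing in `C` and decreasing in `D`. [folklore] -/
theorem ud_mono (τ : Fin 4 → V) {C C' D D' : Set (Sym2 V)} (hC : C ⊆ C') (hD : D' ⊆ D) :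
    ∀ φ : TForm, φ.ud τ C D → φ.ud τ C' D'
  | conn _ _ => fun h => EReach.mono hC h
  | sep _ _ => fun h h' => h (EReach.mono hD h')
  | and φ ψ => fun h => ⟨ud_mono τ hC hD φ h.1, ud_mono τ hC hD ψ h.2⟩
  | or φ ψ => fun h => h.imp (ud_mono τ hC hD φ) (ud_mono τ hC hD ψ)
  | tt => fun h => h
  | ff => fun h => h

end TForm

/-! ### Events of formulas, and the A-type bridge -/

section Events

variable (τ : Fin 4 → V)

/-- The event of a formula: the connection literals are read as open-path connections between the
terminals `τ i`. [folklore] -/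
def ev (φ : TForm) : Set (BondConfig V) := {ω | φ.holds fun i j => (openGraph ω).Reachable (τ i) (τ j)}

/-- Membership in the event of a formula. [folklore] -/
theorem mem_ev (φ : TForm) (ω : BondConfig V) :
    ω ∈ ev τ φ ↔ φ.holds fun i j => (openGraph ω).Reachable (τ i) (τ j) := Iff.rfl

/-- `ev (φ ∧ ψ) = ev φ ∩ ev ψ`. [folklore] -/
@[simp] theorem ev_and (φ ψ : TForm) : ev τ (φ.and ψ) = ev τ φ ∩ ev τ ψ := rfl

/-- `ev (¬φ) = (ev φ)ᶜ`. [folklore] -/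
theorem ev_neg (φ : TForm) : ev τ φ.neg = (ev τ φ)ᶜ := by
  ext ω; exact TForm.holds_neg _ φ

/-- The separation event `D(S, T) = {S ≁ T}` of two sets of terminal indices. [folklore] -/
def sepEv (S T : Finset (Fin 4)) : Set (BondConfig V) :=
  {ω | ∀ i ∈ S, ∀ j ∈ T, ¬ (openGraph ω).Reachable (τ i) (τ j)}

/-- `D(S,T)` is BHK's `{τ(S) ↮ τ(T)}`. [folklore] -/
theorem sepEv_eq (S T : Finset (Fin 4)) :
    sepEv τ S T = {ω : BondConfig V | ∀ s ∈ τ '' ↑S, ∀ t ∈ τ '' ↑T, ¬ (openGraph ω).Reachable s t} := by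
  ext ω
  simp only [sepEv, mem_setOf_eq, mem_image, Finset.mem_coe, forall_exists_index, and_imp,
    forall_apply_eq_imp_iff₂]

/-- `D(S,T) = D(T,S)`. [folklore] -/
theorem sepEv_comm (S T : Finset (Fin 4)) : sepEv τ S T = sepEv τ T S := by
  ext ω
  simp only [sepEv, mem_setOf_eq]
  constructor
  · exact fun h j hj i hi hr => h i hi j hj hr.symm
  · exact fun h i hi j hj hr => h j hj i hi hr.symm

/-- The union of edge clusters over a set of terminal indices equals BHK's `C_{τ(S)}`. [folklore] -/
theorem biUnion_image (S : Finset (Fin 4)) (ω : BondConfig V) :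
    (⋃ s ∈ τ '' (↑S : Set (Fin 4)), openEdgeCluster ω s) = ⋃ i ∈ S, openEdgeCluster ω (τ i) := by
  ext e
  simp only [mem_iUnion, mem_image, Finset.mem_coe, exists_prop]
  constructor
  · rintro ⟨_, ⟨i, hi, rfl⟩, he⟩; exact ⟨i, hi, he⟩
  · rintro ⟨i, hi, he⟩; exact ⟨τ i, ⟨i, hi, rfl⟩, he⟩

/-- **A-type formulas are read off `(C_S, C_T)` by the up–down interpretation.** [folklore] -/
theorem holds_iff_ud (S T : Finset (Fin 4)) (ω : BondConfig V) :
    ∀ φ : TForm, φ.isA S T = true →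
      (φ.holds (fun i j => (openGraph ω).Reachable (τ i) (τ j)) ↔
        φ.ud τ (⋃ i ∈ S, openEdgeCluster ω (τ i)) (⋃ j ∈ T, openEdgeCluster ω (τ j)))
  | .conn i j, h => by
    simp only [TForm.isA, Bool.or_eq_true, decide_eq_true_eq] at h
    change (openGraph ω).Reachable (τ i) (τ j) ↔ EReach _ (τ i) (τ j)
    rcases h with hi | hj
    · rw [← biUnion_image]
      exact reachable_iff_eReach ω (T := τ '' ↑S) ⟨i, hi, rfl⟩ (τ j)
    · rw [← biUnion_image, SimpleGraph.reachable_comm,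
        reachable_iff_eReach ω (T := τ '' ↑S) ⟨j, hj, rfl⟩ (τ i)]
      exact ⟨EReach.symm, EReach.symm⟩
  | .sep i j, h => by
    simp only [TForm.isA, Bool.or_eq_true, decide_eq_true_eq] at h
    change ¬ (openGraph ω).Reachable (τ i) (τ j) ↔ ¬ EReach _ (τ i) (τ j)
    rcases h with hi | hj
    · rw [← biUnion_image]
      exact not_congr (reachable_iff_eReach ω (T := τ '' ↑T) ⟨i, hi, rfl⟩ (τ j))
    · rw [← biUnion_image, SimpleGraph.reachable_comm,
        reachable_iff_eReach ω (T := τ '' ↑T) ⟨j, hj, rfl⟩ (τ i)]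
      exact not_congr ⟨EReach.symm, EReach.symm⟩
  | .and φ ψ, h => by
    simp only [TForm.isA, Bool.and_eq_true] at h
    exact and_congr (holds_iff_ud S T ω φ h.1) (holds_iff_ud S T ω ψ h.2)
  | .or φ ψ, h => by
    simp only [TForm.isA, Bool.and_eq_true] at h
    exact or_congr (holds_iff_ud S T ω φ h.1) (holds_iff_ud S T ω ψ h.2)
  | .tt, _ => Iff.rfl
  | .ff, _ => Iff.rfl

/-- The up–down event of an A-type formula is its event. [folklore] -/
theorem setOf_ud_eq_ev (S T : Finset (Fin 4)) (φ : TForm) (h : φ.isA S T = true) :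
    {ω : BondConfig V | φ.ud τ (⋃ i ∈ S, openEdgeCluster ω (τ i)) (⋃ j ∈ T, openEdgeCluster ω (τ j))} =
      ev τ φ := by
  ext ω
  exact (holds_iff_ud τ S T ω φ h).symm

end Events

/-! ### The four row shapes -/

section Rows

/-- Monotonicity of a two-argument predicate indicator. [folklore] -/
theorem udIndicator_monotone (τ : Fin 4 → V) (φ : TForm) (D : Set (Sym2 V)) :
    Monotone fun C => (if φ.ud τ C D then (1 : ℝ) else 0) := by
  intro C C' hCC'
  dsimp only
  by_cases h : φ.ud τ C D
  · rw [if_pos h, if_pos (TForm.ud_mono τ hCC' le_rfl φ h)]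
  · rw [if_neg h]; split_ifs <;> norm_num

/-- Antitonicity of a two-argument predicate indicator. [folklore] -/
theorem udIndicator_antitone (τ : Fin 4 → V) (φ : TForm) (C : Set (Sym2 V)) :
    Antitone fun D => (if φ.ud τ C D then (1 : ℝ) else 0) := by
  intro D D' hDD'
  dsimp only
  by_cases h : φ.ud τ C D'
  · rw [if_pos h, if_pos (TForm.ud_mono τ le_rfl hDD' φ h)]
  · rw [if_neg h]; split_ifs <;> norm_num

variable [Fintype V] (w : Sym2 V → unitInterval) (τ : Fin 4 → V)

/-- **Row shape `posA`** (two A-type events are positively correlated given `D = {S ≁ T}`):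
`μ(D ∩ A) · μ(D ∩ A′) ≤ μ(D) · μ(D ∩ A ∩ A′)` — BHK 2006 Thm. 2.1 (`q = 1`) / Thm. 1.5 with vertex sets,
for the indicators of `A = ev φ`, `A′ = ev φ′`.
[cite: VandenbergHaggstromKahn2005, Thm. 2.1 (p. 9) at q = 1; Remark 1 after Thm. 1.2 (p. 5)] -/
theorem row_posA (S T : Finset (Fin 4)) (φ φ' : TForm) (hφ : φ.isA S T = true) (hφ' : φ'.isA S T = true) :
    (prodBernoulli w).real (sepEv τ S T ∩ ev τ φ) * (prodBernoulli w).real (sepEv τ S T ∩ ev τ φ') ≤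
      (prodBernoulli w).real (sepEv τ S T) * (prodBernoulli w).real (sepEv τ S T ∩ (ev τ φ ∩ ev τ φ')) := by
  have key := BHK2006_twoSetConditionalAssociation w (τ '' ↑S) (τ '' ↑T)
    (fun C D => if φ.ud τ C D then (1 : ℝ) else 0) (fun C D => if φ'.ud τ C D then (1 : ℝ) else 0)
    (fun D => udIndicator_monotone τ φ D) (fun C => udIndicator_antitone τ φ C)
    (fun D => udIndicator_monotone τ φ' D) (fun C => udIndicator_antitone τ φ' C)
  rw [← sepEv_eq] at key
  simp only [biUnion_image] at key
  simp only [TwoSetConditionalAssociation.predIndicator_eq_indicator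
      (fun ω => φ.ud τ (⋃ i ∈ S, openEdgeCluster ω (τ i)) (⋃ j ∈ T, openEdgeCluster ω (τ j))),
    TwoSetConditionalAssociation.predIndicator_eq_indicator
      (fun ω => φ'.ud τ (⋃ i ∈ S, openEdgeCluster ω (τ i)) (⋃ j ∈ T, openEdgeCluster ω (τ j))),
    TripodExchange.setIntegral_indicator_one_eq, TripodExchange.setIntegral_indicator_mul_indicator_eq,
    setOf_ud_eq_ev τ S T φ hφ, setOf_ud_eq_ev τ S T φ' hφ'] at key
  exact key

/-- **Row shape `posB`** (two B-type events): the same with the roles of `S` and `T` exchanged.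
[cite: VandenbergHaggstromKahn2005, Thm. 2.1 (p. 9) at q = 1; Remark 1 after Thm. 1.2 (p. 5)] -/
theorem row_posB (S T : Finset (Fin 4)) (ψ ψ' : TForm) (hψ : ψ.isB S T = true) (hψ' : ψ'.isB S T = true) :
    (prodBernoulli w).real (sepEv τ S T ∩ ev τ ψ) * (prodBernoulli w).real (sepEv τ S T ∩ ev τ ψ') ≤
      (prodBernoulli w).real (sepEv τ S T) * (prodBernoulli w).real (sepEv τ S T ∩ (ev τ ψ ∩ ev τ ψ')) := by
  rw [sepEv_comm]
  exact row_posA w τ T S ψ ψ' hψ hψ'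

/-- **Row shape `neg`** (an A-type and a B-type event are negatively correlated given `D`):
`μ(D) · μ(D ∩ A ∩ B) ≤ μ(D ∩ A) · μ(D ∩ B)` (from `posA` for `A` and `¬B`).
[cite: VandenbergHaggstromKahn2005, Thm. 2.1 (p. 9) at q = 1; Thm. 1.4 (p. 7)] -/
theorem row_neg (S T : Finset (Fin 4)) (φ ψ : TForm) (hφ : φ.isA S T = true) (hψ : ψ.isB S T = true) :
    (prodBernoulli w).real (sepEv τ S T) * (prodBernoulli w).real (sepEv τ S T ∩ (ev τ φ ∩ ev τ ψ)) ≤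
      (prodBernoulli w).real (sepEv τ S T ∩ ev τ φ) * (prodBernoulli w).real (sepEv τ S T ∩ ev τ ψ) := by
  have key := row_posA w τ S T φ ψ.neg hφ (TForm.isA_neg S T ψ hψ)
  set μ := prodBernoulli w with hμ
  set D := sepEv τ S T with hD
  have h1 : μ.real (D ∩ ev τ ψ.neg) = μ.real D - μ.real (D ∩ ev τ ψ) := by
    rw [ev_neg, ← Set.sdiff_eq]
    have := measureReal_inter_add_sdiff (μ := μ) (s := D) (MeasurableSet.of_discrete (s := ev τ ψ))
    linarith
  have h2 : μ.real (D ∩ (ev τ φ ∩ ev τ ψ.neg)) = μ.real (D ∩ ev τ φ) - μ.real (D ∩ (ev τ φ ∩ ev τ ψ)) := by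
    rw [ev_neg, ← Set.inter_assoc, ← Set.sdiff_eq, ← Set.inter_assoc]
    have := measureReal_inter_add_sdiff (μ := μ) (s := D ∩ ev τ φ) (MeasurableSet.of_discrete (s := ev τ ψ))
    linarith
  rw [h1, h2] at key
  nlinarith [key]

/-- **Row shape `x4`** (cluster-event exchange): for A-type `A₁, A₂` and B-type `B₁, B₂`,
`μ(D ∩ A₁ ∩ B₁) · μ(D ∩ A₂ ∩ B₂) ≤ μ(D ∩ A₁ ∩ A₂) · μ(D ∩ B₁ ∩ B₂)` — from `posA`, `posB` and two
`neg` rows by `m²·L₁L₂ ≤ (a₁b₁)(a₂b₂) = (a₁a₂)(b₁b₂) ≤ m²·R₁R₂` (as in the tree's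
`setClusterEventExchange`). [cite: VandenbergHaggstromKahn2005, Thm. 2.1 (p. 9) at q = 1; Remarks 1–2 after Thm. 1.2 (p. 5)] -/
theorem row_x4 (S T : Finset (Fin 4)) (φ₁ φ₂ ψ₁ ψ₂ : TForm) (hφ₁ : φ₁.isA S T = true)
    (hφ₂ : φ₂.isA S T = true) (hψ₁ : ψ₁.isB S T = true) (hψ₂ : ψ₂.isB S T = true) :
    (prodBernoulli w).real (sepEv τ S T ∩ (ev τ φ₁ ∩ ev τ ψ₁)) *
        (prodBernoulli w).real (sepEv τ S T ∩ (ev τ φ₂ ∩ ev τ ψ₂)) ≤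
      (prodBernoulli w).real (sepEv τ S T ∩ (ev τ φ₁ ∩ ev τ φ₂)) *
        (prodBernoulli w).real (sepEv τ S T ∩ (ev τ ψ₁ ∩ ev τ ψ₂)) := by
  have key_a := row_posA w τ S T φ₁ φ₂ hφ₁ hφ₂
  have key_b := row_posB w τ S T ψ₁ ψ₂ hψ₁ hψ₂
  have key_c := row_neg w τ S T φ₁ ψ₁ hφ₁ hψ₁
  have key_d := row_neg w τ S T φ₂ ψ₂ hφ₂ hψ₂
  set μ := prodBernoulli w with hμ
  set D := sepEv τ S T with hD
  set m := μ.real D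
  set a1 := μ.real (D ∩ ev τ φ₁)
  set a2 := μ.real (D ∩ ev τ φ₂)
  set b1 := μ.real (D ∩ ev τ ψ₁)
  set b2 := μ.real (D ∩ ev τ ψ₂)
  set L1 := μ.real (D ∩ (ev τ φ₁ ∩ ev τ ψ₁))
  set L2 := μ.real (D ∩ (ev τ φ₂ ∩ ev τ ψ₂))
  set R1 := μ.real (D ∩ (ev τ φ₁ ∩ ev τ φ₂))
  set R2 := μ.real (D ∩ (ev τ ψ₁ ∩ ev τ ψ₂))
  have hm0 : 0 ≤ m := measureReal_nonneg
  have ha1 : 0 ≤ a1 := measureReal_nonneg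
  have hb1 : 0 ≤ b1 := measureReal_nonneg
  have hb2 : 0 ≤ b2 := measureReal_nonneg
  have hL2 : 0 ≤ L2 := measureReal_nonneg
  have hR1 : 0 ≤ R1 := measureReal_nonneg
  have hR2 : 0 ≤ R2 := measureReal_nonneg
  have hL1m : L1 ≤ m := measureReal_mono inter_subset_left
  rcases hm0.eq_or_lt with hm | hm
  · have hL10 : L1 = 0 := le_antisymm (hm ▸ hL1m) measureReal_nonneg
    rw [hL10, zero_mul]
    exact mul_nonneg hR1 hR2
  · have h1 : m * L1 * (m * L2) ≤ a1 * b1 * (a2 * b2) :=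
      mul_le_mul key_c key_d (mul_nonneg hm0 hL2) (mul_nonneg ha1 hb1)
    have h2 : a1 * a2 * (b1 * b2) ≤ m * R1 * (m * R2) :=
      mul_le_mul key_a key_b (mul_nonneg hb1 hb2) (mul_nonneg hm0 hR1)
    have h3 : m * m * (L1 * L2) ≤ m * m * (R1 * R2) :=
      calc m * m * (L1 * L2) = m * L1 * (m * L2) := by ring
        _ ≤ a1 * b1 * (a2 * b2) := h1
        _ = a1 * a2 * (b1 * b2) := by ring
        _ ≤ m * R1 * (m * R2) := h2
        _ = m * m * (R1 * R2) := by ring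
    exact le_of_mul_le_mul_left h3 (mul_pos hm hm)

end Rows

/-! ### The fifteen cells -/

section Cells

/-- The literal matrix of a configuration: `lit ω i j = true` iff `τ i ↔ τ j`. [folklore] -/
def lit (τ : Fin 4 → V) (ω : BondConfig V) (i j : Fin 4) : Bool :=
  decide ((openGraph ω).Reachable (τ i) (τ j))

/-- The event of a formula is read off the literal matrix. [folklore] -/
theorem mem_ev_iff_eval (τ : Fin 4 → V) (φ : TForm) (ω : BondConfig V) :
    ω ∈ ev τ φ ↔ φ.eval (lit τ ω) = true := by
  rw [mem_ev, ← TForm.holds_iff_eval]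
  simp only [lit, decide_eq_true_eq]

/-- The 15 set partitions of `{0,1,2,3}` as restricted-growth strings (block of each terminal =
index of its least member's block, in order of first appearance), in the order used by the
certificate engine. [folklore] -/
def rgs : Fin 15 → Fin 4 → Fin 4 :=
  ![![0,0,0,0], ![0,0,0,1], ![0,0,1,0], ![0,0,1,1], ![0,0,1,2], ![0,1,0,0], ![0,1,0,1], ![0,1,0,2],
    ![0,1,1,0], ![0,1,1,1], ![0,1,1,2], ![0,1,2,0], ![0,1,2,1], ![0,1,2,2], ![0,1,2,3]]

/-- The literal matrix of the `p`-th cell. [folklore] -/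
def cellPat (p : Fin 15) (i j : Fin 4) : Bool := decide (rgs p i = rgs p j)

/-- The symmetric Boolean matrix with `true` diagonal and the six given upper entries. [folklore] -/
def mat6 (b01 b02 b03 b12 b13 b23 : Bool) : Fin 4 → Fin 4 → Bool :=
  ![![true, b01, b02, b03], ![b01, true, b12, b13], ![b02, b12, true, b23], ![b03, b13, b23, true]]

/-- Transitivity of a Boolean matrix on four points. [folklore] -/
def IsTransB (β : Fin 4 → Fin 4 → Bool) : Prop := ∀ i j k : Fin 4, β i j = true → β j k = true → β i k = true

/-- `IsTransB` is decidable (a finite conjunction over `Fin 4`). [folklore] -/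
instance instDecidableIsTransB (β : Fin 4 → Fin 4 → Bool) : Decidable (IsTransB β) := by
  unfold IsTransB; infer_instance

/-- **Every transitive pattern of the six connection literals of four points is one of the 15 cell
patterns** (Bell number `B₄ = 15`; the `2^6` cases are checked by `decide`). [folklore] -/
theorem exists_cellPat_mat6 : ∀ b01 b02 b03 b12 b13 b23 : Bool, IsTransB (mat6 b01 b02 b03 b12 b13 b23) →
    ∃ p : Fin 15, ∀ i j : Fin 4, cellPat p i j = mat6 b01 b02 b03 b12 b13 b23 i j := by
  decide

/-- A reflexive symmetric Boolean matrix is `mat6` of its upper entries. [folklore] -/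
theorem eq_mat6 (β : Fin 4 → Fin 4 → Bool) (hrefl : ∀ i, β i i = true) (hsymm : ∀ i j, β i j = β j i) :
    β = mat6 (β 0 1) (β 0 2) (β 0 3) (β 1 2) (β 1 3) (β 2 3) := by
  funext i j
  fin_cases i <;> fin_cases j <;> simp [mat6, hrefl] <;> exact hsymm _ _

/-- Hence every configuration lies in one of the 15 cells: the literal matrix of a configuration is
reflexive, symmetric and transitive. [folklore] -/
theorem exists_cellPat_eq (τ : Fin 4 → V) (ω : BondConfig V) : ∃ p : Fin 15, cellPat p = lit τ ω := by
  have hrefl : ∀ i, lit τ ω i i = true := fun i => by simp [lit]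
  have hsymm : ∀ i j, lit τ ω i j = lit τ ω j i := fun i j => by
    simp only [lit]; rw [Bool.decide_congr SimpleGraph.reachable_comm]
  have htrans : IsTransB (lit τ ω) := fun i j k hij hjk => by
    simp only [lit, decide_eq_true_eq] at hij hjk ⊢; exact hij.trans hjk
  have hm := eq_mat6 (lit τ ω) hrefl hsymm
  rw [hm] at htrans
  obtain ⟨p, hp⟩ := exists_cellPat_mat6 _ _ _ _ _ _ htrans
  refine ⟨p, ?_⟩
  rw [hm]
  funext i j
  exact hp i j

/-- The cell patterns are pairwise distinct. [folklore] -/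
theorem cellPat_injective : Function.Injective cellPat := by
  intro p q h
  have : ∀ p q : Fin 15, cellPat p = cellPat q → p = q := by decide
  exact this p q h

/-- The `p`-th cell: the configurations whose four terminals are connected according to the `p`-th
partition. [folklore] -/
def cell (τ : Fin 4 → V) (p : Fin 15) : Set (BondConfig V) := {ω | lit τ ω = cellPat p}

variable [Fintype V] (w : Sym2 V → unitInterval) (τ : Fin 4 → V)

/-- **The probability of a formula event is the sum of its cells.** [folklore] -/
theorem real_ev_eq_sum (φ : TForm) :
    (prodBernoulli w).real (ev τ φ) =
      ∑ p ∈ (Finset.univ : Finset (Fin 15)).filter (fun p => φ.eval (cellPat p) = true),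
        (prodBernoulli w).real (cell τ p) := by
  have hdec : ev τ φ = ⋃ p ∈ (Finset.univ : Finset (Fin 15)).filter (fun p => φ.eval (cellPat p) = true),
      cell τ p := by
    ext ω
    simp only [mem_iUnion, Finset.mem_filter, Finset.mem_univ, true_and, exists_prop, cell, mem_setOf_eq]
    rw [mem_ev_iff_eval]
    constructor
    · intro h
      obtain ⟨p, hp⟩ := exists_cellPat_eq τ ω
      exact ⟨p, by rw [hp]; exact h, hp.symm⟩
    · rintro ⟨p, hp, hω⟩
      rw [hω]; exact hp
  have hdisj : (↑((Finset.univ : Finset (Fin 15)).filter (fun p => φ.eval (cellPat p) = true)) :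
      Set (Fin 15)).PairwiseDisjoint (cell τ) := by
    intro p _ q _ hpq
    simp only [Function.onFun]
    rw [Set.disjoint_left]
    rintro ω (h1 : _ = _) (h2 : _ = _)
    exact hpq (cellPat_injective (h1.symm.trans h2))
  rw [hdec, measureReal_biUnion_finset hdisj (fun p _ => MeasurableSet.of_discrete)]

/-- Cell decomposition with an explicit list of cells (for `decide`d cell lists). [folklore] -/
theorem real_ev_eq_list (φ : TForm) (l : List (Fin 15)) (hl : l.Nodup)
    (h : ∀ p : Fin 15, p ∈ l ↔ φ.eval (cellPat p) = true) :
    (prodBernoulli w).real (ev τ φ) = (l.map fun p => (prodBernoulli w).real (cell τ p)).sum := by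
  rw [real_ev_eq_sum]
  have hset : (Finset.univ : Finset (Fin 15)).filter (fun p => φ.eval (cellPat p) = true) = l.toFinset := by
    ext p
    simp only [Finset.mem_filter, Finset.mem_univ, true_and, List.mem_toFinset]
    exact (h p).symm
  rw [hset, List.sum_toFinset _ hl]

end Cells

/-! ### Events of literals and of the target -/

section Target

variable (τ : Fin 4 → V)

/-- `ev (φ ∨ ψ) = ev φ ∪ ev ψ`. [folklore] -/
theorem ev_or (φ ψ : TForm) : ev τ (φ.or ψ) = ev τ φ ∪ ev τ ψ := rfl

/-- `ev (i ~ j) = {τ i ↔ τ j}`. [folklore] -/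
theorem ev_conn (i j : Fin 4) : ev τ (.conn i j) = openConn (τ i) (τ j) := rfl

/-- `{0 ↔ A}` for `A = {a₁, a₂, a₃}`: `⋃_{b ∈ A} {0 ↔ b}` (as in the tree's `knMatrix`). [cite: KozmaNitzan2024, §5.2 Thm. 11 (p. 33)] -/
def connA (o a₁ a₂ a₃ : V) : Set (BondConfig V) := ⋃ b ∈ ({a₁, a₂, a₃} : Finset V), openConn o b

/-- `{0 ↔ A}` as the event of the formula `0~1 ∨ 0~2 ∨ 0~3` for the terminals `(o, a₁, a₂, a₃)`. [folklore] -/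
theorem connA_eq_ev (o a₁ a₂ a₃ : V) :
    connA o a₁ a₂ a₃ = ev ![o, a₁, a₂, a₃] (.or (.conn 0 1) (.or (.conn 0 2) (.conn 0 3))) := by
  rw [ev_or, ev_or, ev_conn, ev_conn, ev_conn]
  ext ω
  simp only [connA, mem_iUnion, exists_prop, Finset.mem_insert, Finset.mem_singleton, mem_union,
    Matrix.cons_val_zero, Matrix.cons_val_one]
  constructor
  · rintro ⟨b, (rfl | rfl | rfl), hb⟩
    · exact Or.inl hb
    · exact Or.inr (Or.inl hb)
    · exact Or.inr (Or.inr hb)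
  · rintro (h | h | h)
    · exact ⟨a₁, Or.inl rfl, h⟩
    · exact ⟨a₂, Or.inr (Or.inl rfl), h⟩
    · exact ⟨a₃, Or.inr (Or.inr rfl), h⟩

variable [Fintype V] (w : Sym2 V → unitInterval)

/-- `u = P(0 ↔ A)` (the diagonal entry of `M`). [cite: KozmaNitzan2024, §5.2 Thm. 11 (p. 33)] -/
def uMass (o a₁ a₂ a₃ : V) : ℝ := (prodBernoulli w).real (connA o a₁ a₂ a₃)

/-- `M_{aa′} = P(0 ↔ A, a ↔ a′)`. [cite: KozmaNitzan2024, §5.2 Thm. 11 (p. 33)] -/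
def mMass (o a₁ a₂ a₃ a a' : V) : ℝ := (prodBernoulli w).real (connA o a₁ a₂ a₃ ∩ openConn a a')

/-- `r_a = P(0 ↔ a)` (the right-hand side of the harmonic system). [cite: KozmaNitzan2024, §5.2 Thm. 11 (p. 33)] -/
def rMass (o a : V) : ℝ := (prodBernoulli w).real (openConn o a)

/-- `det M^{(1)}`: the determinant of `M` with its first column replaced by `r` (Cramer numerator of
`c_{a₁}`), written out for the symmetric `3 × 3` matrix `M = [[u, m₁₂, m₁₃], [m₁₂, u, m₂₃], [m₁₃, m₂₃, u]]`.
[cite: KozmaNitzan2024, §5.2 Thm. 11 (p. 33)] -/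
def detM1 (o a₁ a₂ a₃ : V) : ℝ :=
  rMass w o a₁ * (uMass w o a₁ a₂ a₃ * uMass w o a₁ a₂ a₃ - mMass w o a₁ a₂ a₃ a₂ a₃ * mMass w o a₁ a₂ a₃ a₂ a₃) -
    mMass w o a₁ a₂ a₃ a₁ a₂ * (rMass w o a₂ * uMass w o a₁ a₂ a₃ - mMass w o a₁ a₂ a₃ a₂ a₃ * rMass w o a₃) +
    mMass w o a₁ a₂ a₃ a₁ a₃ * (rMass w o a₂ * mMass w o a₁ a₂ a₃ a₂ a₃ - uMass w o a₁ a₂ a₃ * rMass w o a₃)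

/-- `det M = u³ + 2 m₁₂ m₁₃ m₂₃ − u (m₁₂² + m₁₃² + m₂₃²)`. [cite: KozmaNitzan2024, §5.2 Thm. 11 (p. 33)] -/
def detM (o a₁ a₂ a₃ : V) : ℝ :=
  uMass w o a₁ a₂ a₃ ^ 3 + 2 * mMass w o a₁ a₂ a₃ a₁ a₂ * mMass w o a₁ a₂ a₃ a₁ a₃ * mMass w o a₁ a₂ a₃ a₂ a₃ -
    uMass w o a₁ a₂ a₃ * (mMass w o a₁ a₂ a₃ a₁ a₂ ^ 2 + mMass w o a₁ a₂ a₃ a₁ a₃ ^ 2 + mMass w o a₁ a₂ a₃ a₂ a₃ ^ 2)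

end Target

/-! ### The certificate: `det M^{(1)} ≥ 0` -/

section Certificate

variable [Fintype V] (w : Sym2 V → unitInterval)

set_option maxHeartbeats 4000000 in
/-- **`det M^{(1)} ≥ 0` for every finite weighted graph and every four vertices** (the `c_{a₁} ≥ 0`
numerator of Kozma–Nitzan's Theorem 11): an exact degree-3 sum-of-products certificate — 36 two-set
BHK rows (`row_posA` / `row_posB` / `row_neg` / `row_x4`), each multiplied by a nonnegative rational and a
cell (or event) probability, plus 51 nonnegative monomials in the cell probabilities, summing
IDENTICALLY (as polynomials in the 15 cell probabilities) to `det M^{(1)}`.  Certificate found by the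
ttrl2 engine (`harness/ttrl/kn11_lp.py`; `run/shared/lean/ttrl/kn11/cert_kn11_C1_D3.json`), transcribed
mechanically; the final identity is checked by `ring`.
[cite: KozmaNitzan2024, §5.2 Thm. 11 (p. 33) — the c_a ≥ 0 half, proved here] -/
theorem detM1_nonneg (o a₁ a₂ a₃ : V) : 0 ≤ detM1 w o a₁ a₂ a₃ := by
  set τ : Fin 4 → V := ![o, a₁, a₂, a₃] with hτ
-- GENERATED from run/shared/lean/ttrl/kn11/cert_kn11_C1_D3.json by kn11/emit.py (prim-gen-literature gen 10)
  -- separation events of the six (S,T) pairs as formula events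
  have hD0 : sepEv τ ({3} : Finset (Fin 4)) ({1, 2} : Finset (Fin 4)) = ev τ (.and (.sep 3 1) (.sep 3 2)) := by
    ext ω; simp [sepEv, mem_ev, TForm.holds]
  have hD1 : sepEv τ ({1} : Finset (Fin 4)) ({3} : Finset (Fin 4)) = ev τ (.sep 1 3) := by
    ext ω; simp [sepEv, mem_ev, TForm.holds]
  have hD2 : sepEv τ ({2} : Finset (Fin 4)) ({1, 3} : Finset (Fin 4)) = ev τ (.and (.sep 2 1) (.sep 2 3)) := by
    ext ω; simp [sepEv, mem_ev, TForm.holds]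
  have hD3 : sepEv τ ({1} : Finset (Fin 4)) ({2} : Finset (Fin 4)) = ev τ (.sep 1 2) := by
    ext ω; simp [sepEv, mem_ev, TForm.holds]
  have hD4 : sepEv τ ({1} : Finset (Fin 4)) ({2, 3} : Finset (Fin 4)) = ev τ (.and (.sep 1 2) (.sep 1 3)) := by
    ext ω; simp [sepEv, mem_ev, TForm.holds]
  have hD5 : sepEv τ ({2} : Finset (Fin 4)) ({3} : Finset (Fin 4)) = ev τ (.sep 2 3) := by
    ext ω; simp [sepEv, mem_ev, TForm.holds]
  -- cell decompositions of the 90 event formulas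
  have e0 : (prodBernoulli w).real (ev τ (.or (.conn 0 1) (.or (.conn 0 2) (.conn 0 3)))) = ((prodBernoulli w).real (cell τ 0) + ((prodBernoulli w).real (cell τ 1) + ((prodBernoulli w).real (cell τ 2) + ((prodBernoulli w).real (cell τ 3) + ((prodBernoulli w).real (cell τ 4) + ((prodBernoulli w).real (cell τ 5) + ((prodBernoulli w).real (cell τ 6) + ((prodBernoulli w).real (cell τ 7) + ((prodBernoulli w).real (cell τ 8) + (prodBernoulli w).real (cell τ 11)))))))))) := by
    rw [real_ev_eq_list w τ (.or (.conn 0 1) (.or (.conn 0 2) (.conn 0 3))) [0, 1, 2, 3, 4, 5, 6, 7, 8, 11] (by decide) (by decide)]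
    simp only [List.map, List.sum_cons, List.sum_nil, add_zero]
  have e1 : (prodBernoulli w).real (ev τ (.and (.or (.conn 0 1) (.or (.conn 0 2) (.conn 0 3))) (.conn 1 2))) = ((prodBernoulli w).real (cell τ 0) + ((prodBernoulli w).real (cell τ 1) + (prodBernoulli w).real (cell τ 8))) := by
    rw [real_ev_eq_list w τ (.and (.or (.conn 0 1) (.or (.conn 0 2) (.conn 0 3))) (.conn 1 2)) [0, 1, 8] (by decide) (by decide)]
    simp only [List.map, List.sum_cons, List.sum_nil, add_zero]
  have e2 : (prodBernoulli w).real (ev τ (.and (.or (.conn 0 1) (.or (.conn 0 2) (.conn 0 3))) (.conn 1 3))) = ((prodBernoulli w).real (cell τ 0) + ((prodBernoulli w).real (cell τ 2) + (prodBernoulli w).real (cell τ 6))) := by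
    rw [real_ev_eq_list w τ (.and (.or (.conn 0 1) (.or (.conn 0 2) (.conn 0 3))) (.conn 1 3)) [0, 2, 6] (by decide) (by decide)]
    simp only [List.map, List.sum_cons, List.sum_nil, add_zero]
  have e3 : (prodBernoulli w).real (ev τ (.and (.or (.conn 0 1) (.or (.conn 0 2) (.conn 0 3))) (.conn 2 3))) = ((prodBernoulli w).real (cell τ 0) + ((prodBernoulli w).real (cell τ 3) + (prodBernoulli w).real (cell τ 5))) := by
    rw [real_ev_eq_list w τ (.and (.or (.conn 0 1) (.or (.conn 0 2) (.conn 0 3))) (.conn 2 3)) [0, 3, 5] (by decide) (by decide)]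
    simp only [List.map, List.sum_cons, List.sum_nil, add_zero]
  have e4 : (prodBernoulli w).real (ev τ (.conn 0 1)) = ((prodBernoulli w).real (cell τ 0) + ((prodBernoulli w).real (cell τ 1) + ((prodBernoulli w).real (cell τ 2) + ((prodBernoulli w).real (cell τ 3) + (prodBernoulli w).real (cell τ 4))))) := by
    rw [real_ev_eq_list w τ (.conn 0 1) [0, 1, 2, 3, 4] (by decide) (by decide)]
    simp only [List.map, List.sum_cons, List.sum_nil, add_zero]
  have e5 : (prodBernoulli w).real (ev τ (.conn 0 2)) = ((prodBernoulli w).real (cell τ 0) + ((prodBernoulli w).real (cell τ 1) + ((prodBernoulli w).real (cell τ 5) + ((prodBernoulli w).real (cell τ 6) + (prodBernoulli w).real (cell τ 7))))) := by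
    rw [real_ev_eq_list w τ (.conn 0 2) [0, 1, 5, 6, 7] (by decide) (by decide)]
    simp only [List.map, List.sum_cons, List.sum_nil, add_zero]
  have e6 : (prodBernoulli w).real (ev τ (.conn 0 3)) = ((prodBernoulli w).real (cell τ 0) + ((prodBernoulli w).real (cell τ 2) + ((prodBernoulli w).real (cell τ 5) + ((prodBernoulli w).real (cell τ 8) + (prodBernoulli w).real (cell τ 11))))) := by
    rw [real_ev_eq_list w τ (.conn 0 3) [0, 2, 5, 8, 11] (by decide) (by decide)]
    simp only [List.map, List.sum_cons, List.sum_nil, add_zero]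
  have e7 : (prodBernoulli w).real (ev τ (.and (.and (.sep 3 1) (.sep 3 2)) (.conn 3 0))) = ((prodBernoulli w).real (cell τ 8) + (prodBernoulli w).real (cell τ 11)) := by
    rw [real_ev_eq_list w τ (.and (.and (.sep 3 1) (.sep 3 2)) (.conn 3 0)) [8, 11] (by decide) (by decide)]
    simp only [List.map, List.sum_cons, List.sum_nil, add_zero]
  have e8 : (prodBernoulli w).real (ev τ (.and (.and (.sep 3 1) (.sep 3 2)) (.and (.sep 1 0) (.sep 2 0)))) = ((prodBernoulli w).real (cell τ 8) + ((prodBernoulli w).real (cell τ 10) + ((prodBernoulli w).real (cell τ 11) + (prodBernoulli w).real (cell τ 14)))) := by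
    rw [real_ev_eq_list w τ (.and (.and (.sep 3 1) (.sep 3 2)) (.and (.sep 1 0) (.sep 2 0))) [8, 10, 11, 14] (by decide) (by decide)]
    simp only [List.map, List.sum_cons, List.sum_nil, add_zero]
  have e9 : (prodBernoulli w).real (ev τ (.and (.sep 3 1) (.sep 3 2))) = ((prodBernoulli w).real (cell τ 1) + ((prodBernoulli w).real (cell τ 4) + ((prodBernoulli w).real (cell τ 7) + ((prodBernoulli w).real (cell τ 8) + ((prodBernoulli w).real (cell τ 10) + ((prodBernoulli w).real (cell τ 11) + (prodBernoulli w).real (cell τ 14))))))) := by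
    rw [real_ev_eq_list w τ (.and (.sep 3 1) (.sep 3 2)) [1, 4, 7, 8, 10, 11, 14] (by decide) (by decide)]
    simp only [List.map, List.sum_cons, List.sum_nil, add_zero]
  have e10 : (prodBernoulli w).real (ev τ (.and (.and (.sep 3 1) (.sep 3 2)) (.and (.conn 3 0) (.and (.sep 1 0) (.sep 2 0))))) = ((prodBernoulli w).real (cell τ 8) + (prodBernoulli w).real (cell τ 11)) := by
    rw [real_ev_eq_list w τ (.and (.and (.sep 3 1) (.sep 3 2)) (.and (.conn 3 0) (.and (.sep 1 0) (.sep 2 0)))) [8, 11] (by decide) (by decide)]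
    simp only [List.map, List.sum_cons, List.sum_nil, add_zero]
  have e11 : (prodBernoulli w).real (ev τ (.sep 1 3)) = ((prodBernoulli w).real (cell τ 1) + ((prodBernoulli w).real (cell τ 3) + ((prodBernoulli w).real (cell τ 4) + ((prodBernoulli w).real (cell τ 5) + ((prodBernoulli w).real (cell τ 7) + ((prodBernoulli w).real (cell τ 8) + ((prodBernoulli w).real (cell τ 10) + ((prodBernoulli w).real (cell τ 11) + ((prodBernoulli w).real (cell τ 13) + (prodBernoulli w).real (cell τ 14)))))))))) := by
    rw [real_ev_eq_list w τ (.sep 1 3) [1, 3, 4, 5, 7, 8, 10, 11, 13, 14] (by decide) (by decide)]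
    simp only [List.map, List.sum_cons, List.sum_nil, add_zero]
  have e12 : (prodBernoulli w).real (ev τ (.and (.sep 1 3) (.and (.sep 3 0) (.or (.conn 3 2) (.sep 1 0))))) = ((prodBernoulli w).real (cell τ 3) + ((prodBernoulli w).real (cell τ 7) + ((prodBernoulli w).real (cell τ 10) + ((prodBernoulli w).real (cell τ 13) + (prodBernoulli w).real (cell τ 14))))) := by
    rw [real_ev_eq_list w τ (.and (.sep 1 3) (.and (.sep 3 0) (.or (.conn 3 2) (.sep 1 0)))) [3, 7, 10, 13, 14] (by decide) (by decide)]
    simp only [List.map, List.sum_cons, List.sum_nil, add_zero]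
  have e13 : (prodBernoulli w).real (ev τ (.and (.sep 1 3) (.sep 3 0))) = ((prodBernoulli w).real (cell τ 1) + ((prodBernoulli w).real (cell τ 3) + ((prodBernoulli w).real (cell τ 4) + ((prodBernoulli w).real (cell τ 7) + ((prodBernoulli w).real (cell τ 10) + ((prodBernoulli w).real (cell τ 13) + (prodBernoulli w).real (cell τ 14))))))) := by
    rw [real_ev_eq_list w τ (.and (.sep 1 3) (.sep 3 0)) [1, 3, 4, 7, 10, 13, 14] (by decide) (by decide)]
    simp only [List.map, List.sum_cons, List.sum_nil, add_zero]
  have e14 : (prodBernoulli w).real (ev τ (.and (.sep 1 3) (.or (.conn 3 2) (.sep 1 0)))) = ((prodBernoulli w).real (cell τ 3) + ((prodBernoulli w).real (cell τ 5) + ((prodBernoulli w).real (cell τ 7) + ((prodBernoulli w).real (cell τ 8) + ((prodBernoulli w).real (cell τ 10) + ((prodBernoulli w).real (cell τ 11) + ((prodBernoulli w).real (cell τ 13) + (prodBernoulli w).real (cell τ 14)))))))) := by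
    rw [real_ev_eq_list w τ (.and (.sep 1 3) (.or (.conn 3 2) (.sep 1 0))) [3, 5, 7, 8, 10, 11, 13, 14] (by decide) (by decide)]
    simp only [List.map, List.sum_cons, List.sum_nil, add_zero]
  have e15 : (prodBernoulli w).real (ev τ (.and (.sep 2 1) (.sep 2 3))) = ((prodBernoulli w).real (cell τ 2) + ((prodBernoulli w).real (cell τ 4) + ((prodBernoulli w).real (cell τ 6) + ((prodBernoulli w).real (cell τ 7) + ((prodBernoulli w).real (cell τ 11) + ((prodBernoulli w).real (cell τ 12) + (prodBernoulli w).real (cell τ 14))))))) := by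
    rw [real_ev_eq_list w τ (.and (.sep 2 1) (.sep 2 3)) [2, 4, 6, 7, 11, 12, 14] (by decide) (by decide)]
    simp only [List.map, List.sum_cons, List.sum_nil, add_zero]
  have e16 : (prodBernoulli w).real (ev τ (.and (.and (.sep 2 1) (.sep 2 3)) (.and (.sep 1 0) (.sep 2 0)))) = ((prodBernoulli w).real (cell τ 11) + ((prodBernoulli w).real (cell τ 12) + (prodBernoulli w).real (cell τ 14))) := by
    rw [real_ev_eq_list w τ (.and (.and (.sep 2 1) (.sep 2 3)) (.and (.sep 1 0) (.sep 2 0))) [11, 12, 14] (by decide) (by decide)]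
    simp only [List.map, List.sum_cons, List.sum_nil, add_zero]
  have e17 : (prodBernoulli w).real (ev τ (.and (.and (.sep 2 1) (.sep 2 3)) (.sep 1 0))) = ((prodBernoulli w).real (cell τ 6) + ((prodBernoulli w).real (cell τ 7) + ((prodBernoulli w).real (cell τ 11) + ((prodBernoulli w).real (cell τ 12) + (prodBernoulli w).real (cell τ 14))))) := by
    rw [real_ev_eq_list w τ (.and (.and (.sep 2 1) (.sep 2 3)) (.sep 1 0)) [6, 7, 11, 12, 14] (by decide) (by decide)]
    simp only [List.map, List.sum_cons, List.sum_nil, add_zero]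
  have e18 : (prodBernoulli w).real (ev τ (.and (.and (.sep 2 1) (.sep 2 3)) (.sep 2 0))) = ((prodBernoulli w).real (cell τ 2) + ((prodBernoulli w).real (cell τ 4) + ((prodBernoulli w).real (cell τ 11) + ((prodBernoulli w).real (cell τ 12) + (prodBernoulli w).real (cell τ 14))))) := by
    rw [real_ev_eq_list w τ (.and (.and (.sep 2 1) (.sep 2 3)) (.sep 2 0)) [2, 4, 11, 12, 14] (by decide) (by decide)]
    simp only [List.map, List.sum_cons, List.sum_nil, add_zero]
  have e19 : (prodBernoulli w).real (ev τ (.and (.and (.sep 3 1) (.sep 3 2)) (.sep 3 0))) = ((prodBernoulli w).real (cell τ 1) + ((prodBernoulli w).real (cell τ 4) + ((prodBernoulli w).real (cell τ 7) + ((prodBernoulli w).real (cell τ 10) + (prodBernoulli w).real (cell τ 14))))) := by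
    rw [real_ev_eq_list w τ (.and (.and (.sep 3 1) (.sep 3 2)) (.sep 3 0)) [1, 4, 7, 10, 14] (by decide) (by decide)]
    simp only [List.map, List.sum_cons, List.sum_nil, add_zero]
  have e20 : (prodBernoulli w).real (ev τ (.and (.and (.sep 3 1) (.sep 3 2)) (.or (.conn 1 0) (.conn 2 0)))) = ((prodBernoulli w).real (cell τ 1) + ((prodBernoulli w).real (cell τ 4) + (prodBernoulli w).real (cell τ 7))) := by
    rw [real_ev_eq_list w τ (.and (.and (.sep 3 1) (.sep 3 2)) (.or (.conn 1 0) (.conn 2 0))) [1, 4, 7] (by decide) (by decide)]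
    simp only [List.map, List.sum_cons, List.sum_nil, add_zero]
  have e21 : (prodBernoulli w).real (ev τ (.and (.and (.sep 3 1) (.sep 3 2)) (.and (.sep 3 0) (.or (.conn 1 0) (.conn 2 0))))) = ((prodBernoulli w).real (cell τ 1) + ((prodBernoulli w).real (cell τ 4) + (prodBernoulli w).real (cell τ 7))) := by
    rw [real_ev_eq_list w τ (.and (.and (.sep 3 1) (.sep 3 2)) (.and (.sep 3 0) (.or (.conn 1 0) (.conn 2 0)))) [1, 4, 7] (by decide) (by decide)]
    simp only [List.map, List.sum_cons, List.sum_nil, add_zero]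
  have e22 : (prodBernoulli w).real (ev τ (.and (.sep 1 2) (.sep 2 0))) = ((prodBernoulli w).real (cell τ 2) + ((prodBernoulli w).real (cell τ 3) + ((prodBernoulli w).real (cell τ 4) + ((prodBernoulli w).real (cell τ 11) + ((prodBernoulli w).real (cell τ 12) + ((prodBernoulli w).real (cell τ 13) + (prodBernoulli w).real (cell τ 14))))))) := by
    rw [real_ev_eq_list w τ (.and (.sep 1 2) (.sep 2 0)) [2, 3, 4, 11, 12, 13, 14] (by decide) (by decide)]
    simp only [List.map, List.sum_cons, List.sum_nil, add_zero]
  have e23 : (prodBernoulli w).real (ev τ (.and (.sep 1 2) (.and (.conn 1 0) (.sep 2 3)))) = ((prodBernoulli w).real (cell τ 2) + (prodBernoulli w).real (cell τ 4)) := by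
    rw [real_ev_eq_list w τ (.and (.sep 1 2) (.and (.conn 1 0) (.sep 2 3))) [2, 4] (by decide) (by decide)]
    simp only [List.map, List.sum_cons, List.sum_nil, add_zero]
  have e24 : (prodBernoulli w).real (ev τ (.sep 1 2)) = ((prodBernoulli w).real (cell τ 2) + ((prodBernoulli w).real (cell τ 3) + ((prodBernoulli w).real (cell τ 4) + ((prodBernoulli w).real (cell τ 5) + ((prodBernoulli w).real (cell τ 6) + ((prodBernoulli w).real (cell τ 7) + ((prodBernoulli w).real (cell τ 11) + ((prodBernoulli w).real (cell τ 12) + ((prodBernoulli w).real (cell τ 13) + (prodBernoulli w).real (cell τ 14)))))))))) := by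
    rw [real_ev_eq_list w τ (.sep 1 2) [2, 3, 4, 5, 6, 7, 11, 12, 13, 14] (by decide) (by decide)]
    simp only [List.map, List.sum_cons, List.sum_nil, add_zero]
  have e25 : (prodBernoulli w).real (ev τ (.and (.sep 1 2) (.and (.sep 2 0) (.and (.conn 1 0) (.sep 2 3))))) = ((prodBernoulli w).real (cell τ 2) + (prodBernoulli w).real (cell τ 4)) := by
    rw [real_ev_eq_list w τ (.and (.sep 1 2) (.and (.sep 2 0) (.and (.conn 1 0) (.sep 2 3)))) [2, 4] (by decide) (by decide)]
    simp only [List.map, List.sum_cons, List.sum_nil, add_zero]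
  have e26 : (prodBernoulli w).real (ev τ (.and (.and (.sep 2 1) (.sep 2 3)) (.or (.conn 1 0) (.conn 3 0)))) = ((prodBernoulli w).real (cell τ 2) + ((prodBernoulli w).real (cell τ 4) + (prodBernoulli w).real (cell τ 11))) := by
    rw [real_ev_eq_list w τ (.and (.and (.sep 2 1) (.sep 2 3)) (.or (.conn 1 0) (.conn 3 0))) [2, 4, 11] (by decide) (by decide)]
    simp only [List.map, List.sum_cons, List.sum_nil, add_zero]
  have e27 : (prodBernoulli w).real (ev τ (.and (.and (.sep 2 1) (.sep 2 3)) (.and (.sep 2 0) (.or (.conn 1 0) (.conn 3 0))))) = ((prodBernoulli w).real (cell τ 2) + ((prodBernoulli w).real (cell τ 4) + (prodBernoulli w).real (cell τ 11))) := by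
    rw [real_ev_eq_list w τ (.and (.and (.sep 2 1) (.sep 2 3)) (.and (.sep 2 0) (.or (.conn 1 0) (.conn 3 0)))) [2, 4, 11] (by decide) (by decide)]
    simp only [List.map, List.sum_cons, List.sum_nil, add_zero]
  have e28 : (prodBernoulli w).real (ev τ (.and (.sep 1 3) (.and (.conn 1 0) .tt))) = ((prodBernoulli w).real (cell τ 1) + ((prodBernoulli w).real (cell τ 3) + (prodBernoulli w).real (cell τ 4))) := by
    rw [real_ev_eq_list w τ (.and (.sep 1 3) (.and (.conn 1 0) .tt)) [1, 3, 4] (by decide) (by decide)]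
    simp only [List.map, List.sum_cons, List.sum_nil, add_zero]
  have e29 : (prodBernoulli w).real (ev τ (.and (.sep 1 3) (.and (.sep 3 0) (.sep 1 0)))) = ((prodBernoulli w).real (cell τ 7) + ((prodBernoulli w).real (cell τ 10) + ((prodBernoulli w).real (cell τ 13) + (prodBernoulli w).real (cell τ 14)))) := by
    rw [real_ev_eq_list w τ (.and (.sep 1 3) (.and (.sep 3 0) (.sep 1 0))) [7, 10, 13, 14] (by decide) (by decide)]
    simp only [List.map, List.sum_cons, List.sum_nil, add_zero]
  have e30 : (prodBernoulli w).real (ev τ (.and (.sep 1 3) (.and (.conn 1 0) (.sep 3 0)))) = ((prodBernoulli w).real (cell τ 1) + ((prodBernoulli w).real (cell τ 3) + (prodBernoulli w).real (cell τ 4))) := by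
    rw [real_ev_eq_list w τ (.and (.sep 1 3) (.and (.conn 1 0) (.sep 3 0))) [1, 3, 4] (by decide) (by decide)]
    simp only [List.map, List.sum_cons, List.sum_nil, add_zero]
  have e31 : (prodBernoulli w).real (ev τ (.and (.sep 1 3) (.and .tt (.sep 1 0)))) = ((prodBernoulli w).real (cell τ 5) + ((prodBernoulli w).real (cell τ 7) + ((prodBernoulli w).real (cell τ 8) + ((prodBernoulli w).real (cell τ 10) + ((prodBernoulli w).real (cell τ 11) + ((prodBernoulli w).real (cell τ 13) + (prodBernoulli w).real (cell τ 14))))))) := by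
    rw [real_ev_eq_list w τ (.and (.sep 1 3) (.and .tt (.sep 1 0))) [5, 7, 8, 10, 11, 13, 14] (by decide) (by decide)]
    simp only [List.map, List.sum_cons, List.sum_nil, add_zero]
  have e32 : (prodBernoulli w).real (ev τ (.and (.and (.sep 1 2) (.sep 1 3)) (.and (.conn 1 0) .tt))) = ((prodBernoulli w).real (cell τ 3) + (prodBernoulli w).real (cell τ 4)) := by
    rw [real_ev_eq_list w τ (.and (.and (.sep 1 2) (.sep 1 3)) (.and (.conn 1 0) .tt)) [3, 4] (by decide) (by decide)]
    simp only [List.map, List.sum_cons, List.sum_nil, add_zero]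
  have e33 : (prodBernoulli w).real (ev τ (.and (.and (.sep 1 2) (.sep 1 3)) (.and (.sep 3 0) (.sep 1 0)))) = ((prodBernoulli w).real (cell τ 7) + ((prodBernoulli w).real (cell τ 13) + (prodBernoulli w).real (cell τ 14))) := by
    rw [real_ev_eq_list w τ (.and (.and (.sep 1 2) (.sep 1 3)) (.and (.sep 3 0) (.sep 1 0))) [7, 13, 14] (by decide) (by decide)]
    simp only [List.map, List.sum_cons, List.sum_nil, add_zero]
  have e34 : (prodBernoulli w).real (ev τ (.and (.and (.sep 1 2) (.sep 1 3)) (.and (.conn 1 0) (.sep 3 0)))) = ((prodBernoulli w).real (cell τ 3) + (prodBernoulli w).real (cell τ 4)) := by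
    rw [real_ev_eq_list w τ (.and (.and (.sep 1 2) (.sep 1 3)) (.and (.conn 1 0) (.sep 3 0))) [3, 4] (by decide) (by decide)]
    simp only [List.map, List.sum_cons, List.sum_nil, add_zero]
  have e35 : (prodBernoulli w).real (ev τ (.and (.and (.sep 1 2) (.sep 1 3)) (.and .tt (.sep 1 0)))) = ((prodBernoulli w).real (cell τ 5) + ((prodBernoulli w).real (cell τ 7) + ((prodBernoulli w).real (cell τ 11) + ((prodBernoulli w).real (cell τ 13) + (prodBernoulli w).real (cell τ 14))))) := by
    rw [real_ev_eq_list w τ (.and (.and (.sep 1 2) (.sep 1 3)) (.and .tt (.sep 1 0))) [5, 7, 11, 13, 14] (by decide) (by decide)]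
    simp only [List.map, List.sum_cons, List.sum_nil, add_zero]
  have e36 : (prodBernoulli w).real (ev τ (.and (.and (.sep 1 2) (.sep 1 3)) (.sep 1 0))) = ((prodBernoulli w).real (cell τ 5) + ((prodBernoulli w).real (cell τ 7) + ((prodBernoulli w).real (cell τ 11) + ((prodBernoulli w).real (cell τ 13) + (prodBernoulli w).real (cell τ 14))))) := by
    rw [real_ev_eq_list w τ (.and (.and (.sep 1 2) (.sep 1 3)) (.sep 1 0)) [5, 7, 11, 13, 14] (by decide) (by decide)]
    simp only [List.map, List.sum_cons, List.sum_nil, add_zero]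
  have e37 : (prodBernoulli w).real (ev τ (.and (.and (.sep 1 2) (.sep 1 3)) (.or (.conn 2 0) (.conn 3 0)))) = ((prodBernoulli w).real (cell τ 5) + ((prodBernoulli w).real (cell τ 7) + (prodBernoulli w).real (cell τ 11))) := by
    rw [real_ev_eq_list w τ (.and (.and (.sep 1 2) (.sep 1 3)) (.or (.conn 2 0) (.conn 3 0))) [5, 7, 11] (by decide) (by decide)]
    simp only [List.map, List.sum_cons, List.sum_nil, add_zero]
  have e38 : (prodBernoulli w).real (ev τ (.and (.sep 1 2) (.sep 1 3))) = ((prodBernoulli w).real (cell τ 3) + ((prodBernoulli w).real (cell τ 4) + ((prodBernoulli w).real (cell τ 5) + ((prodBernoulli w).real (cell τ 7) + ((prodBernoulli w).real (cell τ 11) + ((prodBernoulli w).real (cell τ 13) + (prodBernoulli w).real (cell τ 14))))))) := by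
    rw [real_ev_eq_list w τ (.and (.sep 1 2) (.sep 1 3)) [3, 4, 5, 7, 11, 13, 14] (by decide) (by decide)]
    simp only [List.map, List.sum_cons, List.sum_nil, add_zero]
  have e39 : (prodBernoulli w).real (ev τ (.and (.and (.sep 1 2) (.sep 1 3)) (.and (.sep 1 0) (.or (.conn 2 0) (.conn 3 0))))) = ((prodBernoulli w).real (cell τ 5) + ((prodBernoulli w).real (cell τ 7) + (prodBernoulli w).real (cell τ 11))) := by
    rw [real_ev_eq_list w τ (.and (.and (.sep 1 2) (.sep 1 3)) (.and (.sep 1 0) (.or (.conn 2 0) (.conn 3 0)))) [5, 7, 11] (by decide) (by decide)]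
    simp only [List.map, List.sum_cons, List.sum_nil, add_zero]
  have e40 : (prodBernoulli w).real (ev τ (.and (.sep 2 3) (.and (.conn 3 0) (.conn 3 1)))) = (prodBernoulli w).real (cell τ 2) := by
    rw [real_ev_eq_list w τ (.and (.sep 2 3) (.and (.conn 3 0) (.conn 3 1))) [2] (by decide) (by decide)]
    simp only [List.map, List.sum_cons, List.sum_nil, add_zero]
  have e41 : (prodBernoulli w).real (ev τ (.and (.sep 2 3) (.or (.sep 2 0) (.sep 2 1)))) = ((prodBernoulli w).real (cell τ 2) + ((prodBernoulli w).real (cell τ 4) + ((prodBernoulli w).real (cell τ 6) + ((prodBernoulli w).real (cell τ 7) + ((prodBernoulli w).real (cell τ 8) + ((prodBernoulli w).real (cell τ 10) + ((prodBernoulli w).real (cell τ 11) + ((prodBernoulli w).real (cell τ 12) + (prodBernoulli w).real (cell τ 14))))))))) := by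
    rw [real_ev_eq_list w τ (.and (.sep 2 3) (.or (.sep 2 0) (.sep 2 1))) [2, 4, 6, 7, 8, 10, 11, 12, 14] (by decide) (by decide)]
    simp only [List.map, List.sum_cons, List.sum_nil, add_zero]
  have e42 : (prodBernoulli w).real (ev τ (.sep 2 3)) = ((prodBernoulli w).real (cell τ 1) + ((prodBernoulli w).real (cell τ 2) + ((prodBernoulli w).real (cell τ 4) + ((prodBernoulli w).real (cell τ 6) + ((prodBernoulli w).real (cell τ 7) + ((prodBernoulli w).real (cell τ 8) + ((prodBernoulli w).real (cell τ 10) + ((prodBernoulli w).real (cell τ 11) + ((prodBernoulli w).real (cell τ 12) + (prodBernoulli w).real (cell τ 14)))))))))) := by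
    rw [real_ev_eq_list w τ (.sep 2 3) [1, 2, 4, 6, 7, 8, 10, 11, 12, 14] (by decide) (by decide)]
    simp only [List.map, List.sum_cons, List.sum_nil, add_zero]
  have e43 : (prodBernoulli w).real (ev τ (.and (.sep 2 3) (.and (.and (.conn 3 0) (.conn 3 1)) (.or (.sep 2 0) (.sep 2 1))))) = (prodBernoulli w).real (cell τ 2) := by
    rw [real_ev_eq_list w τ (.and (.sep 2 3) (.and (.and (.conn 3 0) (.conn 3 1)) (.or (.sep 2 0) (.sep 2 1)))) [2] (by decide) (by decide)]
    simp only [List.map, List.sum_cons, List.sum_nil, add_zero]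
  have e44 : (prodBernoulli w).real (ev τ (.and (.and (.sep 1 2) (.sep 1 3)) (.and .tt (.conn 3 0)))) = ((prodBernoulli w).real (cell τ 5) + (prodBernoulli w).real (cell τ 11)) := by
    rw [real_ev_eq_list w τ (.and (.and (.sep 1 2) (.sep 1 3)) (.and .tt (.conn 3 0))) [5, 11] (by decide) (by decide)]
    simp only [List.map, List.sum_cons, List.sum_nil, add_zero]
  have e45 : (prodBernoulli w).real (ev τ (.and (.and (.sep 1 2) (.sep 1 3)) (.and (.sep 2 0) (.sep 1 0)))) = ((prodBernoulli w).real (cell τ 11) + ((prodBernoulli w).real (cell τ 13) + (prodBernoulli w).real (cell τ 14))) := by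
    rw [real_ev_eq_list w τ (.and (.and (.sep 1 2) (.sep 1 3)) (.and (.sep 2 0) (.sep 1 0))) [11, 13, 14] (by decide) (by decide)]
    simp only [List.map, List.sum_cons, List.sum_nil, add_zero]
  have e46 : (prodBernoulli w).real (ev τ (.and (.and (.sep 1 2) (.sep 1 3)) (.and .tt (.sep 2 0)))) = ((prodBernoulli w).real (cell τ 3) + ((prodBernoulli w).real (cell τ 4) + ((prodBernoulli w).real (cell τ 11) + ((prodBernoulli w).real (cell τ 13) + (prodBernoulli w).real (cell τ 14))))) := by
    rw [real_ev_eq_list w τ (.and (.and (.sep 1 2) (.sep 1 3)) (.and .tt (.sep 2 0))) [3, 4, 11, 13, 14] (by decide) (by decide)]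
    simp only [List.map, List.sum_cons, List.sum_nil, add_zero]
  have e47 : (prodBernoulli w).real (ev τ (.and (.and (.sep 1 2) (.sep 1 3)) (.and (.conn 3 0) (.sep 1 0)))) = ((prodBernoulli w).real (cell τ 5) + (prodBernoulli w).real (cell τ 11)) := by
    rw [real_ev_eq_list w τ (.and (.and (.sep 1 2) (.sep 1 3)) (.and (.conn 3 0) (.sep 1 0))) [5, 11] (by decide) (by decide)]
    simp only [List.map, List.sum_cons, List.sum_nil, add_zero]
  have e48 : (prodBernoulli w).real (ev τ (.and (.and (.sep 1 2) (.sep 1 3)) (.conn 2 0))) = ((prodBernoulli w).real (cell τ 5) + (prodBernoulli w).real (cell τ 7)) := by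
    rw [real_ev_eq_list w τ (.and (.and (.sep 1 2) (.sep 1 3)) (.conn 2 0)) [5, 7] (by decide) (by decide)]
    simp only [List.map, List.sum_cons, List.sum_nil, add_zero]
  have e49 : (prodBernoulli w).real (ev τ (.and (.and (.sep 1 2) (.sep 1 3)) (.and (.conn 2 0) (.sep 1 0)))) = ((prodBernoulli w).real (cell τ 5) + (prodBernoulli w).real (cell τ 7)) := by
    rw [real_ev_eq_list w τ (.and (.and (.sep 1 2) (.sep 1 3)) (.and (.conn 2 0) (.sep 1 0))) [5, 7] (by decide) (by decide)]
    simp only [List.map, List.sum_cons, List.sum_nil, add_zero]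
  have e50 : (prodBernoulli w).real (ev τ (.and (.sep 2 3) (.and (.or (.sep 3 0) (.sep 3 1)) (.sep 2 0)))) = ((prodBernoulli w).real (cell τ 4) + ((prodBernoulli w).real (cell τ 8) + ((prodBernoulli w).real (cell τ 10) + ((prodBernoulli w).real (cell τ 11) + ((prodBernoulli w).real (cell τ 12) + (prodBernoulli w).real (cell τ 14)))))) := by
    rw [real_ev_eq_list w τ (.and (.sep 2 3) (.and (.or (.sep 3 0) (.sep 3 1)) (.sep 2 0))) [4, 8, 10, 11, 12, 14] (by decide) (by decide)]
    simp only [List.map, List.sum_cons, List.sum_nil, add_zero]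
  have e51 : (prodBernoulli w).real (ev τ (.and (.sep 2 3) (.or (.sep 3 0) (.sep 3 1)))) = ((prodBernoulli w).real (cell τ 1) + ((prodBernoulli w).real (cell τ 4) + ((prodBernoulli w).real (cell τ 6) + ((prodBernoulli w).real (cell τ 7) + ((prodBernoulli w).real (cell τ 8) + ((prodBernoulli w).real (cell τ 10) + ((prodBernoulli w).real (cell τ 11) + ((prodBernoulli w).real (cell τ 12) + (prodBernoulli w).real (cell τ 14))))))))) := by
    rw [real_ev_eq_list w τ (.and (.sep 2 3) (.or (.sep 3 0) (.sep 3 1))) [1, 4, 6, 7, 8, 10, 11, 12, 14] (by decide) (by decide)]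
    simp only [List.map, List.sum_cons, List.sum_nil, add_zero]
  have e52 : (prodBernoulli w).real (ev τ (.and (.sep 2 3) (.sep 2 0))) = ((prodBernoulli w).real (cell τ 2) + ((prodBernoulli w).real (cell τ 4) + ((prodBernoulli w).real (cell τ 8) + ((prodBernoulli w).real (cell τ 10) + ((prodBernoulli w).real (cell τ 11) + ((prodBernoulli w).real (cell τ 12) + (prodBernoulli w).real (cell τ 14))))))) := by
    rw [real_ev_eq_list w τ (.and (.sep 2 3) (.sep 2 0)) [2, 4, 8, 10, 11, 12, 14] (by decide) (by decide)]
    simp only [List.map, List.sum_cons, List.sum_nil, add_zero]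
  have e53 : (prodBernoulli w).real (ev τ (.and (.and (.sep 1 2) (.sep 1 3)) (.conn 1 0))) = ((prodBernoulli w).real (cell τ 3) + (prodBernoulli w).real (cell τ 4)) := by
    rw [real_ev_eq_list w τ (.and (.and (.sep 1 2) (.sep 1 3)) (.conn 1 0)) [3, 4] (by decide) (by decide)]
    simp only [List.map, List.sum_cons, List.sum_nil, add_zero]
  have e54 : (prodBernoulli w).real (ev τ (.and (.and (.sep 1 2) (.sep 1 3)) (.sep 2 0))) = ((prodBernoulli w).real (cell τ 3) + ((prodBernoulli w).real (cell τ 4) + ((prodBernoulli w).real (cell τ 11) + ((prodBernoulli w).real (cell τ 13) + (prodBernoulli w).real (cell τ 14))))) := by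
    rw [real_ev_eq_list w τ (.and (.and (.sep 1 2) (.sep 1 3)) (.sep 2 0)) [3, 4, 11, 13, 14] (by decide) (by decide)]
    simp only [List.map, List.sum_cons, List.sum_nil, add_zero]
  have e55 : (prodBernoulli w).real (ev τ (.and (.and (.sep 1 2) (.sep 1 3)) (.and (.conn 1 0) (.sep 2 0)))) = ((prodBernoulli w).real (cell τ 3) + (prodBernoulli w).real (cell τ 4)) := by
    rw [real_ev_eq_list w τ (.and (.and (.sep 1 2) (.sep 1 3)) (.and (.conn 1 0) (.sep 2 0))) [3, 4] (by decide) (by decide)]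
    simp only [List.map, List.sum_cons, List.sum_nil, add_zero]
  have e56 : (prodBernoulli w).real (ev τ (.and (.sep 2 3) (.conn 3 0))) = ((prodBernoulli w).real (cell τ 2) + ((prodBernoulli w).real (cell τ 8) + (prodBernoulli w).real (cell τ 11))) := by
    rw [real_ev_eq_list w τ (.and (.sep 2 3) (.conn 3 0)) [2, 8, 11] (by decide) (by decide)]
    simp only [List.map, List.sum_cons, List.sum_nil, add_zero]
  have e57 : (prodBernoulli w).real (ev τ (.and (.sep 2 3) (.and (.conn 3 0) (.sep 2 0)))) = ((prodBernoulli w).real (cell τ 2) + ((prodBernoulli w).real (cell τ 8) + (prodBernoulli w).real (cell τ 11))) := by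
    rw [real_ev_eq_list w τ (.and (.sep 2 3) (.and (.conn 3 0) (.sep 2 0))) [2, 8, 11] (by decide) (by decide)]
    simp only [List.map, List.sum_cons, List.sum_nil, add_zero]
  have e58 : (prodBernoulli w).real (ev τ (.and (.and (.sep 1 2) (.sep 1 3)) (.and .tt (.sep 3 0)))) = ((prodBernoulli w).real (cell τ 3) + ((prodBernoulli w).real (cell τ 4) + ((prodBernoulli w).real (cell τ 7) + ((prodBernoulli w).real (cell τ 13) + (prodBernoulli w).real (cell τ 14))))) := by
    rw [real_ev_eq_list w τ (.and (.and (.sep 1 2) (.sep 1 3)) (.and .tt (.sep 3 0))) [3, 4, 7, 13, 14] (by decide) (by decide)]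
    simp only [List.map, List.sum_cons, List.sum_nil, add_zero]
  have e59 : (prodBernoulli w).real (ev τ (.and (.sep 2 3) (.and (.conn 2 0) (.conn 3 1)))) = (prodBernoulli w).real (cell τ 6) := by
    rw [real_ev_eq_list w τ (.and (.sep 2 3) (.and (.conn 2 0) (.conn 3 1))) [6] (by decide) (by decide)]
    simp only [List.map, List.sum_cons, List.sum_nil, add_zero]
  have e60 : (prodBernoulli w).real (ev τ (.and (.sep 2 3) (.and (.conn 2 1) (.conn 3 0)))) = (prodBernoulli w).real (cell τ 8) := by
    rw [real_ev_eq_list w τ (.and (.sep 2 3) (.and (.conn 2 1) (.conn 3 0))) [8] (by decide) (by decide)]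
    simp only [List.map, List.sum_cons, List.sum_nil, add_zero]
  have e61 : (prodBernoulli w).real (ev τ (.and (.sep 2 3) (.and (.conn 2 0) (.conn 2 1)))) = (prodBernoulli w).real (cell τ 1) := by
    rw [real_ev_eq_list w τ (.and (.sep 2 3) (.and (.conn 2 0) (.conn 2 1))) [1] (by decide) (by decide)]
    simp only [List.map, List.sum_cons, List.sum_nil, add_zero]
  have e62 : (prodBernoulli w).real (ev τ (.and (.sep 2 3) (.and (.conn 3 1) (.conn 3 0)))) = (prodBernoulli w).real (cell τ 2) := by
    rw [real_ev_eq_list w τ (.and (.sep 2 3) (.and (.conn 3 1) (.conn 3 0))) [2] (by decide) (by decide)]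
    simp only [List.map, List.sum_cons, List.sum_nil, add_zero]
  have e63 : (prodBernoulli w).real (ev τ (.and (.and (.sep 2 1) (.sep 2 3)) (.conn 2 0))) = ((prodBernoulli w).real (cell τ 6) + (prodBernoulli w).real (cell τ 7)) := by
    rw [real_ev_eq_list w τ (.and (.and (.sep 2 1) (.sep 2 3)) (.conn 2 0)) [6, 7] (by decide) (by decide)]
    simp only [List.map, List.sum_cons, List.sum_nil, add_zero]
  have e64 : (prodBernoulli w).real (ev τ (.and (.and (.sep 2 1) (.sep 2 3)) (.and (.conn 2 0) (.sep 1 0)))) = ((prodBernoulli w).real (cell τ 6) + (prodBernoulli w).real (cell τ 7)) := by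
    rw [real_ev_eq_list w τ (.and (.and (.sep 2 1) (.sep 2 3)) (.and (.conn 2 0) (.sep 1 0))) [6, 7] (by decide) (by decide)]
    simp only [List.map, List.sum_cons, List.sum_nil, add_zero]
  have e65 : (prodBernoulli w).real (ev τ (.and (.and (.sep 1 2) (.sep 1 3)) (.and (.or (.sep 2 0) (.sep 2 3)) (.sep 1 0)))) = ((prodBernoulli w).real (cell τ 7) + ((prodBernoulli w).real (cell τ 11) + ((prodBernoulli w).real (cell τ 13) + (prodBernoulli w).real (cell τ 14)))) := by
    rw [real_ev_eq_list w τ (.and (.and (.sep 1 2) (.sep 1 3)) (.and (.or (.sep 2 0) (.sep 2 3)) (.sep 1 0))) [7, 11, 13, 14] (by decide) (by decide)]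
    simp only [List.map, List.sum_cons, List.sum_nil, add_zero]
  have e66 : (prodBernoulli w).real (ev τ (.and (.and (.sep 1 2) (.sep 1 3)) (.or (.sep 2 0) (.sep 2 3)))) = ((prodBernoulli w).real (cell τ 3) + ((prodBernoulli w).real (cell τ 4) + ((prodBernoulli w).real (cell τ 7) + ((prodBernoulli w).real (cell τ 11) + ((prodBernoulli w).real (cell τ 13) + (prodBernoulli w).real (cell τ 14)))))) := by
    rw [real_ev_eq_list w τ (.and (.and (.sep 1 2) (.sep 1 3)) (.or (.sep 2 0) (.sep 2 3))) [3, 4, 7, 11, 13, 14] (by decide) (by decide)]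
    simp only [List.map, List.sum_cons, List.sum_nil, add_zero]
  have e67 : (prodBernoulli w).real (ev τ (.and (.conn 1 3) (.or (.conn 0 1) (.or (.conn 0 2) (.conn 0 3))))) = ((prodBernoulli w).real (cell τ 0) + ((prodBernoulli w).real (cell τ 2) + (prodBernoulli w).real (cell τ 6))) := by
    rw [real_ev_eq_list w τ (.and (.conn 1 3) (.or (.conn 0 1) (.or (.conn 0 2) (.conn 0 3)))) [0, 2, 6] (by decide) (by decide)]
    simp only [List.map, List.sum_cons, List.sum_nil, add_zero]
  have e68 : (prodBernoulli w).real (ev τ (.and (.and (.sep 1 2) (.sep 1 3)) (.and (.conn 1 0) (.or (.sep 2 0) (.sep 2 3))))) = ((prodBernoulli w).real (cell τ 3) + (prodBernoulli w).real (cell τ 4)) := by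
    rw [real_ev_eq_list w τ (.and (.and (.sep 1 2) (.sep 1 3)) (.and (.conn 1 0) (.or (.sep 2 0) (.sep 2 3)))) [3, 4] (by decide) (by decide)]
    simp only [List.map, List.sum_cons, List.sum_nil, add_zero]
  have e69 : (prodBernoulli w).real (ev τ (.and (.conn 1 2) (.or (.conn 0 1) (.or (.conn 0 2) (.conn 0 3))))) = ((prodBernoulli w).real (cell τ 0) + ((prodBernoulli w).real (cell τ 1) + (prodBernoulli w).real (cell τ 8))) := by
    rw [real_ev_eq_list w τ (.and (.conn 1 2) (.or (.conn 0 1) (.or (.conn 0 2) (.conn 0 3)))) [0, 1, 8] (by decide) (by decide)]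
    simp only [List.map, List.sum_cons, List.sum_nil, add_zero]
  have e70 : (prodBernoulli w).real (ev τ (.and (.and (.sep 3 1) (.sep 3 2)) (.and (.conn 3 0) .tt))) = ((prodBernoulli w).real (cell τ 8) + (prodBernoulli w).real (cell τ 11)) := by
    rw [real_ev_eq_list w τ (.and (.and (.sep 3 1) (.sep 3 2)) (.and (.conn 3 0) .tt)) [8, 11] (by decide) (by decide)]
    simp only [List.map, List.sum_cons, List.sum_nil, add_zero]
  have e71 : (prodBernoulli w).real (ev τ (.and (.and (.sep 3 1) (.sep 3 2)) (.and (.sep 1 0) (.sep 3 0)))) = ((prodBernoulli w).real (cell τ 7) + ((prodBernoulli w).real (cell τ 10) + (prodBernoulli w).real (cell τ 14))) := by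
    rw [real_ev_eq_list w τ (.and (.and (.sep 3 1) (.sep 3 2)) (.and (.sep 1 0) (.sep 3 0))) [7, 10, 14] (by decide) (by decide)]
    simp only [List.map, List.sum_cons, List.sum_nil, add_zero]
  have e72 : (prodBernoulli w).real (ev τ (.and (.and (.sep 3 1) (.sep 3 2)) (.and (.conn 3 0) (.sep 1 0)))) = ((prodBernoulli w).real (cell τ 8) + (prodBernoulli w).real (cell τ 11)) := by
    rw [real_ev_eq_list w τ (.and (.and (.sep 3 1) (.sep 3 2)) (.and (.conn 3 0) (.sep 1 0))) [8, 11] (by decide) (by decide)]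
    simp only [List.map, List.sum_cons, List.sum_nil, add_zero]
  have e73 : (prodBernoulli w).real (ev τ (.and (.and (.sep 3 1) (.sep 3 2)) (.and .tt (.sep 3 0)))) = ((prodBernoulli w).real (cell τ 1) + ((prodBernoulli w).real (cell τ 4) + ((prodBernoulli w).real (cell τ 7) + ((prodBernoulli w).real (cell τ 10) + (prodBernoulli w).real (cell τ 14))))) := by
    rw [real_ev_eq_list w τ (.and (.and (.sep 3 1) (.sep 3 2)) (.and .tt (.sep 3 0))) [1, 4, 7, 10, 14] (by decide) (by decide)]
    simp only [List.map, List.sum_cons, List.sum_nil, add_zero]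
  have e74 : (prodBernoulli w).real (ev τ (.and (.and (.sep 3 1) (.sep 3 2)) (.and (.conn 1 0) (.conn 1 2)))) = (prodBernoulli w).real (cell τ 1) := by
    rw [real_ev_eq_list w τ (.and (.and (.sep 3 1) (.sep 3 2)) (.and (.conn 1 0) (.conn 1 2))) [1] (by decide) (by decide)]
    simp only [List.map, List.sum_cons, List.sum_nil, add_zero]
  have e75 : (prodBernoulli w).real (ev τ (.and (.and (.sep 3 1) (.sep 3 2)) (.and (.sep 3 0) (.and (.conn 1 0) (.conn 1 2))))) = (prodBernoulli w).real (cell τ 1) := by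
    rw [real_ev_eq_list w τ (.and (.and (.sep 3 1) (.sep 3 2)) (.and (.sep 3 0) (.and (.conn 1 0) (.conn 1 2)))) [1] (by decide) (by decide)]
    simp only [List.map, List.sum_cons, List.sum_nil, add_zero]
  have e76 : (prodBernoulli w).real (ev τ (.and (.sep 2 3) (.and (.conn 3 0) (.sep 2 1)))) = ((prodBernoulli w).real (cell τ 2) + (prodBernoulli w).real (cell τ 11)) := by
    rw [real_ev_eq_list w τ (.and (.sep 2 3) (.and (.conn 3 0) (.sep 2 1))) [2, 11] (by decide) (by decide)]
    simp only [List.map, List.sum_cons, List.sum_nil, add_zero]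
  have e77 : (prodBernoulli w).real (ev τ (.and (.sep 2 3) (.and (.and (.conn 3 0) (.sep 2 1)) (.or (.sep 2 0) (.sep 2 1))))) = ((prodBernoulli w).real (cell τ 2) + (prodBernoulli w).real (cell τ 11)) := by
    rw [real_ev_eq_list w τ (.and (.sep 2 3) (.and (.and (.conn 3 0) (.sep 2 1)) (.or (.sep 2 0) (.sep 2 1)))) [2, 11] (by decide) (by decide)]
    simp only [List.map, List.sum_cons, List.sum_nil, add_zero]
  have e78 : (prodBernoulli w).real (ev τ (.and (.and (.sep 1 2) (.sep 1 3)) (.sep 3 0))) = ((prodBernoulli w).real (cell τ 3) + ((prodBernoulli w).real (cell τ 4) + ((prodBernoulli w).real (cell τ 7) + ((prodBernoulli w).real (cell τ 13) + (prodBernoulli w).real (cell τ 14))))) := by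
    rw [real_ev_eq_list w τ (.and (.and (.sep 1 2) (.sep 1 3)) (.sep 3 0)) [3, 4, 7, 13, 14] (by decide) (by decide)]
    simp only [List.map, List.sum_cons, List.sum_nil, add_zero]
  have e79 : (prodBernoulli w).real (ev τ (.and (.and (.sep 1 2) (.sep 1 3)) (.and (.conn 1 0) (.sep 2 3)))) = (prodBernoulli w).real (cell τ 4) := by
    rw [real_ev_eq_list w τ (.and (.and (.sep 1 2) (.sep 1 3)) (.and (.conn 1 0) (.sep 2 3))) [4] (by decide) (by decide)]
    simp only [List.map, List.sum_cons, List.sum_nil, add_zero]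
  have e80 : (prodBernoulli w).real (ev τ (.and (.and (.sep 1 2) (.sep 1 3)) (.and (.sep 3 0) (.and (.conn 1 0) (.sep 2 3))))) = (prodBernoulli w).real (cell τ 4) := by
    rw [real_ev_eq_list w τ (.and (.and (.sep 1 2) (.sep 1 3)) (.and (.sep 3 0) (.and (.conn 1 0) (.sep 2 3)))) [4] (by decide) (by decide)]
    simp only [List.map, List.sum_cons, List.sum_nil, add_zero]
  have e81 : (prodBernoulli w).real (ev τ (.and (.sep 2 3) (.and (.conn 2 0) (.sep 2 1)))) = ((prodBernoulli w).real (cell τ 6) + (prodBernoulli w).real (cell τ 7)) := by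
    rw [real_ev_eq_list w τ (.and (.sep 2 3) (.and (.conn 2 0) (.sep 2 1))) [6, 7] (by decide) (by decide)]
    simp only [List.map, List.sum_cons, List.sum_nil, add_zero]
  have e82 : (prodBernoulli w).real (ev τ (.and (.sep 2 3) (.and (.sep 3 1) (.conn 3 0)))) = ((prodBernoulli w).real (cell τ 8) + (prodBernoulli w).real (cell τ 11)) := by
    rw [real_ev_eq_list w τ (.and (.sep 2 3) (.and (.sep 3 1) (.conn 3 0))) [8, 11] (by decide) (by decide)]
    simp only [List.map, List.sum_cons, List.sum_nil, add_zero]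
  have e83 : (prodBernoulli w).real (ev τ (.and (.sep 2 3) (.and (.conn 2 0) (.sep 3 1)))) = ((prodBernoulli w).real (cell τ 1) + (prodBernoulli w).real (cell τ 7)) := by
    rw [real_ev_eq_list w τ (.and (.sep 2 3) (.and (.conn 2 0) (.sep 3 1))) [1, 7] (by decide) (by decide)]
    simp only [List.map, List.sum_cons, List.sum_nil, add_zero]
  have e84 : (prodBernoulli w).real (ev τ (.and (.sep 2 3) (.and (.sep 2 1) (.conn 3 0)))) = ((prodBernoulli w).real (cell τ 2) + (prodBernoulli w).real (cell τ 11)) := by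
    rw [real_ev_eq_list w τ (.and (.sep 2 3) (.and (.sep 2 1) (.conn 3 0))) [2, 11] (by decide) (by decide)]
    simp only [List.map, List.sum_cons, List.sum_nil, add_zero]
  have e85 : (prodBernoulli w).real (ev τ (.and (.and (.sep 1 2) (.sep 1 3)) (.and (.sep 2 0) (.sep 3 0)))) = ((prodBernoulli w).real (cell τ 3) + ((prodBernoulli w).real (cell τ 4) + ((prodBernoulli w).real (cell τ 13) + (prodBernoulli w).real (cell τ 14)))) := by
    rw [real_ev_eq_list w τ (.and (.and (.sep 1 2) (.sep 1 3)) (.and (.sep 2 0) (.sep 3 0))) [3, 4, 13, 14] (by decide) (by decide)]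
    simp only [List.map, List.sum_cons, List.sum_nil, add_zero]
  have e86 : (prodBernoulli w).real (ev τ (.and (.and (.sep 1 2) (.sep 1 3)) (.and (.conn 1 0) (.and (.sep 2 0) (.sep 3 0))))) = ((prodBernoulli w).real (cell τ 3) + (prodBernoulli w).real (cell τ 4)) := by
    rw [real_ev_eq_list w τ (.and (.and (.sep 1 2) (.sep 1 3)) (.and (.conn 1 0) (.and (.sep 2 0) (.sep 3 0)))) [3, 4] (by decide) (by decide)]
    simp only [List.map, List.sum_cons, List.sum_nil, add_zero]
  have e87 : (prodBernoulli w).real (ev τ (.and (.sep 2 3) (.or (.conn 2 1) (.sep 3 0)))) = ((prodBernoulli w).real (cell τ 1) + ((prodBernoulli w).real (cell τ 4) + ((prodBernoulli w).real (cell τ 6) + ((prodBernoulli w).real (cell τ 7) + ((prodBernoulli w).real (cell τ 8) + ((prodBernoulli w).real (cell τ 10) + ((prodBernoulli w).real (cell τ 12) + (prodBernoulli w).real (cell τ 14)))))))) := by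
    rw [real_ev_eq_list w τ (.and (.sep 2 3) (.or (.conn 2 1) (.sep 3 0))) [1, 4, 6, 7, 8, 10, 12, 14] (by decide) (by decide)]
    simp only [List.map, List.sum_cons, List.sum_nil, add_zero]
  have e88 : (prodBernoulli w).real (ev τ (.and (.sep 2 3) (.and (.and (.conn 2 0) (.conn 2 1)) (.or (.conn 2 1) (.sep 3 0))))) = (prodBernoulli w).real (cell τ 1) := by
    rw [real_ev_eq_list w τ (.and (.sep 2 3) (.and (.and (.conn 2 0) (.conn 2 1)) (.or (.conn 2 1) (.sep 3 0)))) [1] (by decide) (by decide)]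
    simp only [List.map, List.sum_cons, List.sum_nil, add_zero]
  have e89 : (prodBernoulli w).real (ev τ (.and (.sep 2 3) (.and (.conn 3 0) (.or (.sep 2 0) (.sep 2 1))))) = ((prodBernoulli w).real (cell τ 2) + ((prodBernoulli w).real (cell τ 8) + (prodBernoulli w).real (cell τ 11))) := by
    rw [real_ev_eq_list w τ (.and (.sep 2 3) (.and (.conn 3 0) (.or (.sep 2 0) (.sep 2 1)))) [2, 8, 11] (by decide) (by decide)]
    simp only [List.map, List.sum_cons, List.sum_nil, add_zero]
  -- the 36 two-set rows of the certificate, in cell coordinates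
  have r0 : ((prodBernoulli w).real (cell τ 8) + (prodBernoulli w).real (cell τ 11)) * ((prodBernoulli w).real (cell τ 8) + ((prodBernoulli w).real (cell τ 10) + ((prodBernoulli w).real (cell τ 11) + (prodBernoulli w).real (cell τ 14)))) ≤ ((prodBernoulli w).real (cell τ 1) + ((prodBernoulli w).real (cell τ 4) + ((prodBernoulli w).real (cell τ 7) + ((prodBernoulli w).real (cell τ 8) + ((prodBernoulli w).real (cell τ 10) + ((prodBernoulli w).real (cell τ 11) + (prodBernoulli w).real (cell τ 14))))))) * ((prodBernoulli w).real (cell τ 8) + (prodBernoulli w).real (cell τ 11)) := by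
    have h := row_posA w τ ({3} : Finset (Fin 4)) ({1, 2} : Finset (Fin 4)) (.conn 3 0) (.and (.sep 1 0) (.sep 2 0)) (by decide) (by decide)
    rw [hD0] at h
    simp only [← ev_and] at h
    simp only [e7, e8, e9, e10] at h
    exact h
  have r1 : ((prodBernoulli w).real (cell τ 1) + ((prodBernoulli w).real (cell τ 3) + ((prodBernoulli w).real (cell τ 4) + ((prodBernoulli w).real (cell τ 5) + ((prodBernoulli w).real (cell τ 7) + ((prodBernoulli w).real (cell τ 8) + ((prodBernoulli w).real (cell τ 10) + ((prodBernoulli w).real (cell τ 11) + ((prodBernoulli w).real (cell τ 13) + (prodBernoulli w).real (cell τ 14)))))))))) * ((prodBernoulli w).real (cell τ 3) + ((prodBernoulli w).real (cell τ 7) + ((prodBernoulli w).real (cell τ 10) + ((prodBernoulli w).real (cell τ 13) + (prodBernoulli w).real (cell τ 14))))) ≤ ((prodBernoulli w).real (cell τ 1) + ((prodBernoulli w).real (cell τ 3) + ((prodBernoulli w).real (cell τ 4) + ((prodBernoulli w).real (cell τ 7) + ((prodBernoulli w).real (cell τ 10) + ((prodBernoulli w).real (cell τ 13) + (prodBernoulli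 w).real (cell τ 14))))))) * ((prodBernoulli w).real (cell τ 3) + ((prodBernoulli w).real (cell τ 5) + ((prodBernoulli w).real (cell τ 7) + ((prodBernoulli w).real (cell τ 8) + ((prodBernoulli w).real (cell τ 10) + ((prodBernoulli w).real (cell τ 11) + ((prodBernoulli w).real (cell τ 13) + (prodBernoulli w).real (cell τ 14)))))))) := by
    have h := row_neg w τ ({1} : Finset (Fin 4)) ({3} : Finset (Fin 4)) (.sep 3 0) (.or (.conn 3 2) (.sep 1 0)) (by decide) (by decide)
    rw [hD1] at h
    simp only [← ev_and] at h
    simp only [e11, e12, e13, e14] at h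
    exact h
  have r2 : ((prodBernoulli w).real (cell τ 2) + ((prodBernoulli w).real (cell τ 4) + ((prodBernoulli w).real (cell τ 6) + ((prodBernoulli w).real (cell τ 7) + ((prodBernoulli w).real (cell τ 11) + ((prodBernoulli w).real (cell τ 12) + (prodBernoulli w).real (cell τ 14))))))) * ((prodBernoulli w).real (cell τ 11) + ((prodBernoulli w).real (cell τ 12) + (prodBernoulli w).real (cell τ 14))) ≤ ((prodBernoulli w).real (cell τ 6) + ((prodBernoulli w).real (cell τ 7) + ((prodBernoulli w).real (cell τ 11) + ((prodBernoulli w).real (cell τ 12) + (prodBernoulli w).real (cell τ 14))))) * ((prodBernoulli w).real (cell τ 2) + ((prodBernoulli w).real (cell τ 4) + ((prodBernoulli w).real (cell τ 11) + ((prodBernoulli w).real (cell τ 12) + (prodBernoulli w).real (cell τ 14))))) := by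
    have h := row_neg w τ ({2} : Finset (Fin 4)) ({1, 3} : Finset (Fin 4)) (.sep 1 0) (.sep 2 0) (by decide) (by decide)
    rw [hD2] at h
    simp only [← ev_and] at h
    simp only [e15, e16, e17, e18] at h
    exact h
  have r3 : ((prodBernoulli w).real (cell τ 1) + ((prodBernoulli w).real (cell τ 4) + ((prodBernoulli w).real (cell τ 7) + ((prodBernoulli w).real (cell τ 10) + (prodBernoulli w).real (cell τ 14))))) * ((prodBernoulli w).real (cell τ 1) + ((prodBernoulli w).real (cell τ 4) + (prodBernoulli w).real (cell τ 7))) ≤ ((prodBernoulli w).real (cell τ 1) + ((prodBernoulli w).real (cell τ 4) + ((prodBernoulli w).real (cell τ 7) + ((prodBernoulli w).real (cell τ 8) + ((prodBernoulli w).real (cell τ 10) + ((prodBernoulli w).real (cell τ 11) + (prodBernoulli w).real (cell τ 14))))))) * ((prodBernoulli w).real (cell τ 1) + ((prodBernoulli w).real (cell τ 4) + (prodBernoulli w).real (cell τ 7))) := by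
    have h := row_posB w τ ({3} : Finset (Fin 4)) ({1, 2} : Finset (Fin 4)) (.sep 3 0) (.or (.conn 1 0) (.conn 2 0)) (by decide) (by decide)
    rw [hD0] at h
    simp only [← ev_and] at h
    simp only [e19, e20, e9, e21] at h
    exact h
  have r4 : ((prodBernoulli w).real (cell τ 2) + ((prodBernoulli w).real (cell τ 3) + ((prodBernoulli w).real (cell τ 4) + ((prodBernoulli w).real (cell τ 11) + ((prodBernoulli w).real (cell τ 12) + ((prodBernoulli w).real (cell τ 13) + (prodBernoulli w).real (cell τ 14))))))) * ((prodBernoulli w).real (cell τ 2) + (prodBernoulli w).real (cell τ 4)) ≤ ((prodBernoulli w).real (cell τ 2) + ((prodBernoulli w).real (cell τ 3) + ((prodBernoulli w).real (cell τ 4) + ((prodBernoulli w).real (cell τ 5) + ((prodBernoulli w).real (cell τ 6) + ((prodBernoulli w).real (cell τ 7) + ((prodBernoulli w).real (cell τ 11) + ((prodBernoulli w).real (cell τ 12) + ((prodBernoulli w).real (cell τ 13) + (prodBernoulli w).real (cell τ 14)))))))))) * ((prodBernoulli w).real (cell τ 2) + (prodBernoulli w).real (cell τ 4)) := by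
    have h := row_posA w τ ({1} : Finset (Fin 4)) ({2} : Finset (Fin 4)) (.sep 2 0) (.and (.conn 1 0) (.sep 2 3)) (by decide) (by decide)
    rw [hD3] at h
    simp only [← ev_and] at h
    simp only [e22, e23, e24, e25] at h
    exact h
  have r5 : ((prodBernoulli w).real (cell τ 2) + ((prodBernoulli w).real (cell τ 4) + ((prodBernoulli w).real (cell τ 11) + ((prodBernoulli w).real (cell τ 12) + (prodBernoulli w).real (cell τ 14))))) * ((prodBernoulli w).real (cell τ 2) + ((prodBernoulli w).real (cell τ 4) + (prodBernoulli w).real (cell τ 11))) ≤ ((prodBernoulli w).real (cell τ 2) + ((prodBernoulli w).real (cell τ 4) + ((prodBernoulli w).real (cell τ 6) + ((prodBernoulli w).real (cell τ 7) + ((prodBernoulli w).real (cell τ 11) + ((prodBernoulli w).real (cell τ 12) + (prodBernoulli w).real (cell τ 14))))))) * ((prodBernoulli w).real (cell τ 2) + ((prodBernoulli w).real (cell τ 4) + (prodBernoulli w).real (cell τ 11))) := by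
    have h := row_posB w τ ({2} : Finset (Fin 4)) ({1, 3} : Finset (Fin 4)) (.sep 2 0) (.or (.conn 1 0) (.conn 3 0)) (by decide) (by decide)
    rw [hD2] at h
    simp only [← ev_and] at h
    simp only [e18, e26, e15, e27] at h
    exact h
  have r6 : ((prodBernoulli w).real (cell τ 1) + ((prodBernoulli w).real (cell τ 3) + (prodBernoulli w).real (cell τ 4))) * ((prodBernoulli w).real (cell τ 7) + ((prodBernoulli w).real (cell τ 10) + ((prodBernoulli w).real (cell τ 13) + (prodBernoulli w).real (cell τ 14)))) ≤ ((prodBernoulli w).real (cell τ 1) + ((prodBernoulli w).real (cell τ 3) + (prodBernoulli w).real (cell τ 4))) * ((prodBernoulli w).real (cell τ 5) + ((prodBernoulli w).real (cell τ 7) + ((prodBernoulli w).real (cell τ 8) + ((prodBernoulli w).real (cell τ 10) + ((prodBernoulli w).real (cell τ 11) + ((prodBernoulli w).real (cell τ 13) + (prodBernoulli w).real (cell τ 14))))))) := by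
    have h := row_x4 w τ ({1} : Finset (Fin 4)) ({3} : Finset (Fin 4)) (.conn 1 0) (.sep 3 0) .tt (.sep 1 0) (by decide) (by decide) (by decide) (by decide)
    rw [hD1] at h
    simp only [← ev_and] at h
    simp only [e28, e29, e30, e31] at h
    exact h
  have r7 : ((prodBernoulli w).real (cell τ 3) + (prodBernoulli w).real (cell τ 4)) * ((prodBernoulli w).real (cell τ 7) + ((prodBernoulli w).real (cell τ 13) + (prodBernoulli w).real (cell τ 14))) ≤ ((prodBernoulli w).real (cell τ 3) + (prodBernoulli w).real (cell τ 4)) * ((prodBernoulli w).real (cell τ 5) + ((prodBernoulli w).real (cell τ 7) + ((prodBernoulli w).real (cell τ 11) + ((prodBernoulli w).real (cell τ 13) + (prodBernoulli w).real (cell τ 14))))) := by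
    have h := row_x4 w τ ({1} : Finset (Fin 4)) ({2, 3} : Finset (Fin 4)) (.conn 1 0) (.sep 3 0) .tt (.sep 1 0) (by decide) (by decide) (by decide) (by decide)
    rw [hD4] at h
    simp only [← ev_and] at h
    simp only [e32, e33, e34, e35] at h
    exact h
  have r8 : ((prodBernoulli w).real (cell τ 5) + ((prodBernoulli w).real (cell τ 7) + ((prodBernoulli w).real (cell τ 11) + ((prodBernoulli w).real (cell τ 13) + (prodBernoulli w).real (cell τ 14))))) * ((prodBernoulli w).real (cell τ 5) + ((prodBernoulli w).real (cell τ 7) + (prodBernoulli w).real (cell τ 11))) ≤ ((prodBernoulli w).real (cell τ 3) + ((prodBernoulli w).real (cell τ 4) + ((prodBernoulli w).real (cell τ 5) + ((prodBernoulli w).real (cell τ 7) + ((prodBernoulli w).real (cell τ 11) + ((prodBernoulli w).real (cell τ 13) + (prodBernoulli w).real (cell τ 14))))))) * ((prodBernoulli w).real (cell τ 5) + ((prodBernoulli w).real (cell τ 7) + (prodBernoulli w).real (cell τ 11))) := by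
    have h := row_posB w τ ({1} : Finset (Fin 4)) ({2, 3} : Finset (Fin 4)) (.sep 1 0) (.or (.conn 2 0) (.conn 3 0)) (by decide) (by decide)
    rw [hD4] at h
    simp only [← ev_and] at h
    simp only [e36, e37, e38, e39] at h
    exact h
  have r9 : (prodBernoulli w).real (cell τ 2) * ((prodBernoulli w).real (cell τ 2) + ((prodBernoulli w).real (cell τ 4) + ((prodBernoulli w).real (cell τ 6) + ((prodBernoulli w).real (cell τ 7) + ((prodBernoulli w).real (cell τ 8) + ((prodBernoulli w).real (cell τ 10) + ((prodBernoulli w).real (cell τ 11) + ((prodBernoulli w).real (cell τ 12) + (prodBernoulli w).real (cell τ 14))))))))) ≤ ((prodBernoulli w).real (cell τ 1) + ((prodBernoulli w).real (cell τ 2) + ((prodBernoulli w).real (cell τ 4) + ((prodBernoulli w).real (cell τ 6) + ((prodBernoulli w).real (cell τ 7) + ((prodBernoulli w).real (cell τ 8) + ((prodBernoulli w).real (cell τ 10) + ((prodBernoulli w).real (cell τ 11) + ((prodBernoulli w).real (cell τ 12) + (prodBernoulli w).real (cell τ 14)))))))))) * (prodBernoulli w).real (cell τ 2) := by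
    have h := row_posB w τ ({2} : Finset (Fin 4)) ({3} : Finset (Fin 4)) (.and (.conn 3 0) (.conn 3 1)) (.or (.sep 2 0) (.sep 2 1)) (by decide) (by decide)
    rw [hD5] at h
    simp only [← ev_and] at h
    simp only [e40, e41, e42, e43] at h
    exact h
  have r10 : ((prodBernoulli w).real (cell τ 5) + (prodBernoulli w).real (cell τ 11)) * ((prodBernoulli w).real (cell τ 11) + ((prodBernoulli w).real (cell τ 13) + (prodBernoulli w).real (cell τ 14))) ≤ ((prodBernoulli w).real (cell τ 3) + ((prodBernoulli w).real (cell τ 4) + ((prodBernoulli w).real (cell τ 11) + ((prodBernoulli w).real (cell τ 13) + (prodBernoulli w).real (cell τ 14))))) * ((prodBernoulli w).real (cell τ 5) + (prodBernoulli w).real (cell τ 11)) := by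
    have h := row_x4 w τ ({1} : Finset (Fin 4)) ({2, 3} : Finset (Fin 4)) .tt (.sep 2 0) (.conn 3 0) (.sep 1 0) (by decide) (by decide) (by decide) (by decide)
    rw [hD4] at h
    simp only [← ev_and] at h
    simp only [e44, e45, e46, e47] at h
    exact h
  have r11 : ((prodBernoulli w).real (cell τ 5) + (prodBernoulli w).real (cell τ 7)) * ((prodBernoulli w).real (cell τ 5) + ((prodBernoulli w).real (cell τ 7) + ((prodBernoulli w).real (cell τ 11) + ((prodBernoulli w).real (cell τ 13) + (prodBernoulli w).real (cell τ 14))))) ≤ ((prodBernoulli w).real (cell τ 3) + ((prodBernoulli w).real (cell τ 4) + ((prodBernoulli w).real (cell τ 5) + ((prodBernoulli w).real (cell τ 7) + ((prodBernoulli w).real (cell τ 11) + ((prodBernoulli w).real (cell τ 13) + (prodBernoulli w).real (cell τ 14))))))) * ((prodBernoulli w).real (cell τ 5) + (prodBernoulli w).real (cell τ 7)) := by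
    have h := row_posB w τ ({1} : Finset (Fin 4)) ({2, 3} : Finset (Fin 4)) (.conn 2 0) (.sep 1 0) (by decide) (by decide)
    rw [hD4] at h
    simp only [← ev_and] at h
    simp only [e48, e36, e38, e49] at h
    exact h
  have r12 : ((prodBernoulli w).real (cell τ 1) + ((prodBernoulli w).real (cell τ 2) + ((prodBernoulli w).real (cell τ 4) + ((prodBernoulli w).real (cell τ 6) + ((prodBernoulli w).real (cell τ 7) + ((prodBernoulli w).real (cell τ 8) + ((prodBernoulli w).real (cell τ 10) + ((prodBernoulli w).real (cell τ 11) + ((prodBernoulli w).real (cell τ 12) + (prodBernoulli w).real (cell τ 14)))))))))) * ((prodBernoulli w).real (cell τ 4) + ((prodBernoulli w).real (cell τ 8) + ((prodBernoulli w).real (cell τ 10) + ((prodBernoulli w).real (cell τ 11) + ((prodBernoulli w).real (cell τ 12) + (prodBernoulli w).real (cell τ 14)))))) ≤ ((prodBernoulli w).real (cell τ 1) + ((prodBernoulli w).real (cell τ 4) + ((prodBernoulli w).real (cell τ 6) + ((prodBernoulli w).real (cell τ 7) + ((prodBernoulli w).real (cell τ 8) + ((prodBernoulli w).real (cell τ 10)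 + ((prodBernoulli w).real (cell τ 11) + ((prodBernoulli w).real (cell τ 12) + (prodBernoulli w).real (cell τ 14))))))))) * ((prodBernoulli w).real (cell τ 2) + ((prodBernoulli w).real (cell τ 4) + ((prodBernoulli w).real (cell τ 8) + ((prodBernoulli w).real (cell τ 10) + ((prodBernoulli w).real (cell τ 11) + ((prodBernoulli w).real (cell τ 12) + (prodBernoulli w).real (cell τ 14))))))) := by
    have h := row_neg w τ ({2} : Finset (Fin 4)) ({3} : Finset (Fin 4)) (.or (.sep 3 0) (.sep 3 1)) (.sep 2 0) (by decide) (by decide)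
    rw [hD5] at h
    simp only [← ev_and] at h
    simp only [e42, e50, e51, e52] at h
    exact h
  have r13 : ((prodBernoulli w).real (cell τ 3) + (prodBernoulli w).real (cell τ 4)) * ((prodBernoulli w).real (cell τ 3) + ((prodBernoulli w).real (cell τ 4) + ((prodBernoulli w).real (cell τ 11) + ((prodBernoulli w).real (cell τ 13) + (prodBernoulli w).real (cell τ 14))))) ≤ ((prodBernoulli w).real (cell τ 3) + ((prodBernoulli w).real (cell τ 4) + ((prodBernoulli w).real (cell τ 5) + ((prodBernoulli w).real (cell τ 7) + ((prodBernoulli w).real (cell τ 11) + ((prodBernoulli w).real (cell τ 13) + (prodBernoulli w).real (cell τ 14))))))) * ((prodBernoulli w).real (cell τ 3) + (prodBernoulli w).real (cell τ 4)) := by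
    have h := row_posA w τ ({1} : Finset (Fin 4)) ({2, 3} : Finset (Fin 4)) (.conn 1 0) (.sep 2 0) (by decide) (by decide)
    rw [hD4] at h
    simp only [← ev_and] at h
    simp only [e53, e54, e38, e55] at h
    exact h
  have r14 : ((prodBernoulli w).real (cell τ 2) + ((prodBernoulli w).real (cell τ 8) + (prodBernoulli w).real (cell τ 11))) * ((prodBernoulli w).real (cell τ 2) + ((prodBernoulli w).real (cell τ 4) + ((prodBernoulli w).real (cell τ 8) + ((prodBernoulli w).real (cell τ 10) + ((prodBernoulli w).real (cell τ 11) + ((prodBernoulli w).real (cell τ 12) + (prodBernoulli w).real (cell τ 14))))))) ≤ ((prodBernoulli w).real (cell τ 1) + ((prodBernoulli w).real (cell τ 2) + ((prodBernoulli w).real (cell τ 4) + ((prodBernoulli w).real (cell τ 6) + ((prodBernoulli w).real (cell τ 7) + ((prodBernoulli w).real (cell τ 8) + ((prodBernoulli w).real (cell τ 10) + ((prodBernoulli w).real (cell τ 11) + ((prodBernoulli w).real (cell τ 12) + (prodBernoulli w).real (cell τ 14)))))))))) * ((prodBernoulli w).real (cell τ 2) + ((prodBernoulli w).real (cell τ 8)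 + (prodBernoulli w).real (cell τ 11))) := by
    have h := row_posB w τ ({2} : Finset (Fin 4)) ({3} : Finset (Fin 4)) (.conn 3 0) (.sep 2 0) (by decide) (by decide)
    rw [hD5] at h
    simp only [← ev_and] at h
    simp only [e56, e52, e42, e57] at h
    exact h
  have r15 : ((prodBernoulli w).real (cell τ 5) + (prodBernoulli w).real (cell τ 11)) * ((prodBernoulli w).real (cell τ 7) + ((prodBernoulli w).real (cell τ 13) + (prodBernoulli w).real (cell τ 14))) ≤ ((prodBernoulli w).real (cell τ 3) + ((prodBernoulli w).real (cell τ 4) + ((prodBernoulli w).real (cell τ 7) + ((prodBernoulli w).real (cell τ 13) + (prodBernoulli w).real (cell τ 14))))) * ((prodBernoulli w).real (cell τ 5) + (prodBernoulli w).real (cell τ 11)) := by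
    have h := row_x4 w τ ({1} : Finset (Fin 4)) ({2, 3} : Finset (Fin 4)) .tt (.sep 3 0) (.conn 3 0) (.sep 1 0) (by decide) (by decide) (by decide) (by decide)
    rw [hD4] at h
    simp only [← ev_and] at h
    simp only [e44, e33, e58, e47] at h
    exact h
  have r16 : ((prodBernoulli w).real (cell τ 3) + (prodBernoulli w).real (cell τ 4)) * ((prodBernoulli w).real (cell τ 3) + ((prodBernoulli w).real (cell τ 4) + ((prodBernoulli w).real (cell τ 11) + ((prodBernoulli w).real (cell τ 13) + (prodBernoulli w).real (cell τ 14))))) ≤ ((prodBernoulli w).real (cell τ 3) + ((prodBernoulli w).real (cell τ 4) + ((prodBernoulli w).real (cell τ 5) + ((prodBernoulli w).real (cell τ 7) + ((prodBernoulli w).real (cell τ 11) + ((prodBernoulli w).real (cell τ 13) + (prodBernoulli w).real (cell τ 14))))))) * ((prodBernoulli w).real (cell τ 3) + (prodBernoulli w).real (cell τ 4)) := by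
    have h := row_posA w τ ({1} : Finset (Fin 4)) ({2, 3} : Finset (Fin 4)) (.conn 1 0) (.sep 2 0) (by decide) (by decide)
    rw [hD4] at h
    simp only [← ev_and] at h
    simp only [e53, e54, e38, e55] at h
    exact h
  have r17 : (prodBernoulli w).real (cell τ 6) * (prodBernoulli w).real (cell τ 8) ≤ (prodBernoulli w).real (cell τ 1) * (prodBernoulli w).real (cell τ 2) := by
    have h := row_x4 w τ ({2} : Finset (Fin 4)) ({3} : Finset (Fin 4)) (.conn 2 0) (.conn 2 1) (.conn 3 1) (.conn 3 0) (by decide) (by decide) (by decide) (by decide)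
    rw [hD5] at h
    simp only [← ev_and] at h
    simp only [e59, e60, e61, e62] at h
    exact h
  have r18 : ((prodBernoulli w).real (cell τ 6) + (prodBernoulli w).real (cell τ 7)) * ((prodBernoulli w).real (cell τ 6) + ((prodBernoulli w).real (cell τ 7) + ((prodBernoulli w).real (cell τ 11) + ((prodBernoulli w).real (cell τ 12) + (prodBernoulli w).real (cell τ 14))))) ≤ ((prodBernoulli w).real (cell τ 2) + ((prodBernoulli w).real (cell τ 4) + ((prodBernoulli w).real (cell τ 6) + ((prodBernoulli w).real (cell τ 7) + ((prodBernoulli w).real (cell τ 11) + ((prodBernoulli w).real (cell τ 12) + (prodBernoulli w).real (cell τ 14))))))) * ((prodBernoulli w).real (cell τ 6) + (prodBernoulli w).real (cell τ 7)) := by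
    have h := row_posA w τ ({2} : Finset (Fin 4)) ({1, 3} : Finset (Fin 4)) (.conn 2 0) (.sep 1 0) (by decide) (by decide)
    rw [hD2] at h
    simp only [← ev_and] at h
    simp only [e63, e17, e15, e64] at h
    exact h
  have r19 : ((prodBernoulli w).real (cell τ 3) + ((prodBernoulli w).real (cell τ 4) + ((prodBernoulli w).real (cell τ 5) + ((prodBernoulli w).real (cell τ 7) + ((prodBernoulli w).real (cell τ 11) + ((prodBernoulli w).real (cell τ 13) + (prodBernoulli w).real (cell τ 14))))))) * ((prodBernoulli w).real (cell τ 7) + ((prodBernoulli w).real (cell τ 11) + ((prodBernoulli w).real (cell τ 13) + (prodBernoulli w).real (cell τ 14)))) ≤ ((prodBernoulli w).real (cell τ 3) + ((prodBernoulli w).real (cell τ 4) + ((prodBernoulli w).real (cell τ 7) + ((prodBernoulli w).real (cell τ 11) + ((prodBernoulli w).real (cell τ 13) + (prodBernoulli w).real (cell τ 14)))))) * ((prodBernoulli w).real (cell τ 5) + ((prodBernoulli w).real (cell τ 7) + ((prodBernoulli w).real (cell τ 11) + ((prodBernoulli w).real (cell τ 13) + (prodBernoulli w).real (cell τ 14)))))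 := by
    have h := row_neg w τ ({1} : Finset (Fin 4)) ({2, 3} : Finset (Fin 4)) (.or (.sep 2 0) (.sep 2 3)) (.sep 1 0) (by decide) (by decide)
    rw [hD4] at h
    simp only [← ev_and] at h
    simp only [e38, e65, e66, e36] at h
    exact h
  have r20 : (prodBernoulli w).real (cell τ 6) * (prodBernoulli w).real (cell τ 8) ≤ (prodBernoulli w).real (cell τ 1) * (prodBernoulli w).real (cell τ 2) := by
    have h := row_x4 w τ ({2} : Finset (Fin 4)) ({3} : Finset (Fin 4)) (.conn 2 0) (.conn 2 1) (.conn 3 1) (.conn 3 0) (by decide) (by decide) (by decide) (by decide)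
    rw [hD5] at h
    simp only [← ev_and] at h
    simp only [e59, e60, e61, e62] at h
    exact h
  have r21 : ((prodBernoulli w).real (cell τ 3) + (prodBernoulli w).real (cell τ 4)) * ((prodBernoulli w).real (cell τ 3) + ((prodBernoulli w).real (cell τ 4) + ((prodBernoulli w).real (cell τ 7) + ((prodBernoulli w).real (cell τ 11) + ((prodBernoulli w).real (cell τ 13) + (prodBernoulli w).real (cell τ 14)))))) ≤ ((prodBernoulli w).real (cell τ 3) + ((prodBernoulli w).real (cell τ 4) + ((prodBernoulli w).real (cell τ 5) + ((prodBernoulli w).real (cell τ 7) + ((prodBernoulli w).real (cell τ 11) + ((prodBernoulli w).real (cell τ 13) + (prodBernoulli w).real (cell τ 14))))))) * ((prodBernoulli w).real (cell τ 3) + (prodBernoulli w).real (cell τ 4)) := by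
    have h := row_posA w τ ({1} : Finset (Fin 4)) ({2, 3} : Finset (Fin 4)) (.conn 1 0) (.or (.sep 2 0) (.sep 2 3)) (by decide) (by decide)
    rw [hD4] at h
    simp only [← ev_and] at h
    simp only [e53, e66, e38, e68] at h
    exact h
  have r22 : (prodBernoulli w).real (cell τ 6) * (prodBernoulli w).real (cell τ 8) ≤ (prodBernoulli w).real (cell τ 1) * (prodBernoulli w).real (cell τ 2) := by
    have h := row_x4 w τ ({2} : Finset (Fin 4)) ({3} : Finset (Fin 4)) (.conn 2 0) (.conn 2 1) (.conn 3 1) (.conn 3 0) (by decide) (by decide) (by decide) (by decide)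
    rw [hD5] at h
    simp only [← ev_and] at h
    simp only [e59, e60, e61, e62] at h
    exact h
  have r23 : ((prodBernoulli w).real (cell τ 8) + (prodBernoulli w).real (cell τ 11)) * ((prodBernoulli w).real (cell τ 7) + ((prodBernoulli w).real (cell τ 10) + (prodBernoulli w).real (cell τ 14))) ≤ ((prodBernoulli w).real (cell τ 8) + (prodBernoulli w).real (cell τ 11)) * ((prodBernoulli w).real (cell τ 1) + ((prodBernoulli w).real (cell τ 4) + ((prodBernoulli w).real (cell τ 7) + ((prodBernoulli w).real (cell τ 10) + (prodBernoulli w).real (cell τ 14))))) := by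
    have h := row_x4 w τ ({3} : Finset (Fin 4)) ({1, 2} : Finset (Fin 4)) (.conn 3 0) (.sep 1 0) .tt (.sep 3 0) (by decide) (by decide) (by decide) (by decide)
    rw [hD0] at h
    simp only [← ev_and] at h
    simp only [e70, e71, e72, e73] at h
    exact h
  have r24 : ((prodBernoulli w).real (cell τ 1) + ((prodBernoulli w).real (cell τ 4) + ((prodBernoulli w).real (cell τ 7) + ((prodBernoulli w).real (cell τ 10) + (prodBernoulli w).real (cell τ 14))))) * (prodBernoulli w).real (cell τ 1) ≤ ((prodBernoulli w).real (cell τ 1) + ((prodBernoulli w).real (cell τ 4) + ((prodBernoulli w).real (cell τ 7) + ((prodBernoulli w).real (cell τ 8) + ((prodBernoulli w).real (cell τ 10) + ((prodBernoulli w).real (cell τ 11) + (prodBernoulli w).real (cell τ 14))))))) * (prodBernoulli w).real (cell τ 1) := by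
    have h := row_posB w τ ({3} : Finset (Fin 4)) ({1, 2} : Finset (Fin 4)) (.sep 3 0) (.and (.conn 1 0) (.conn 1 2)) (by decide) (by decide)
    rw [hD0] at h
    simp only [← ev_and] at h
    simp only [e19, e74, e9, e75] at h
    exact h
  have r25 : ((prodBernoulli w).real (cell τ 2) + (prodBernoulli w).real (cell τ 11)) * ((prodBernoulli w).real (cell τ 2) + ((prodBernoulli w).real (cell τ 4) + ((prodBernoulli w).real (cell τ 6) + ((prodBernoulli w).real (cell τ 7) + ((prodBernoulli w).real (cell τ 8) + ((prodBernoulli w).real (cell τ 10) + ((prodBernoulli w).real (cell τ 11) + ((prodBernoulli w).real (cell τ 12) + (prodBernoulli w).real (cell τ 14))))))))) ≤ ((prodBernoulli w).real (cell τ 1) + ((prodBernoulli w).real (cell τ 2) + ((prodBernoulli w).real (cell τ 4) + ((prodBernoulli w).real (cell τ 6) + ((prodBernoulli w).real (cell τ 7) + ((prodBernoulli w).real (cell τ 8) + ((prodBernoulli w).real (cell τ 10) + ((prodBernoulli w).real (cell τ 11) + ((prodBernoulli w).real (cell τ 12) + (prodBernoulli w).real (cell τ 14)))))))))) * ((prodBernoulli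 w).real (cell τ 2) + (prodBernoulli w).real (cell τ 11)) := by
    have h := row_posB w τ ({2} : Finset (Fin 4)) ({3} : Finset (Fin 4)) (.and (.conn 3 0) (.sep 2 1)) (.or (.sep 2 0) (.sep 2 1)) (by decide) (by decide)
    rw [hD5] at h
    simp only [← ev_and] at h
    simp only [e76, e41, e42, e77] at h
    exact h
  have r26 : ((prodBernoulli w).real (cell τ 2) + ((prodBernoulli w).real (cell τ 4) + ((prodBernoulli w).real (cell τ 11) + ((prodBernoulli w).real (cell τ 12) + (prodBernoulli w).real (cell τ 14))))) * ((prodBernoulli w).real (cell τ 2) + ((prodBernoulli w).real (cell τ 4) + (prodBernoulli w).real (cell τ 11))) ≤ ((prodBernoulli w).real (cell τ 2) + ((prodBernoulli w).real (cell τ 4) + ((prodBernoulli w).real (cell τ 6) + ((prodBernoulli w).real (cell τ 7) + ((prodBernoulli w).real (cell τ 11) + ((prodBernoulli w).real (cell τ 12) + (prodBernoulli w).real (cell τ 14))))))) * ((prodBernoulli w).real (cell τ 2) + ((prodBernoulli w).real (cell τ 4) + (prodBernoulli w).real (cell τ 11))) := by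
    have h := row_posB w τ ({2} : Finset (Fin 4)) ({1, 3} : Finset (Fin 4)) (.sep 2 0) (.or (.conn 1 0) (.conn 3 0)) (by decide) (by decide)
    rw [hD2] at h
    simp only [← ev_and] at h
    simp only [e18, e26, e15, e27] at h
    exact h
  have r27 : (prodBernoulli w).real (cell τ 6) * (prodBernoulli w).real (cell τ 8) ≤ (prodBernoulli w).real (cell τ 1) * (prodBernoulli w).real (cell τ 2) := by
    have h := row_x4 w τ ({2} : Finset (Fin 4)) ({3} : Finset (Fin 4)) (.conn 2 0) (.conn 2 1) (.conn 3 1) (.conn 3 0) (by decide) (by decide) (by decide) (by decide)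
    rw [hD5] at h
    simp only [← ev_and] at h
    simp only [e59, e60, e61, e62] at h
    exact h
  have r28 : ((prodBernoulli w).real (cell τ 3) + ((prodBernoulli w).real (cell τ 4) + ((prodBernoulli w).real (cell τ 7) + ((prodBernoulli w).real (cell τ 13) + (prodBernoulli w).real (cell τ 14))))) * (prodBernoulli w).real (cell τ 4) ≤ ((prodBernoulli w).real (cell τ 3) + ((prodBernoulli w).real (cell τ 4) + ((prodBernoulli w).real (cell τ 5) + ((prodBernoulli w).real (cell τ 7) + ((prodBernoulli w).real (cell τ 11) + ((prodBernoulli w).real (cell τ 13) + (prodBernoulli w).real (cell τ 14))))))) * (prodBernoulli w).real (cell τ 4) := by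
    have h := row_posA w τ ({1} : Finset (Fin 4)) ({2, 3} : Finset (Fin 4)) (.sep 3 0) (.and (.conn 1 0) (.sep 2 3)) (by decide) (by decide)
    rw [hD4] at h
    simp only [← ev_and] at h
    simp only [e78, e79, e38, e80] at h
    exact h
  have r29 : ((prodBernoulli w).real (cell τ 6) + (prodBernoulli w).real (cell τ 7)) * ((prodBernoulli w).real (cell τ 8) + (prodBernoulli w).real (cell τ 11)) ≤ ((prodBernoulli w).real (cell τ 1) + (prodBernoulli w).real (cell τ 7)) * ((prodBernoulli w).real (cell τ 2) + (prodBernoulli w).real (cell τ 11)) := by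
    have h := row_x4 w τ ({2} : Finset (Fin 4)) ({3} : Finset (Fin 4)) (.conn 2 0) (.sep 3 1) (.sep 2 1) (.conn 3 0) (by decide) (by decide) (by decide) (by decide)
    rw [hD5] at h
    simp only [← ev_and] at h
    simp only [e81, e82, e83, e84] at h
    exact h
  have r30 : (prodBernoulli w).real (cell τ 6) * (prodBernoulli w).real (cell τ 8) ≤ (prodBernoulli w).real (cell τ 1) * (prodBernoulli w).real (cell τ 2) := by
    have h := row_x4 w τ ({2} : Finset (Fin 4)) ({3} : Finset (Fin 4)) (.conn 2 0) (.conn 2 1) (.conn 3 1) (.conn 3 0) (by decide) (by decide) (by decide) (by decide)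
    rw [hD5] at h
    simp only [← ev_and] at h
    simp only [e59, e60, e61, e62] at h
    exact h
  have r31 : (prodBernoulli w).real (cell τ 6) * (prodBernoulli w).real (cell τ 8) ≤ (prodBernoulli w).real (cell τ 1) * (prodBernoulli w).real (cell τ 2) := by
    have h := row_x4 w τ ({2} : Finset (Fin 4)) ({3} : Finset (Fin 4)) (.conn 2 0) (.conn 2 1) (.conn 3 1) (.conn 3 0) (by decide) (by decide) (by decide) (by decide)
    rw [hD5] at h
    simp only [← ev_and] at h
    simp only [e59, e60, e61, e62] at h
    exact h
  have r32 : ((prodBernoulli w).real (cell τ 6) + (prodBernoulli w).real (cell τ 7)) * ((prodBernoulli w).real (cell τ 8) + (prodBernoulli w).real (cell τ 11)) ≤ ((prodBernoulli w).real (cell τ 1) + (prodBernoulli w).real (cell τ 7)) * ((prodBernoulli w).real (cell τ 2) + (prodBernoulli w).real (cell τ 11)) := by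
    have h := row_x4 w τ ({2} : Finset (Fin 4)) ({3} : Finset (Fin 4)) (.conn 2 0) (.sep 3 1) (.sep 2 1) (.conn 3 0) (by decide) (by decide) (by decide) (by decide)
    rw [hD5] at h
    simp only [← ev_and] at h
    simp only [e81, e82, e83, e84] at h
    exact h
  have r33 : ((prodBernoulli w).real (cell τ 3) + (prodBernoulli w).real (cell τ 4)) * ((prodBernoulli w).real (cell τ 3) + ((prodBernoulli w).real (cell τ 4) + ((prodBernoulli w).real (cell τ 13) + (prodBernoulli w).real (cell τ 14)))) ≤ ((prodBernoulli w).real (cell τ 3) + ((prodBernoulli w).real (cell τ 4) + ((prodBernoulli w).real (cell τ 5) + ((prodBernoulli w).real (cell τ 7) + ((prodBernoulli w).real (cell τ 11) + ((prodBernoulli w).real (cell τ 13) + (prodBernoulli w).real (cell τ 14))))))) * ((prodBernoulli w).real (cell τ 3) + (prodBernoulli w).real (cell τ 4)) := by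
    have h := row_posA w τ ({1} : Finset (Fin 4)) ({2, 3} : Finset (Fin 4)) (.conn 1 0) (.and (.sep 2 0) (.sep 3 0)) (by decide) (by decide)
    rw [hD4] at h
    simp only [← ev_and] at h
    simp only [e53, e85, e38, e86] at h
    exact h
  have r34 : (prodBernoulli w).real (cell τ 1) * ((prodBernoulli w).real (cell τ 1) + ((prodBernoulli w).real (cell τ 4) + ((prodBernoulli w).real (cell τ 6) + ((prodBernoulli w).real (cell τ 7) + ((prodBernoulli w).real (cell τ 8) + ((prodBernoulli w).real (cell τ 10) + ((prodBernoulli w).real (cell τ 12) + (prodBernoulli w).real (cell τ 14)))))))) ≤ ((prodBernoulli w).real (cell τ 1) + ((prodBernoulli w).real (cell τ 2) + ((prodBernoulli w).real (cell τ 4) + ((prodBernoulli w).real (cell τ 6) + ((prodBernoulli w).real (cell τ 7) + ((prodBernoulli w).real (cell τ 8) + ((prodBernoulli w).real (cell τ 10) + ((prodBernoulli w).real (cell τ 11) + ((prodBernoulli w).real (cell τ 12) + (prodBernoulli w).real (cell τ 14)))))))))) * (prodBernoulli w).real (cell τ 1) := by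
    have h := row_posA w τ ({2} : Finset (Fin 4)) ({3} : Finset (Fin 4)) (.and (.conn 2 0) (.conn 2 1)) (.or (.conn 2 1) (.sep 3 0)) (by decide) (by decide)
    rw [hD5] at h
    simp only [← ev_and] at h
    simp only [e61, e87, e42, e88] at h
    exact h
  have r35 : ((prodBernoulli w).real (cell τ 2) + ((prodBernoulli w).real (cell τ 8) + (prodBernoulli w).real (cell τ 11))) * ((prodBernoulli w).real (cell τ 2) + ((prodBernoulli w).real (cell τ 4) + ((prodBernoulli w).real (cell τ 6) + ((prodBernoulli w).real (cell τ 7) + ((prodBernoulli w).real (cell τ 8) + ((prodBernoulli w).real (cell τ 10) + ((prodBernoulli w).real (cell τ 11) + ((prodBernoulli w).real (cell τ 12) + (prodBernoulli w).real (cell τ 14))))))))) ≤ ((prodBernoulli w).real (cell τ 1) + ((prodBernoulli w).real (cell τ 2) + ((prodBernoulli w).real (cell τ 4) + ((prodBernoulli w).real (cell τ 6) + ((prodBernoulli w).real (cell τ 7) + ((prodBernoulli w).real (cell τ 8) + ((prodBernoulli w).real (cell τ 10) + ((prodBernoulli w).real (cell τ 11) + ((prodBernoulli w).real (cell τ 12)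 + (prodBernoulli w).real (cell τ 14)))))))))) * ((prodBernoulli w).real (cell τ 2) + ((prodBernoulli w).real (cell τ 8) + (prodBernoulli w).real (cell τ 11))) := by
    have h := row_posB w τ ({2} : Finset (Fin 4)) ({3} : Finset (Fin 4)) (.conn 3 0) (.or (.sep 2 0) (.sep 2 1)) (by decide) (by decide)
    rw [hD5] at h
    simp only [← ev_and] at h
    simp only [e56, e41, e42, e89] at h
    exact h
  -- the certificate: det M^{(1)} = Σ λ_r x_{m_r} R_r + Σ σ_γ x^γ
  have hsum : (0:ℝ) ≤ (1 : ℝ) * (prodBernoulli w).real (cell τ 3) * (((prodBernoulli w).real (cell τ 1) + ((prodBernoulli w).real (cell τ 4) + ((prodBernoulli w).real (cell τ 7) + ((prodBernoulli w).real (cell τ 8) + ((prodBernoulli w).real (cell τ 10) + ((prodBernoulli w).real (cell τ 11) + (prodBernoulli w).real (cell τ 14))))))) * ((prodBernoulli w).real (cell τ 8) + (prodBernoulli w).real (cell τ 11)) - ((prodBernoulli w).real (cell τ 8) + (prodBernoulli w).real (cell τ 11)) * ((prodBernoulli w).real (cell τ 8) + ((prodBernoulli w).real (cell τ 10) + ((prodBernoulli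 w).real (cell τ 11) + (prodBernoulli w).real (cell τ 14))))) + (1/2 : ℝ) * (prodBernoulli w).real (cell τ 3) * (((prodBernoulli w).real (cell τ 1) + ((prodBernoulli w).real (cell τ 3) + ((prodBernoulli w).real (cell τ 4) + ((prodBernoulli w).real (cell τ 7) + ((prodBernoulli w).real (cell τ 10) + ((prodBernoulli w).real (cell τ 13) + (prodBernoulli w).real (cell τ 14))))))) * ((prodBernoulli w).real (cell τ 3) + ((prodBernoulli w).real (cell τ 5) + ((prodBernoulli w).real (cell τ 7) + ((prodBernoulli w).real (cell τ 8) + ((prodBernoulli w).real (cell τ 10) + ((prodBernoulli w).real (cell τ 11) + ((prodBernoulli w).real (cell τ 13) + (prodBernoulli w).real (cell τ 14)))))))) - ((prodBernoulli w).real (cell τ 1) + ((prodBernoulli w).real (cell τ 3) + ((prodBernoulli w).real (cell τ 4) + ((prodBernoulli w).real (cell τ 5) + ((prodBernoulli w).real (cell τ 7) + ((prodBernoulli w).real (cell τ 8) + ((prodBernoulli w).real (cell τ 10) + ((prodBernoulli w).real (cell τ 11) + ((prodBernoulli w).real (cell τ 13) + (prodBernoulli w).real (cell τ 14)))))))))) *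 ((prodBernoulli w).real (cell τ 3) + ((prodBernoulli w).real (cell τ 7) + ((prodBernoulli w).real (cell τ 10) + ((prodBernoulli w).real (cell τ 13) + (prodBernoulli w).real (cell τ 14)))))) + (1 : ℝ) * (prodBernoulli w).real (cell τ 4) * (((prodBernoulli w).real (cell τ 6) + ((prodBernoulli w).real (cell τ 7) + ((prodBernoulli w).real (cell τ 11) + ((prodBernoulli w).real (cell τ 12) + (prodBernoulli w).real (cell τ 14))))) * ((prodBernoulli w).real (cell τ 2) + ((prodBernoulli w).real (cell τ 4) + ((prodBernoulli w).real (cell τ 11) + ((prodBernoulli w).real (cell τ 12) + (prodBernoulli w).real (cell τ 14))))) - ((prodBernoulli w).real (cell τ 2) + ((prodBernoulli w).real (cell τ 4) + ((prodBernoulli w).real (cell τ 6) + ((prodBernoulli w).real (cell τ 7) + ((prodBernoulli w).real (cell τ 11) + ((prodBernoulli w).real (cell τ 12) + (prodBernoulli w).real (cell τ 14))))))) * ((prodBernoulli w).real (cell τ 11) + ((prodBernoulli w).real (cell τ 12) + (prodBernoulli w).real (cell τ 14)))) + (1/2 : ℝ) * (prodBernoulli w).real (cell τ 4) * (((prodBernoulli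 w).real (cell τ 1) + ((prodBernoulli w).real (cell τ 4) + ((prodBernoulli w).real (cell τ 7) + ((prodBernoulli w).real (cell τ 8) + ((prodBernoulli w).real (cell τ 10) + ((prodBernoulli w).real (cell τ 11) + (prodBernoulli w).real (cell τ 14))))))) * ((prodBernoulli w).real (cell τ 1) + ((prodBernoulli w).real (cell τ 4) + (prodBernoulli w).real (cell τ 7))) - ((prodBernoulli w).real (cell τ 1) + ((prodBernoulli w).real (cell τ 4) + ((prodBernoulli w).real (cell τ 7) + ((prodBernoulli w).real (cell τ 10) + (prodBernoulli w).real (cell τ 14))))) * ((prodBernoulli w).real (cell τ 1) + ((prodBernoulli w).real (cell τ 4) + (prodBernoulli w).real (cell τ 7)))) + (1/2 : ℝ) * (prodBernoulli w).real (cell τ 4) * (((prodBernoulli w).real (cell τ 2) + ((prodBernoulli w).real (cell τ 3) + ((prodBernoulli w).real (cell τ 4) + ((prodBernoulli w).real (cell τ 5) + ((prodBernoulli w).real (cell τ 6) + ((prodBernoulli w).real (cell τ 7) + ((prodBernoulli w).real (cell τ 11) + ((prodBernoulli w).real (cell τ 12) + ((prodBernoulli w).real (cell τ 13) + (prodBernoulli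 w).real (cell τ 14)))))))))) * ((prodBernoulli w).real (cell τ 2) + (prodBernoulli w).real (cell τ 4)) - ((prodBernoulli w).real (cell τ 2) + ((prodBernoulli w).real (cell τ 3) + ((prodBernoulli w).real (cell τ 4) + ((prodBernoulli w).real (cell τ 11) + ((prodBernoulli w).real (cell τ 12) + ((prodBernoulli w).real (cell τ 13) + (prodBernoulli w).real (cell τ 14))))))) * ((prodBernoulli w).real (cell τ 2) + (prodBernoulli w).real (cell τ 4))) + (1/2 : ℝ) * (prodBernoulli w).real (cell τ 4) * (((prodBernoulli w).real (cell τ 2) + ((prodBernoulli w).real (cell τ 4) + ((prodBernoulli w).real (cell τ 6) + ((prodBernoulli w).real (cell τ 7) + ((prodBernoulli w).real (cell τ 11) + ((prodBernoulli w).real (cell τ 12) + (prodBernoulli w).real (cell τ 14))))))) * ((prodBernoulli w).real (cell τ 2) + ((prodBernoulli w).real (cell τ 4) + (prodBernoulli w).real (cell τ 11))) - ((prodBernoulli w).real (cell τ 2) + ((prodBernoulli w).real (cell τ 4) + ((prodBernoulli w).real (cell τ 11) + ((prodBernoulli w).real (cell τ 12) + (prodBernoulli w).real (cell τ 14)))))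 * ((prodBernoulli w).real (cell τ 2) + ((prodBernoulli w).real (cell τ 4) + (prodBernoulli w).real (cell τ 11)))) + (3/2 : ℝ) * (prodBernoulli w).real (cell τ 4) * (((prodBernoulli w).real (cell τ 1) + ((prodBernoulli w).real (cell τ 3) + (prodBernoulli w).real (cell τ 4))) * ((prodBernoulli w).real (cell τ 5) + ((prodBernoulli w).real (cell τ 7) + ((prodBernoulli w).real (cell τ 8) + ((prodBernoulli w).real (cell τ 10) + ((prodBernoulli w).real (cell τ 11) + ((prodBernoulli w).real (cell τ 13) + (prodBernoulli w).real (cell τ 14))))))) - ((prodBernoulli w).real (cell τ 1) + ((prodBernoulli w).real (cell τ 3) + (prodBernoulli w).real (cell τ 4))) * ((prodBernoulli w).real (cell τ 7) + ((prodBernoulli w).real (cell τ 10) + ((prodBernoulli w).real (cell τ 13) + (prodBernoulli w).real (cell τ 14))))) + (1 : ℝ) * (prodBernoulli w).real (cell τ 2) * (((prodBernoulli w).real (cell τ 3) + (prodBernoulli w).real (cell τ 4)) * ((prodBernoulli w).real (cell τ 5) + ((prodBernoulli w).real (cell τ 7) + ((prodBernoulli w).real (cell τ 11) + ((prodBernoulli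 w).real (cell τ 13) + (prodBernoulli w).real (cell τ 14))))) - ((prodBernoulli w).real (cell τ 3) + (prodBernoulli w).real (cell τ 4)) * ((prodBernoulli w).real (cell τ 7) + ((prodBernoulli w).real (cell τ 13) + (prodBernoulli w).real (cell τ 14)))) + (1 : ℝ) * (prodBernoulli w).real (cell τ 2) * (((prodBernoulli w).real (cell τ 3) + ((prodBernoulli w).real (cell τ 4) + ((prodBernoulli w).real (cell τ 5) + ((prodBernoulli w).real (cell τ 7) + ((prodBernoulli w).real (cell τ 11) + ((prodBernoulli w).real (cell τ 13) + (prodBernoulli w).real (cell τ 14))))))) * ((prodBernoulli w).real (cell τ 5) + ((prodBernoulli w).real (cell τ 7) + (prodBernoulli w).real (cell τ 11))) - ((prodBernoulli w).real (cell τ 5) + ((prodBernoulli w).real (cell τ 7) + ((prodBernoulli w).real (cell τ 11) + ((prodBernoulli w).real (cell τ 13) + (prodBernoulli w).real (cell τ 14))))) * ((prodBernoulli w).real (cell τ 5) + ((prodBernoulli w).real (cell τ 7) + (prodBernoulli w).real (cell τ 11)))) + (7/2 : ℝ) * (prodBernoulli w).real (cell τ 4) * (((prodBernoulli w).real (cell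 τ 1) + ((prodBernoulli w).real (cell τ 2) + ((prodBernoulli w).real (cell τ 4) + ((prodBernoulli w).real (cell τ 6) + ((prodBernoulli w).real (cell τ 7) + ((prodBernoulli w).real (cell τ 8) + ((prodBernoulli w).real (cell τ 10) + ((prodBernoulli w).real (cell τ 11) + ((prodBernoulli w).real (cell τ 12) + (prodBernoulli w).real (cell τ 14)))))))))) * (prodBernoulli w).real (cell τ 2) - (prodBernoulli w).real (cell τ 2) * ((prodBernoulli w).real (cell τ 2) + ((prodBernoulli w).real (cell τ 4) + ((prodBernoulli w).real (cell τ 6) + ((prodBernoulli w).real (cell τ 7) + ((prodBernoulli w).real (cell τ 8) + ((prodBernoulli w).real (cell τ 10) + ((prodBernoulli w).real (cell τ 11) + ((prodBernoulli w).real (cell τ 12) + (prodBernoulli w).real (cell τ 14)))))))))) + (1 : ℝ) * (prodBernoulli w).real (cell τ 8) * (((prodBernoulli w).real (cell τ 3) + ((prodBernoulli w).real (cell τ 4) + ((prodBernoulli w).real (cell τ 11) + ((prodBernoulli w).real (cell τ 13) + (prodBernoulli w).real (cell τ 14))))) * ((prodBernoulli w).real (cell τ 5) + (prodBernoulli w).real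 (cell τ 11)) - ((prodBernoulli w).real (cell τ 5) + (prodBernoulli w).real (cell τ 11)) * ((prodBernoulli w).real (cell τ 11) + ((prodBernoulli w).real (cell τ 13) + (prodBernoulli w).real (cell τ 14)))) + (1 : ℝ) * (prodBernoulli w).real (cell τ 6) * (((prodBernoulli w).real (cell τ 3) + ((prodBernoulli w).real (cell τ 4) + ((prodBernoulli w).real (cell τ 5) + ((prodBernoulli w).real (cell τ 7) + ((prodBernoulli w).real (cell τ 11) + ((prodBernoulli w).real (cell τ 13) + (prodBernoulli w).real (cell τ 14))))))) * ((prodBernoulli w).real (cell τ 5) + (prodBernoulli w).real (cell τ 7)) - ((prodBernoulli w).real (cell τ 5) + (prodBernoulli w).real (cell τ 7)) * ((prodBernoulli w).real (cell τ 5) + ((prodBernoulli w).real (cell τ 7) + ((prodBernoulli w).real (cell τ 11) + ((prodBernoulli w).real (cell τ 13) + (prodBernoulli w).real (cell τ 14)))))) + (1/2 : ℝ) * (prodBernoulli w).real (cell τ 4) * (((prodBernoulli w).real (cell τ 1) + ((prodBernoulli w).real (cell τ 4) + ((prodBernoulli w).real (cell τ 6) + ((prodBernoulli w).real (cell τ 7)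 + ((prodBernoulli w).real (cell τ 8) + ((prodBernoulli w).real (cell τ 10) + ((prodBernoulli w).real (cell τ 11) + ((prodBernoulli w).real (cell τ 12) + (prodBernoulli w).real (cell τ 14))))))))) * ((prodBernoulli w).real (cell τ 2) + ((prodBernoulli w).real (cell τ 4) + ((prodBernoulli w).real (cell τ 8) + ((prodBernoulli w).real (cell τ 10) + ((prodBernoulli w).real (cell τ 11) + ((prodBernoulli w).real (cell τ 12) + (prodBernoulli w).real (cell τ 14))))))) - ((prodBernoulli w).real (cell τ 1) + ((prodBernoulli w).real (cell τ 2) + ((prodBernoulli w).real (cell τ 4) + ((prodBernoulli w).real (cell τ 6) + ((prodBernoulli w).real (cell τ 7) + ((prodBernoulli w).real (cell τ 8) + ((prodBernoulli w).real (cell τ 10) + ((prodBernoulli w).real (cell τ 11) + ((prodBernoulli w).real (cell τ 12) + (prodBernoulli w).real (cell τ 14)))))))))) * ((prodBernoulli w).real (cell τ 4) + ((prodBernoulli w).real (cell τ 8) + ((prodBernoulli w).real (cell τ 10) + ((prodBernoulli w).real (cell τ 11) + ((prodBernoulli w).real (cell τ 12) + (prodBernoulli w).real (cell τ 14)))))))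 + (3/2 : ℝ) * (prodBernoulli w).real (cell τ 1) * (((prodBernoulli w).real (cell τ 3) + ((prodBernoulli w).real (cell τ 4) + ((prodBernoulli w).real (cell τ 5) + ((prodBernoulli w).real (cell τ 7) + ((prodBernoulli w).real (cell τ 11) + ((prodBernoulli w).real (cell τ 13) + (prodBernoulli w).real (cell τ 14))))))) * ((prodBernoulli w).real (cell τ 3) + (prodBernoulli w).real (cell τ 4)) - ((prodBernoulli w).real (cell τ 3) + (prodBernoulli w).real (cell τ 4)) * ((prodBernoulli w).real (cell τ 3) + ((prodBernoulli w).real (cell τ 4) + ((prodBernoulli w).real (cell τ 11) + ((prodBernoulli w).real (cell τ 13) + (prodBernoulli w).real (cell τ 14)))))) + (1/2 : ℝ) * (prodBernoulli w).real (cell τ 4) * (((prodBernoulli w).real (cell τ 1) + ((prodBernoulli w).real (cell τ 2) + ((prodBernoulli w).real (cell τ 4) + ((prodBernoulli w).real (cell τ 6) + ((prodBernoulli w).real (cell τ 7) + ((prodBernoulli w).real (cell τ 8) + ((prodBernoulli w).real (cell τ 10) + ((prodBernoulli w).real (cell τ 11) + ((prodBernoulli w).real (cell τ 12) + (prodBernoulli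 w).real (cell τ 14)))))))))) * ((prodBernoulli w).real (cell τ 2) + ((prodBernoulli w).real (cell τ 8) + (prodBernoulli w).real (cell τ 11))) - ((prodBernoulli w).real (cell τ 2) + ((prodBernoulli w).real (cell τ 8) + (prodBernoulli w).real (cell τ 11))) * ((prodBernoulli w).real (cell τ 2) + ((prodBernoulli w).real (cell τ 4) + ((prodBernoulli w).real (cell τ 8) + ((prodBernoulli w).real (cell τ 10) + ((prodBernoulli w).real (cell τ 11) + ((prodBernoulli w).real (cell τ 12) + (prodBernoulli w).real (cell τ 14)))))))) + (1/2 : ℝ) * (prodBernoulli w).real (cell τ 11) * (((prodBernoulli w).real (cell τ 3) + ((prodBernoulli w).real (cell τ 4) + ((prodBernoulli w).real (cell τ 7) + ((prodBernoulli w).real (cell τ 13) + (prodBernoulli w).real (cell τ 14))))) * ((prodBernoulli w).real (cell τ 5) + (prodBernoulli w).real (cell τ 11)) - ((prodBernoulli w).real (cell τ 5) + (prodBernoulli w).real (cell τ 11)) * ((prodBernoulli w).real (cell τ 7) + ((prodBernoulli w).real (cell τ 13) + (prodBernoulli w).real (cell τ 14)))) + (1 : ℝ) * (prodBernoulli w).real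 (cell τ 7) * (((prodBernoulli w).real (cell τ 3) + ((prodBernoulli w).real (cell τ 4) + ((prodBernoulli w).real (cell τ 5) + ((prodBernoulli w).real (cell τ 7) + ((prodBernoulli w).real (cell τ 11) + ((prodBernoulli w).real (cell τ 13) + (prodBernoulli w).real (cell τ 14))))))) * ((prodBernoulli w).real (cell τ 3) + (prodBernoulli w).real (cell τ 4)) - ((prodBernoulli w).real (cell τ 3) + (prodBernoulli w).real (cell τ 4)) * ((prodBernoulli w).real (cell τ 3) + ((prodBernoulli w).real (cell τ 4) + ((prodBernoulli w).real (cell τ 11) + ((prodBernoulli w).real (cell τ 13) + (prodBernoulli w).real (cell τ 14)))))) + (2 : ℝ) * (prodBernoulli w).real (cell τ 5) * ((prodBernoulli w).real (cell τ 1) * (prodBernoulli w).real (cell τ 2) - (prodBernoulli w).real (cell τ 6) * (prodBernoulli w).real (cell τ 8)) + (7/2 : ℝ) * (prodBernoulli w).real (cell τ 3) * (((prodBernoulli w).real (cell τ 2) + ((prodBernoulli w).real (cell τ 4) + ((prodBernoulli w).real (cell τ 6) + ((prodBernoulli w).real (cell τ 7) + ((prodBernoulli w).real (cell τ 11) + ((prodBernoulli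 w).real (cell τ 12) + (prodBernoulli w).real (cell τ 14))))))) * ((prodBernoulli w).real (cell τ 6) + (prodBernoulli w).real (cell τ 7)) - ((prodBernoulli w).real (cell τ 6) + (prodBernoulli w).real (cell τ 7)) * ((prodBernoulli w).real (cell τ 6) + ((prodBernoulli w).real (cell τ 7) + ((prodBernoulli w).real (cell τ 11) + ((prodBernoulli w).real (cell τ 12) + (prodBernoulli w).real (cell τ 14)))))) + (1 : ℝ) * (prodBernoulli w).real (cell τ 7) * (((prodBernoulli w).real (cell τ 3) + ((prodBernoulli w).real (cell τ 4) + ((prodBernoulli w).real (cell τ 7) + ((prodBernoulli w).real (cell τ 11) + ((prodBernoulli w).real (cell τ 13) + (prodBernoulli w).real (cell τ 14)))))) * ((prodBernoulli w).real (cell τ 5) + ((prodBernoulli w).real (cell τ 7) + ((prodBernoulli w).real (cell τ 11) + ((prodBernoulli w).real (cell τ 13) + (prodBernoulli w).real (cell τ 14))))) - ((prodBernoulli w).real (cell τ 3) + ((prodBernoulli w).real (cell τ 4) + ((prodBernoulli w).real (cell τ 5) + ((prodBernoulli w).real (cell τ 7) + ((prodBernoulli w).real (cell τ 11) + ((prodBernoulli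 w).real (cell τ 13) + (prodBernoulli w).real (cell τ 14))))))) * ((prodBernoulli w).real (cell τ 7) + ((prodBernoulli w).real (cell τ 11) + ((prodBernoulli w).real (cell τ 13) + (prodBernoulli w).real (cell τ 14))))) + (1 : ℝ) * ((prodBernoulli w).real (cell τ 0) + ((prodBernoulli w).real (cell τ 2) + (prodBernoulli w).real (cell τ 6))) * ((prodBernoulli w).real (cell τ 1) * (prodBernoulli w).real (cell τ 2) - (prodBernoulli w).real (cell τ 6) * (prodBernoulli w).real (cell τ 8)) + (1 : ℝ) * (prodBernoulli w).real (cell τ 11) * (((prodBernoulli w).real (cell τ 3) + ((prodBernoulli w).real (cell τ 4) + ((prodBernoulli w).real (cell τ 5) + ((prodBernoulli w).real (cell τ 7) + ((prodBernoulli w).real (cell τ 11) + ((prodBernoulli w).real (cell τ 13) + (prodBernoulli w).real (cell τ 14))))))) * ((prodBernoulli w).real (cell τ 3) + (prodBernoulli w).real (cell τ 4)) - ((prodBernoulli w).real (cell τ 3) + (prodBernoulli w).real (cell τ 4)) * ((prodBernoulli w).real (cell τ 3) + ((prodBernoulli w).real (cell τ 4) + ((prodBernoulli w).real (cell τ 7)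 + ((prodBernoulli w).real (cell τ 11) + ((prodBernoulli w).real (cell τ 13) + (prodBernoulli w).real (cell τ 14))))))) + (1 : ℝ) * ((prodBernoulli w).real (cell τ 0) + ((prodBernoulli w).real (cell τ 1) + (prodBernoulli w).real (cell τ 8))) * ((prodBernoulli w).real (cell τ 1) * (prodBernoulli w).real (cell τ 2) - (prodBernoulli w).real (cell τ 6) * (prodBernoulli w).real (cell τ 8)) + (1 : ℝ) * (prodBernoulli w).real (cell τ 3) * (((prodBernoulli w).real (cell τ 8) + (prodBernoulli w).real (cell τ 11)) * ((prodBernoulli w).real (cell τ 1) + ((prodBernoulli w).real (cell τ 4) + ((prodBernoulli w).real (cell τ 7) + ((prodBernoulli w).real (cell τ 10) + (prodBernoulli w).real (cell τ 14))))) - ((prodBernoulli w).real (cell τ 8) + (prodBernoulli w).real (cell τ 11)) * ((prodBernoulli w).real (cell τ 7) + ((prodBernoulli w).real (cell τ 10) + (prodBernoulli w).real (cell τ 14)))) + (1/2 : ℝ) * (prodBernoulli w).real (cell τ 4) * (((prodBernoulli w).real (cell τ 1) + ((prodBernoulli w).real (cell τ 4) + ((prodBernoulli w).real (cell τ 7)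 + ((prodBernoulli w).real (cell τ 8) + ((prodBernoulli w).real (cell τ 10) + ((prodBernoulli w).real (cell τ 11) + (prodBernoulli w).real (cell τ 14))))))) * (prodBernoulli w).real (cell τ 1) - ((prodBernoulli w).real (cell τ 1) + ((prodBernoulli w).real (cell τ 4) + ((prodBernoulli w).real (cell τ 7) + ((prodBernoulli w).real (cell τ 10) + (prodBernoulli w).real (cell τ 14))))) * (prodBernoulli w).real (cell τ 1)) + (1 : ℝ) * (prodBernoulli w).real (cell τ 3) * (((prodBernoulli w).real (cell τ 1) + ((prodBernoulli w).real (cell τ 2) + ((prodBernoulli w).real (cell τ 4) + ((prodBernoulli w).real (cell τ 6) + ((prodBernoulli w).real (cell τ 7) + ((prodBernoulli w).real (cell τ 8) + ((prodBernoulli w).real (cell τ 10) + ((prodBernoulli w).real (cell τ 11) + ((prodBernoulli w).real (cell τ 12) + (prodBernoulli w).real (cell τ 14)))))))))) * ((prodBernoulli w).real (cell τ 2) + (prodBernoulli w).real (cell τ 11)) - ((prodBernoulli w).real (cell τ 2) + (prodBernoulli w).real (cell τ 11)) * ((prodBernoulli w).real (cell τ 2) + ((prodBernoulli w).real (cell τ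 4) + ((prodBernoulli w).real (cell τ 6) + ((prodBernoulli w).real (cell τ 7) + ((prodBernoulli w).real (cell τ 8) + ((prodBernoulli w).real (cell τ 10) + ((prodBernoulli w).real (cell τ 11) + ((prodBernoulli w).real (cell τ 12) + (prodBernoulli w).real (cell τ 14)))))))))) + (1/2 : ℝ) * (prodBernoulli w).real (cell τ 3) * (((prodBernoulli w).real (cell τ 2) + ((prodBernoulli w).real (cell τ 4) + ((prodBernoulli w).real (cell τ 6) + ((prodBernoulli w).real (cell τ 7) + ((prodBernoulli w).real (cell τ 11) + ((prodBernoulli w).real (cell τ 12) + (prodBernoulli w).real (cell τ 14))))))) * ((prodBernoulli w).real (cell τ 2) + ((prodBernoulli w).real (cell τ 4) + (prodBernoulli w).real (cell τ 11))) - ((prodBernoulli w).real (cell τ 2) + ((prodBernoulli w).real (cell τ 4) + ((prodBernoulli w).real (cell τ 11) + ((prodBernoulli w).real (cell τ 12) + (prodBernoulli w).real (cell τ 14))))) * ((prodBernoulli w).real (cell τ 2) + ((prodBernoulli w).real (cell τ 4) + (prodBernoulli w).real (cell τ 11)))) + (1 : ℝ) * (prodBernoulli w).real (cell τ 11) * ((prodBernoulli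 w).real (cell τ 1) * (prodBernoulli w).real (cell τ 2) - (prodBernoulli w).real (cell τ 6) * (prodBernoulli w).real (cell τ 8)) + (1/2 : ℝ) * (prodBernoulli w).real (cell τ 2) * (((prodBernoulli w).real (cell τ 3) + ((prodBernoulli w).real (cell τ 4) + ((prodBernoulli w).real (cell τ 5) + ((prodBernoulli w).real (cell τ 7) + ((prodBernoulli w).real (cell τ 11) + ((prodBernoulli w).real (cell τ 13) + (prodBernoulli w).real (cell τ 14))))))) * (prodBernoulli w).real (cell τ 4) - ((prodBernoulli w).real (cell τ 3) + ((prodBernoulli w).real (cell τ 4) + ((prodBernoulli w).real (cell τ 7) + ((prodBernoulli w).real (cell τ 13) + (prodBernoulli w).real (cell τ 14))))) * (prodBernoulli w).real (cell τ 4)) + (1 : ℝ) * ((prodBernoulli w).real (cell τ 0) + ((prodBernoulli w).real (cell τ 1) + ((prodBernoulli w).real (cell τ 5) + ((prodBernoulli w).real (cell τ 6) + (prodBernoulli w).real (cell τ 7))))) * (((prodBernoulli w).real (cell τ 1) + (prodBernoulli w).real (cell τ 7)) * ((prodBernoulli w).real (cell τ 2) + (prodBernoulli w).real (cell τ 11))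 - ((prodBernoulli w).real (cell τ 6) + (prodBernoulli w).real (cell τ 7)) * ((prodBernoulli w).real (cell τ 8) + (prodBernoulli w).real (cell τ 11))) + (1 : ℝ) * (prodBernoulli w).real (cell τ 7) * ((prodBernoulli w).real (cell τ 1) * (prodBernoulli w).real (cell τ 2) - (prodBernoulli w).real (cell τ 6) * (prodBernoulli w).real (cell τ 8)) + (1/2 : ℝ) * (prodBernoulli w).real (cell τ 4) * ((prodBernoulli w).real (cell τ 1) * (prodBernoulli w).real (cell τ 2) - (prodBernoulli w).real (cell τ 6) * (prodBernoulli w).real (cell τ 8)) + (1 : ℝ) * ((prodBernoulli w).real (cell τ 0) + ((prodBernoulli w).real (cell τ 2) + ((prodBernoulli w).real (cell τ 5) + ((prodBernoulli w).real (cell τ 8) + (prodBernoulli w).real (cell τ 11))))) * (((prodBernoulli w).real (cell τ 1) + (prodBernoulli w).real (cell τ 7)) * ((prodBernoulli w).real (cell τ 2) + (prodBernoulli w).real (cell τ 11)) - ((prodBernoulli w).real (cell τ 6) + (prodBernoulli w).real (cell τ 7)) * ((prodBernoulli w).real (cell τ 8) + (prodBernoulli w).real (cell τ 11))) + (1/2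 : ℝ) * (prodBernoulli w).real (cell τ 11) * (((prodBernoulli w).real (cell τ 3) + ((prodBernoulli w).real (cell τ 4) + ((prodBernoulli w).real (cell τ 5) + ((prodBernoulli w).real (cell τ 7) + ((prodBernoulli w).real (cell τ 11) + ((prodBernoulli w).real (cell τ 13) + (prodBernoulli w).real (cell τ 14))))))) * ((prodBernoulli w).real (cell τ 3) + (prodBernoulli w).real (cell τ 4)) - ((prodBernoulli w).real (cell τ 3) + (prodBernoulli w).real (cell τ 4)) * ((prodBernoulli w).real (cell τ 3) + ((prodBernoulli w).real (cell τ 4) + ((prodBernoulli w).real (cell τ 13) + (prodBernoulli w).real (cell τ 14))))) + (1 : ℝ) * (prodBernoulli w).real (cell τ 4) * (((prodBernoulli w).real (cell τ 1) + ((prodBernoulli w).real (cell τ 2) + ((prodBernoulli w).real (cell τ 4) + ((prodBernoulli w).real (cell τ 6) + ((prodBernoulli w).real (cell τ 7) + ((prodBernoulli w).real (cell τ 8) + ((prodBernoulli w).real (cell τ 10) + ((prodBernoulli w).real (cell τ 11) + ((prodBernoulli w).real (cell τ 12) + (prodBernoulli w).real (cell τ 14)))))))))) * (prodBernoulli w).real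 (cell τ 1) - (prodBernoulli w).real (cell τ 1) * ((prodBernoulli w).real (cell τ 1) + ((prodBernoulli w).real (cell τ 4) + ((prodBernoulli w).real (cell τ 6) + ((prodBernoulli w).real (cell τ 7) + ((prodBernoulli w).real (cell τ 8) + ((prodBernoulli w).real (cell τ 10) + ((prodBernoulli w).real (cell τ 12) + (prodBernoulli w).real (cell τ 14))))))))) + (3/2 : ℝ) * (prodBernoulli w).real (cell τ 3) * (((prodBernoulli w).real (cell τ 1) + ((prodBernoulli w).real (cell τ 2) + ((prodBernoulli w).real (cell τ 4) + ((prodBernoulli w).real (cell τ 6) + ((prodBernoulli w).real (cell τ 7) + ((prodBernoulli w).real (cell τ 8) + ((prodBernoulli w).real (cell τ 10) + ((prodBernoulli w).real (cell τ 11) + ((prodBernoulli w).real (cell τ 12) + (prodBernoulli w).real (cell τ 14)))))))))) * ((prodBernoulli w).real (cell τ 2) + ((prodBernoulli w).real (cell τ 8) + (prodBernoulli w).real (cell τ 11))) - ((prodBernoulli w).real (cell τ 2) + ((prodBernoulli w).real (cell τ 8) + (prodBernoulli w).real (cell τ 11))) * ((prodBernoulli w).real (cell τ 2) + ((prodBernoulli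 w).real (cell τ 4) + ((prodBernoulli w).real (cell τ 6) + ((prodBernoulli w).real (cell τ 7) + ((prodBernoulli w).real (cell τ 8) + ((prodBernoulli w).real (cell τ 10) + ((prodBernoulli w).real (cell τ 11) + ((prodBernoulli w).real (cell τ 12) + (prodBernoulli w).real (cell τ 14)))))))))) + (1 : ℝ) * ((prodBernoulli w).real (cell τ 4) * (prodBernoulli w).real (cell τ 4) * (prodBernoulli w).real (cell τ 4)) + (2 : ℝ) * ((prodBernoulli w).real (cell τ 2) * (prodBernoulli w).real (cell τ 2) * (prodBernoulli w).real (cell τ 4)) + (3 : ℝ) * ((prodBernoulli w).real (cell τ 2) * (prodBernoulli w).real (cell τ 4) * (prodBernoulli w).real (cell τ 4)) + (3 : ℝ) * ((prodBernoulli w).real (cell τ 0) * (prodBernoulli w).real (cell τ 4) * (prodBernoulli w).real (cell τ 4)) + (3 : ℝ) * ((prodBernoulli w).real (cell τ 1) * (prodBernoulli w).real (cell τ 4) * (prodBernoulli w).real (cell τ 4)) + (4 : ℝ) * ((prodBernoulli w).real (cell τ 0) * (prodBernoulli w).real (cell τ 2) * (prodBernoulli w).real (cell τ 4)) + (6 :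 ℝ) * ((prodBernoulli w).real (cell τ 1) * (prodBernoulli w).real (cell τ 3) * (prodBernoulli w).real (cell τ 4)) + (4 : ℝ) * ((prodBernoulli w).real (cell τ 0) * (prodBernoulli w).real (cell τ 1) * (prodBernoulli w).real (cell τ 4)) + (2 : ℝ) * ((prodBernoulli w).real (cell τ 1) * (prodBernoulli w).real (cell τ 1) * (prodBernoulli w).real (cell τ 4)) + (4 : ℝ) * ((prodBernoulli w).real (cell τ 0) * (prodBernoulli w).real (cell τ 3) * (prodBernoulli w).real (cell τ 4)) + (4 : ℝ) * ((prodBernoulli w).real (cell τ 0) * (prodBernoulli w).real (cell τ 1) * (prodBernoulli w).real (cell τ 3)) + (6 : ℝ) * ((prodBernoulli w).real (cell τ 2) * (prodBernoulli w).real (cell τ 3) * (prodBernoulli w).real (cell τ 4)) + (2 : ℝ) * ((prodBernoulli w).real (cell τ 1) * (prodBernoulli w).real (cell τ 1) * (prodBernoulli w).real (cell τ 3)) + (3 : ℝ) * ((prodBernoulli w).real (cell τ 3) * (prodBernoulli w).real (cell τ 4) * (prodBernoulli w).real (cell τ 4)) + (4 : ℝ) * ((prodBernoulli w).real (cell τ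 0) * (prodBernoulli w).real (cell τ 3) * (prodBernoulli w).real (cell τ 8)) + (4 : ℝ) * ((prodBernoulli w).real (cell τ 0) * (prodBernoulli w).real (cell τ 3) * (prodBernoulli w).real (cell τ 6)) + (4 : ℝ) * ((prodBernoulli w).real (cell τ 0) * (prodBernoulli w).real (cell τ 2) * (prodBernoulli w).real (cell τ 3)) + (2 : ℝ) * ((prodBernoulli w).real (cell τ 2) * (prodBernoulli w).real (cell τ 2) * (prodBernoulli w).real (cell τ 3)) + (2 : ℝ) * ((prodBernoulli w).real (cell τ 0) * (prodBernoulli w).real (cell τ 4) * (prodBernoulli w).real (cell τ 8)) + (2 : ℝ) * ((prodBernoulli w).real (cell τ 0) * (prodBernoulli w).real (cell τ 4) * (prodBernoulli w).real (cell τ 6)) + (3 : ℝ) * ((prodBernoulli w).real (cell τ 1) * (prodBernoulli w).real (cell τ 4) * (prodBernoulli w).real (cell τ 6)) + (4 : ℝ) * ((prodBernoulli w).real (cell τ 2) * (prodBernoulli w).real (cell τ 3) * (prodBernoulli w).real (cell τ 8)) + (3 : ℝ) * ((prodBernoulli w).real (cell τ 2) * (prodBernoulli w).real (cell τ 4) *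 (prodBernoulli w).real (cell τ 8)) + (4 : ℝ) * ((prodBernoulli w).real (cell τ 1) * (prodBernoulli w).real (cell τ 3) * (prodBernoulli w).real (cell τ 6)) + (2 : ℝ) * ((prodBernoulli w).real (cell τ 1) * (prodBernoulli w).real (cell τ 3) * (prodBernoulli w).real (cell τ 3)) + (2 : ℝ) * ((prodBernoulli w).real (cell τ 3) * (prodBernoulli w).real (cell τ 8) * (prodBernoulli w).real (cell τ 8)) + (2 : ℝ) * ((prodBernoulli w).real (cell τ 3) * (prodBernoulli w).real (cell τ 6) * (prodBernoulli w).real (cell τ 6)) + (2 : ℝ) * ((prodBernoulli w).real (cell τ 2) * (prodBernoulli w).real (cell τ 3) * (prodBernoulli w).real (cell τ 3)) + (1 : ℝ) * ((prodBernoulli w).real (cell τ 4) * (prodBernoulli w).real (cell τ 6) * (prodBernoulli w).real (cell τ 6)) + (3/2 : ℝ) * ((prodBernoulli w).real (cell τ 1) * (prodBernoulli w).real (cell τ 3) * (prodBernoulli w).real (cell τ 7)) + (2 : ℝ) * ((prodBernoulli w).real (cell τ 3) * (prodBernoulli w).real (cell τ 3) * (prodBernoulli w).real (cell τ 4)) +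 (3/2 : ℝ) * ((prodBernoulli w).real (cell τ 1) * (prodBernoulli w).real (cell τ 4) * (prodBernoulli w).real (cell τ 7)) + (2 : ℝ) * ((prodBernoulli w).real (cell τ 3) * (prodBernoulli w).real (cell τ 3) * (prodBernoulli w).real (cell τ 11)) + (1 : ℝ) * ((prodBernoulli w).real (cell τ 2) * (prodBernoulli w).real (cell τ 3) * (prodBernoulli w).real (cell τ 11)) + (1 : ℝ) * ((prodBernoulli w).real (cell τ 4) * (prodBernoulli w).real (cell τ 8) * (prodBernoulli w).real (cell τ 8)) + (2 : ℝ) * ((prodBernoulli w).real (cell τ 3) * (prodBernoulli w).real (cell τ 8) * (prodBernoulli w).real (cell τ 11)) + (4 : ℝ) * ((prodBernoulli w).real (cell τ 0) * (prodBernoulli w).real (cell τ 3) * (prodBernoulli w).real (cell τ 7)) + (2 : ℝ) * ((prodBernoulli w).real (cell τ 3) * (prodBernoulli w).real (cell τ 3) * (prodBernoulli w).real (cell τ 6)) + (2 : ℝ) * ((prodBernoulli w).real (cell τ 3) * (prodBernoulli w).real (cell τ 6) * (prodBernoulli w).real (cell τ 7)) + (2 : ℝ) * ((prodBernoulli w).real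 (cell τ 3) * (prodBernoulli w).real (cell τ 3) * (prodBernoulli w).real (cell τ 8)) + (3 : ℝ) * ((prodBernoulli w).real (cell τ 0) * (prodBernoulli w).real (cell τ 4) * (prodBernoulli w).real (cell τ 11)) + (2 : ℝ) * ((prodBernoulli w).real (cell τ 3) * (prodBernoulli w).real (cell τ 3) * (prodBernoulli w).real (cell τ 7)) + (1 : ℝ) * ((prodBernoulli w).real (cell τ 3) * (prodBernoulli w).real (cell τ 5) * (prodBernoulli w).real (cell τ 6)) + (1 : ℝ) * ((prodBernoulli w).real (cell τ 4) * (prodBernoulli w).real (cell τ 8) * (prodBernoulli w).real (cell τ 11)) + (1/2 : ℝ) * ((prodBernoulli w).real (cell τ 3) * (prodBernoulli w).real (cell τ 6) * (prodBernoulli w).real (cell τ 11)) + (4 : ℝ) * ((prodBernoulli w).real (cell τ 0) * (prodBernoulli w).real (cell τ 3) * (prodBernoulli w).real (cell τ 11)) + (3 : ℝ) * ((prodBernoulli w).real (cell τ 0) * (prodBernoulli w).real (cell τ 4) * (prodBernoulli w).real (cell τ 7)) + (1 : ℝ) * ((prodBernoulli w).real (cell τ 3) * (prodBernoulli w).real (cell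 τ 5) * (prodBernoulli w).real (cell τ 8)) + (1 : ℝ) * ((prodBernoulli w).real (cell τ 4) * (prodBernoulli w).real (cell τ 6) * (prodBernoulli w).real (cell τ 7)) + (1/2 : ℝ) * ((prodBernoulli w).real (cell τ 2) * (prodBernoulli w).real (cell τ 4) * (prodBernoulli w).real (cell τ 11)) + (11/2 : ℝ) * ((prodBernoulli w).real (cell τ 1) * (prodBernoulli w).real (cell τ 2) * (prodBernoulli w).real (cell τ 3)) :=
    add_nonneg (add_nonneg (add_nonneg (add_nonneg (add_nonneg (add_nonneg (add_nonneg (add_nonneg (add_nonneg (add_nonneg (add_nonneg (add_nonneg (add_nonneg (add_nonneg (add_nonneg (add_nonneg (add_nonneg (add_nonneg (add_nonneg (add_nonneg (add_nonneg (add_nonneg (add_nonneg (add_nonneg (add_nonneg (add_nonneg (add_nonneg (add_nonneg (add_nonneg (add_nonneg (add_nonneg (add_nonneg (add_nonneg (add_nonneg (add_nonneg (add_nonneg (add_nonneg (add_nonneg (add_nonneg (add_nonneg (add_nonneg (add_nonneg (add_nonneg (add_nonneg (add_nonneg (add_nonneg (add_nonneg (add_nonneg (add_nonneg (add_nonneg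 (add_nonneg (add_nonneg (add_nonneg (add_nonneg (add_nonneg (add_nonneg (add_nonneg (add_nonneg (add_nonneg (add_nonneg (add_nonneg (add_nonneg (add_nonneg (add_nonneg (add_nonneg (add_nonneg (add_nonneg (add_nonneg (add_nonneg (add_nonneg (add_nonneg (add_nonneg (add_nonneg (add_nonneg (add_nonneg (add_nonneg (add_nonneg (add_nonneg (add_nonneg (add_nonneg (add_nonneg (add_nonneg (add_nonneg (add_nonneg (add_nonneg (add_nonneg (mul_nonneg (mul_nonneg (by norm_num) measureReal_nonneg) (sub_nonneg.2 r0)) (mul_nonneg (mul_nonneg (by norm_num) measureReal_nonneg) (sub_nonneg.2 r1))) (mul_nonneg (mul_nonneg (by norm_num) measureReal_nonneg) (sub_nonneg.2 r2))) (mul_nonneg (mul_nonneg (by norm_num) measureReal_nonneg) (sub_nonneg.2 r3))) (mul_nonneg (mul_nonneg (by norm_num) measureReal_nonneg) (sub_nonneg.2 r4))) (mul_nonneg (mul_nonneg (by norm_num) measureReal_nonneg) (sub_nonneg.2 r5))) (mul_nonneg (mul_nonneg (by norm_num) measureReal_nonneg) (sub_nonneg.2 r6))) (mul_nonneg (mul_nonneg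 (by norm_num) measureReal_nonneg) (sub_nonneg.2 r7))) (mul_nonneg (mul_nonneg (by norm_num) measureReal_nonneg) (sub_nonneg.2 r8))) (mul_nonneg (mul_nonneg (by norm_num) measureReal_nonneg) (sub_nonneg.2 r9))) (mul_nonneg (mul_nonneg (by norm_num) measureReal_nonneg) (sub_nonneg.2 r10))) (mul_nonneg (mul_nonneg (by norm_num) measureReal_nonneg) (sub_nonneg.2 r11))) (mul_nonneg (mul_nonneg (by norm_num) measureReal_nonneg) (sub_nonneg.2 r12))) (mul_nonneg (mul_nonneg (by norm_num) measureReal_nonneg) (sub_nonneg.2 r13))) (mul_nonneg (mul_nonneg (by norm_num) measureReal_nonneg) (sub_nonneg.2 r14))) (mul_nonneg (mul_nonneg (by norm_num) measureReal_nonneg) (sub_nonneg.2 r15))) (mul_nonneg (mul_nonneg (by norm_num) measureReal_nonneg) (sub_nonneg.2 r16))) (mul_nonneg (mul_nonneg (by norm_num) measureReal_nonneg) (sub_nonneg.2 r17))) (mul_nonneg (mul_nonneg (by norm_num) measureReal_nonneg) (sub_nonneg.2 r18))) (mul_nonneg (mul_nonneg (by norm_num) measureReal_nonneg) (sub_nonneg.2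 r19))) (mul_nonneg (mul_nonneg (by norm_num) (by positivity)) (sub_nonneg.2 r20))) (mul_nonneg (mul_nonneg (by norm_num) measureReal_nonneg) (sub_nonneg.2 r21))) (mul_nonneg (mul_nonneg (by norm_num) (by positivity)) (sub_nonneg.2 r22))) (mul_nonneg (mul_nonneg (by norm_num) measureReal_nonneg) (sub_nonneg.2 r23))) (mul_nonneg (mul_nonneg (by norm_num) measureReal_nonneg) (sub_nonneg.2 r24))) (mul_nonneg (mul_nonneg (by norm_num) measureReal_nonneg) (sub_nonneg.2 r25))) (mul_nonneg (mul_nonneg (by norm_num) measureReal_nonneg) (sub_nonneg.2 r26))) (mul_nonneg (mul_nonneg (by norm_num) measureReal_nonneg) (sub_nonneg.2 r27))) (mul_nonneg (mul_nonneg (by norm_num) measureReal_nonneg) (sub_nonneg.2 r28))) (mul_nonneg (mul_nonneg (by norm_num) (by positivity)) (sub_nonneg.2 r29))) (mul_nonneg (mul_nonneg (by norm_num) measureReal_nonneg) (sub_nonneg.2 r30))) (mul_nonneg (mul_nonneg (by norm_num) measureReal_nonneg) (sub_nonneg.2 r31))) (mul_nonneg (mul_nonneg (by norm_num) (by positivity))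 (sub_nonneg.2 r32))) (mul_nonneg (mul_nonneg (by norm_num) measureReal_nonneg) (sub_nonneg.2 r33))) (mul_nonneg (mul_nonneg (by norm_num) measureReal_nonneg) (sub_nonneg.2 r34))) (mul_nonneg (mul_nonneg (by norm_num) measureReal_nonneg) (sub_nonneg.2 r35))) (mul_nonneg (by norm_num) (mul_nonneg (mul_nonneg measureReal_nonneg measureReal_nonneg) measureReal_nonneg))) (mul_nonneg (by norm_num) (mul_nonneg (mul_nonneg measureReal_nonneg measureReal_nonneg) measureReal_nonneg))) (mul_nonneg (by norm_num) (mul_nonneg (mul_nonneg measureReal_nonneg measureReal_nonneg) measureReal_nonneg))) (mul_nonneg (by norm_num) (mul_nonneg (mul_nonneg measureReal_nonneg measureReal_nonneg) measureReal_nonneg))) (mul_nonneg (by norm_num) (mul_nonneg (mul_nonneg measureReal_nonneg measureReal_nonneg) measureReal_nonneg))) (mul_nonneg (by norm_num) (mul_nonneg (mul_nonneg measureReal_nonneg measureReal_nonneg) measureReal_nonneg))) (mul_nonneg (by norm_num) (mul_nonneg (mul_nonneg measureReal_nonneg measureReal_nonneg) measureReal_nonneg))) (mul_nonneg (by norm_num)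 (mul_nonneg (mul_nonneg measureReal_nonneg measureReal_nonneg) measureReal_nonneg))) (mul_nonneg (by norm_num) (mul_nonneg (mul_nonneg measureReal_nonneg measureReal_nonneg) measureReal_nonneg))) (mul_nonneg (by norm_num) (mul_nonneg (mul_nonneg measureReal_nonneg measureReal_nonneg) measureReal_nonneg))) (mul_nonneg (by norm_num) (mul_nonneg (mul_nonneg measureReal_nonneg measureReal_nonneg) measureReal_nonneg))) (mul_nonneg (by norm_num) (mul_nonneg (mul_nonneg measureReal_nonneg measureReal_nonneg) measureReal_nonneg))) (mul_nonneg (by norm_num) (mul_nonneg (mul_nonneg measureReal_nonneg measureReal_nonneg) measureReal_nonneg))) (mul_nonneg (by norm_num) (mul_nonneg (mul_nonneg measureReal_nonneg measureReal_nonneg) measureReal_nonneg))) (mul_nonneg (by norm_num) (mul_nonneg (mul_nonneg measureReal_nonneg measureReal_nonneg) measureReal_nonneg))) (mul_nonneg (by norm_num) (mul_nonneg (mul_nonneg measureReal_nonneg measureReal_nonneg) measureReal_nonneg))) (mul_nonneg (by norm_num) (mul_nonneg (mul_nonneg measureReal_nonneg measureReal_nonneg) measureReal_nonneg))) (mul_nonneg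 (by norm_num) (mul_nonneg (mul_nonneg measureReal_nonneg measureReal_nonneg) measureReal_nonneg))) (mul_nonneg (by norm_num) (mul_nonneg (mul_nonneg measureReal_nonneg measureReal_nonneg) measureReal_nonneg))) (mul_nonneg (by norm_num) (mul_nonneg (mul_nonneg measureReal_nonneg measureReal_nonneg) measureReal_nonneg))) (mul_nonneg (by norm_num) (mul_nonneg (mul_nonneg measureReal_nonneg measureReal_nonneg) measureReal_nonneg))) (mul_nonneg (by norm_num) (mul_nonneg (mul_nonneg measureReal_nonneg measureReal_nonneg) measureReal_nonneg))) (mul_nonneg (by norm_num) (mul_nonneg (mul_nonneg measureReal_nonneg measureReal_nonneg) measureReal_nonneg))) (mul_nonneg (by norm_num) (mul_nonneg (mul_nonneg measureReal_nonneg measureReal_nonneg) measureReal_nonneg))) (mul_nonneg (by norm_num) (mul_nonneg (mul_nonneg measureReal_nonneg measureReal_nonneg) measureReal_nonneg))) (mul_nonneg (by norm_num) (mul_nonneg (mul_nonneg measureReal_nonneg measureReal_nonneg) measureReal_nonneg))) (mul_nonneg (by norm_num) (mul_nonneg (mul_nonneg measureReal_nonneg measureReal_nonneg) measureReal_nonneg)))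 (mul_nonneg (by norm_num) (mul_nonneg (mul_nonneg measureReal_nonneg measureReal_nonneg) measureReal_nonneg))) (mul_nonneg (by norm_num) (mul_nonneg (mul_nonneg measureReal_nonneg measureReal_nonneg) measureReal_nonneg))) (mul_nonneg (by norm_num) (mul_nonneg (mul_nonneg measureReal_nonneg measureReal_nonneg) measureReal_nonneg))) (mul_nonneg (by norm_num) (mul_nonneg (mul_nonneg measureReal_nonneg measureReal_nonneg) measureReal_nonneg))) (mul_nonneg (by norm_num) (mul_nonneg (mul_nonneg measureReal_nonneg measureReal_nonneg) measureReal_nonneg))) (mul_nonneg (by norm_num) (mul_nonneg (mul_nonneg measureReal_nonneg measureReal_nonneg) measureReal_nonneg))) (mul_nonneg (by norm_num) (mul_nonneg (mul_nonneg measureReal_nonneg measureReal_nonneg) measureReal_nonneg))) (mul_nonneg (by norm_num) (mul_nonneg (mul_nonneg measureReal_nonneg measureReal_nonneg) measureReal_nonneg))) (mul_nonneg (by norm_num) (mul_nonneg (mul_nonneg measureReal_nonneg measureReal_nonneg) measureReal_nonneg))) (mul_nonneg (by norm_num) (mul_nonneg (mul_nonneg measureReal_nonneg measureReal_nonneg)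 measureReal_nonneg))) (mul_nonneg (by norm_num) (mul_nonneg (mul_nonneg measureReal_nonneg measureReal_nonneg) measureReal_nonneg))) (mul_nonneg (by norm_num) (mul_nonneg (mul_nonneg measureReal_nonneg measureReal_nonneg) measureReal_nonneg))) (mul_nonneg (by norm_num) (mul_nonneg (mul_nonneg measureReal_nonneg measureReal_nonneg) measureReal_nonneg))) (mul_nonneg (by norm_num) (mul_nonneg (mul_nonneg measureReal_nonneg measureReal_nonneg) measureReal_nonneg))) (mul_nonneg (by norm_num) (mul_nonneg (mul_nonneg measureReal_nonneg measureReal_nonneg) measureReal_nonneg))) (mul_nonneg (by norm_num) (mul_nonneg (mul_nonneg measureReal_nonneg measureReal_nonneg) measureReal_nonneg))) (mul_nonneg (by norm_num) (mul_nonneg (mul_nonneg measureReal_nonneg measureReal_nonneg) measureReal_nonneg))) (mul_nonneg (by norm_num) (mul_nonneg (mul_nonneg measureReal_nonneg measureReal_nonneg) measureReal_nonneg))) (mul_nonneg (by norm_num) (mul_nonneg (mul_nonneg measureReal_nonneg measureReal_nonneg) measureReal_nonneg))) (mul_nonneg (by norm_num) (mul_nonneg (mul_nonneg measureReal_nonneg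 measureReal_nonneg) measureReal_nonneg))) (mul_nonneg (by norm_num) (mul_nonneg (mul_nonneg measureReal_nonneg measureReal_nonneg) measureReal_nonneg))) (mul_nonneg (by norm_num) (mul_nonneg (mul_nonneg measureReal_nonneg measureReal_nonneg) measureReal_nonneg))) (mul_nonneg (by norm_num) (mul_nonneg (mul_nonneg measureReal_nonneg measureReal_nonneg) measureReal_nonneg))) (mul_nonneg (by norm_num) (mul_nonneg (mul_nonneg measureReal_nonneg measureReal_nonneg) measureReal_nonneg))
  -- the seven masses of the target as events of formulas
  have hU : connA o a₁ a₂ a₃ = ev τ (.or (.conn 0 1) (.or (.conn 0 2) (.conn 0 3))) := connA_eq_ev o a₁ a₂ a₃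
  have hu : uMass w o a₁ a₂ a₃ = ((prodBernoulli w).real (cell τ 0) + ((prodBernoulli w).real (cell τ 1) + ((prodBernoulli w).real (cell τ 2) + ((prodBernoulli w).real (cell τ 3) + ((prodBernoulli w).real (cell τ 4) + ((prodBernoulli w).real (cell τ 5) + ((prodBernoulli w).real (cell τ 6) + ((prodBernoulli w).real (cell τ 7) + ((prodBernoulli w).real (cell τ 8) + (prodBernoulli w).real (cell τ 11)))))))))) := by
    rw [uMass, hU]; exact e0
  have hm12 : mMass w o a₁ a₂ a₃ a₁ a₂ = ((prodBernoulli w).real (cell τ 0) + ((prodBernoulli w).real (cell τ 1) + (prodBernoulli w).real (cell τ 8))) := by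
    rw [mMass, hU, show openConn a₁ a₂ = ev τ (.conn 1 2) from rfl, ← ev_and]; exact e1
  have hm13 : mMass w o a₁ a₂ a₃ a₁ a₃ = ((prodBernoulli w).real (cell τ 0) + ((prodBernoulli w).real (cell τ 2) + (prodBernoulli w).real (cell τ 6))) := by
    rw [mMass, hU, show openConn a₁ a₃ = ev τ (.conn 1 3) from rfl, ← ev_and]; exact e2
  have hm23 : mMass w o a₁ a₂ a₃ a₂ a₃ = ((prodBernoulli w).real (cell τ 0) + ((prodBernoulli w).real (cell τ 3) + (prodBernoulli w).real (cell τ 5))) := by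
    rw [mMass, hU, show openConn a₂ a₃ = ev τ (.conn 2 3) from rfl, ← ev_and]; exact e3
  have hr1 : rMass w o a₁ = ((prodBernoulli w).real (cell τ 0) + ((prodBernoulli w).real (cell τ 1) + ((prodBernoulli w).real (cell τ 2) + ((prodBernoulli w).real (cell τ 3) + (prodBernoulli w).real (cell τ 4))))) := by
    rw [rMass, show openConn o a₁ = ev τ (.conn 0 1) from rfl]; exact e4
  have hr2 : rMass w o a₂ = ((prodBernoulli w).real (cell τ 0) + ((prodBernoulli w).real (cell τ 1) + ((prodBernoulli w).real (cell τ 5) + ((prodBernoulli w).real (cell τ 6) + (prodBernoulli w).real (cell τ 7))))) := by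
    rw [rMass, show openConn o a₂ = ev τ (.conn 0 2) from rfl]; exact e5
  have hr3 : rMass w o a₃ = ((prodBernoulli w).real (cell τ 0) + ((prodBernoulli w).real (cell τ 2) + ((prodBernoulli w).real (cell τ 5) + ((prodBernoulli w).real (cell τ 8) + (prodBernoulli w).real (cell τ 11))))) := by
    rw [rMass, show openConn o a₃ = ev τ (.conn 0 3) from rfl]; exact e6
  rw [detM1, hu, hm12, hm13, hm23, hr1, hr2, hr3]
  exact le_of_le_of_eq hsum (by ring)

omit [Fintype V] in
/-- `mMass` is symmetric in the pair. [folklore] -/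
theorem mMass_comm (o a₁ a₂ a₃ a a' : V) : mMass w o a₁ a₂ a₃ a a' = mMass w o a₁ a₂ a₃ a' a := by
  unfold mMass
  have : (openConn a a' : Set (BondConfig V)) = openConn a' a := by
    ext ω; exact SimpleGraph.reachable_comm
  rw [this]

omit [Fintype V] in
/-- The diagonal entries: `P(0 ↔ A, a ↔ a) = P(0 ↔ A)`. [folklore] -/
theorem mMass_self (o a₁ a₂ a₃ a : V) : mMass w o a₁ a₂ a₃ a a = uMass w o a₁ a₂ a₃ := by
  unfold mMass uMass
  congr 1
  exact Set.inter_eq_left.2 fun ω _ => (SimpleGraph.Reachable.refl a : (openGraph ω).Reachable a a)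

omit [Fintype V] in
/-- `connA` does not depend on the order of the three relays (first two swapped). [folklore] -/
theorem connA_swap12 (o a₁ a₂ a₃ : V) : connA o a₂ a₁ a₃ = connA o a₁ a₂ a₃ := by
  unfold connA; rw [Finset.insert_comm]

omit [Fintype V] in
/-- `connA` does not depend on the order of the three relays (first and third swapped). [folklore] -/
theorem connA_swap13 (o a₁ a₂ a₃ : V) : connA o a₃ a₂ a₁ = connA o a₁ a₂ a₃ := by
  have h : ({a₃, a₂, a₁} : Finset V) = {a₁, a₂, a₃} := by
    ext b; simp only [Finset.mem_insert, Finset.mem_singleton]; tauto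
  unfold connA; rw [h]

/-- `det M^{(2)} ≥ 0` (the Cramer numerator of `c_{a₂}`): `detM1_nonneg` for the relabelling `(a₂, a₁, a₃)`.
[cite: KozmaNitzan2024, §5.2 Thm. 11 (p. 33) — the c_a ≥ 0 half, proved here] -/
theorem detM2_nonneg (o a₁ a₂ a₃ : V) :
    0 ≤ rMass w o a₂ * (uMass w o a₁ a₂ a₃ * uMass w o a₁ a₂ a₃ - mMass w o a₁ a₂ a₃ a₁ a₃ * mMass w o a₁ a₂ a₃ a₁ a₃) -
      mMass w o a₁ a₂ a₃ a₁ a₂ * (rMass w o a₁ * uMass w o a₁ a₂ a₃ - mMass w o a₁ a₂ a₃ a₁ a₃ * rMass w o a₃) +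
      mMass w o a₁ a₂ a₃ a₂ a₃ * (rMass w o a₁ * mMass w o a₁ a₂ a₃ a₁ a₃ - uMass w o a₁ a₂ a₃ * rMass w o a₃) := by
  have h := detM1_nonneg w o a₂ a₁ a₃
  have e1 : uMass w o a₂ a₁ a₃ = uMass w o a₁ a₂ a₃ := by unfold uMass; rw [connA_swap12]
  have e2 : ∀ a a', mMass w o a₂ a₁ a₃ a a' = mMass w o a₁ a₂ a₃ a a' := by
    intro a a'; unfold mMass; rw [connA_swap12]
  simp only [detM1, e1, e2, mMass_comm w o a₁ a₂ a₃ a₂ a₁] at h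
  exact h

/-- `det M^{(3)} ≥ 0` (the Cramer numerator of `c_{a₃}`): `detM1_nonneg` for the relabelling `(a₃, a₂, a₁)`.
[cite: KozmaNitzan2024, §5.2 Thm. 11 (p. 33) — the c_a ≥ 0 half, proved here] -/
theorem detM3_nonneg (o a₁ a₂ a₃ : V) :
    0 ≤ rMass w o a₃ * (uMass w o a₁ a₂ a₃ * uMass w o a₁ a₂ a₃ - mMass w o a₁ a₂ a₃ a₁ a₂ * mMass w o a₁ a₂ a₃ a₁ a₂) -
      mMass w o a₁ a₂ a₃ a₂ a₃ * (rMass w o a₂ * uMass w o a₁ a₂ a₃ - mMass w o a₁ a₂ a₃ a₁ a₂ * rMass w o a₁) +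
      mMass w o a₁ a₂ a₃ a₁ a₃ * (rMass w o a₂ * mMass w o a₁ a₂ a₃ a₁ a₂ - uMass w o a₁ a₂ a₃ * rMass w o a₁) := by
  have h := detM1_nonneg w o a₃ a₂ a₁
  have e1 : uMass w o a₃ a₂ a₁ = uMass w o a₁ a₂ a₃ := by unfold uMass; rw [connA_swap13]
  have e2 : ∀ a a', mMass w o a₃ a₂ a₁ a a' = mMass w o a₁ a₂ a₃ a a' := by
    intro a a'; unfold mMass; rw [connA_swap13]
  simp only [detM1, e1, e2, mMass_comm w o a₁ a₂ a₃ a₂ a₁, mMass_comm w o a₁ a₂ a₃ a₃ a₁,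
    mMass_comm w o a₁ a₂ a₃ a₃ a₂] at h
  exact h

/-- **`det M ≥ 0`**: `M = (P(0 ↔ A, a ↔ a′))_{a,a′}` is a principal block of the connectivity kernel of
the finite measure `μ(· ∩ {0 ↔ A})`, which is positive semidefinite (the tree's
`posSemidef_connKernelMatrix`; KN p. 34: "always nonnegatively defined"), pulled back along
`(a₁, a₂, a₃)` and expanded by Sarrus. [cite: KozmaNitzan2024, §5.2 p. 33–34] -/
theorem detM_nonneg (o a₁ a₂ a₃ : V) : 0 ≤ detM w o a₁ a₂ a₃ := by
  have hpsd : ((connKernelMatrix ((prodBernoulli w).restrict (connA o a₁ a₂ a₃))).submatrix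
      ![a₁, a₂, a₃] ![a₁, a₂, a₃]).PosSemidef :=
    (posSemidef_connKernelMatrix _).submatrix _
  have hdet := hpsd.det_nonneg
  have hent : ∀ a a' : V,
      connKernelMatrix ((prodBernoulli w).restrict (connA o a₁ a₂ a₃)) a a' = mMass w o a₁ a₂ a₃ a a' := by
    intro a a'
    unfold mMass
    rw [connKernelMatrix_apply, measureReal_restrict_apply MeasurableSet.of_discrete, Set.inter_comm]
  have e0 : (![a₁, a₂, a₃] : Fin 3 → V) 0 = a₁ := rfl
  have e1 : (![a₁, a₂, a₃] : Fin 3 → V) 1 = a₂ := rfl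
  have e2 : (![a₁, a₂, a₃] : Fin 3 → V) 2 = a₃ := rfl
  rw [Matrix.det_fin_three] at hdet
  simp only [Matrix.submatrix_apply, e0, e1, e2, hent, mMass_self, mMass_comm w o a₁ a₂ a₃ a₂ a₁,
    mMass_comm w o a₁ a₂ a₃ a₃ a₁, mMass_comm w o a₁ a₂ a₃ a₃ a₂] at hdet
  exact le_of_le_of_eq hdet (by unfold detM; ring)

omit [Fintype V] in
/-- For `A = {a₁, a₂, a₃}` the tree's Kozma–Nitzan matrix `knMatrix w o A` has entries `mMass`
(and diagonal `uMass`, by `mMass_self`): the system below IS the harmonic system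
`Σ_a c_a P(0 ↔ A, a ↔ a′) = P(0 ↔ a′)` of Theorem 11 / Question 5. [cite: KozmaNitzan2024, §5.2 Thm. 11 (p. 33)] -/
theorem knMatrix_three_apply (o a₁ a₂ a₃ : V) (a a' : (({a₁, a₂, a₃} : Finset V) : Type _)) :
    knMatrix w o {a₁, a₂, a₃} a a' = mMass w o a₁ a₂ a₃ a a' := rfl

omit [Fintype V] in
/-- Cramer's rule for the symmetric `3 × 3` system `M c = r`,
`M = [[u, m₁₂, m₁₃], [m₁₂, u, m₂₃], [m₁₃, m₂₃, u]]`: `c_i · det M = det M^{(i)}` (pure algebra). [folklore] -/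
theorem cramer3 {u m₁₂ m₁₃ m₂₃ r₁ r₂ r₃ c₁ c₂ c₃ : ℝ}
    (h₁ : c₁ * u + c₂ * m₁₂ + c₃ * m₁₃ = r₁) (h₂ : c₁ * m₁₂ + c₂ * u + c₃ * m₂₃ = r₂)
    (h₃ : c₁ * m₁₃ + c₂ * m₂₃ + c₃ * u = r₃) :
    c₁ * (u ^ 3 + 2 * m₁₂ * m₁₃ * m₂₃ - u * (m₁₂ ^ 2 + m₁₃ ^ 2 + m₂₃ ^ 2)) =
        r₁ * (u * u - m₂₃ * m₂₃) - m₁₂ * (r₂ * u - m₂₃ * r₃) + m₁₃ * (r₂ * m₂₃ - u * r₃) ∧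
      c₂ * (u ^ 3 + 2 * m₁₂ * m₁₃ * m₂₃ - u * (m₁₂ ^ 2 + m₁₃ ^ 2 + m₂₃ ^ 2)) =
        r₂ * (u * u - m₁₃ * m₁₃) - m₁₂ * (r₁ * u - m₁₃ * r₃) + m₂₃ * (r₁ * m₁₃ - u * r₃) ∧
      c₃ * (u ^ 3 + 2 * m₁₂ * m₁₃ * m₂₃ - u * (m₁₂ ^ 2 + m₁₃ ^ 2 + m₂₃ ^ 2)) =
        r₃ * (u * u - m₁₂ * m₁₂) - m₂₃ * (r₂ * u - m₁₂ * r₁) + m₁₃ * (r₂ * m₁₂ - u * r₁) := by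
  refine ⟨?_, ?_, ?_⟩
  · linear_combination (u * u - m₂₃ * m₂₃) * h₁ + (m₁₃ * m₂₃ - m₁₂ * u) * h₂ + (m₁₂ * m₂₃ - m₁₃ * u) * h₃
  · linear_combination (m₁₃ * m₂₃ - m₁₂ * u) * h₁ + (u * u - m₁₃ * m₁₃) * h₂ + (m₁₂ * m₁₃ - m₂₃ * u) * h₃
  · linear_combination (m₁₂ * m₂₃ - m₁₃ * u) * h₁ + (m₁₂ * m₁₃ - m₂₃ * u) * h₂ + (u * u - m₁₂ * m₁₂) * h₃

end Certificate

/-! ### Kozma–Nitzan's Theorem 11 — the `c_a ≥ 0` half -/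

section Theorem11

variable [Fintype V] (w : Sym2 V → unitInterval)

/-- **Kozma–Nitzan 2024, Theorem 11 (arXiv:2401.12397 §5.2, p. 33) — the nonnegativity half, PROVED.**
Printed: "Let `G` be a graph and let `A ⊂ G` with `|A| = 3`. Assume that the equations
`{Σ_{a∈A} c_a P(0 ↔ A, a ↔ a′) = P(0 ↔ a′) ∀a′ ∈ A}` have a unique solution. Then this solution
satisfies `c_a ≥ 0` for all `a ∈ A` and `Σ c_a ≥ 1`.  We skip the proof of this theorem as it is long
and holds only for `|A| ≤ 3`.  For `|A| ≥ 4` it is possible for some of the `c_i` to be negative." —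
no proof is printed.
Here, for bond percolation `prodBernoulli w` with arbitrary edge probabilities on a finite vertex type,
`0 = o`, `A = {a₁, a₂, a₃}`, `u = P(0 ↔ A)`, `m_{aa′} = P(0 ↔ A, a ↔ a′)` (the entries of the tree's
`knMatrix w o {a₁, a₂, a₃}`, `knMatrix_three_apply` / `mMass_self`), `r_a = P(0 ↔ a)`: if `(c₁, c₂, c₃)`
solves the three equations and the solution is unique (equivalently, given a solution, `det M ≠ 0`),
then `c₁, c₂, c₃ ≥ 0`.  PROOF: Cramer `c_i · det M = det M^{(i)}` (`cramer3`); `det M ≥ 0` by positive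
semidefiniteness (`detM_nonneg`), hence `det M > 0`; and `det M^{(i)} ≥ 0` by the exact two-set-BHK
sum-of-products certificate `detM1_nonneg` (36 van den Berg–Häggström–Kahn rows, 51 monomials; a cubic
polynomial identity in the 15 four-point connection cells) and its relabellings `detM2_nonneg`,
`detM3_nonneg`.  The `Σ_a c_a ≥ 1` half is NOT proved in this file.
[cite: KozmaNitzan2024, §5.2 Thm. 11 (p. 33) — c_a ≥ 0 half; VandenbergHaggstromKahn2005, Thm. 2.1 (p. 9)] -/
theorem _root_.Literature.Probability.Percolation.KozmaNitzan2024_thm11_nonneg (o a₁ a₂ a₃ : V)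
    (c₁ c₂ c₃ : ℝ)
    (h₁ : c₁ * uMass w o a₁ a₂ a₃ + c₂ * mMass w o a₁ a₂ a₃ a₁ a₂ + c₃ * mMass w o a₁ a₂ a₃ a₁ a₃ =
      rMass w o a₁)
    (h₂ : c₁ * mMass w o a₁ a₂ a₃ a₁ a₂ + c₂ * uMass w o a₁ a₂ a₃ + c₃ * mMass w o a₁ a₂ a₃ a₂ a₃ =
      rMass w o a₂)
    (h₃ : c₁ * mMass w o a₁ a₂ a₃ a₁ a₃ + c₂ * mMass w o a₁ a₂ a₃ a₂ a₃ + c₃ * uMass w o a₁ a₂ a₃ =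
      rMass w o a₃)
    (hdet : detM w o a₁ a₂ a₃ ≠ 0) : 0 ≤ c₁ ∧ 0 ≤ c₂ ∧ 0 ≤ c₃ := by
  obtain ⟨cr₁, cr₂, cr₃⟩ := cramer3 h₁ h₂ h₃
  have hD : 0 < detM w o a₁ a₂ a₃ := lt_of_le_of_ne (detM_nonneg w o a₁ a₂ a₃) (Ne.symm hdet)
  have n₁ : 0 ≤ c₁ * detM w o a₁ a₂ a₃ := by
    rw [detM, cr₁]; exact detM1_nonneg w o a₁ a₂ a₃
  have n₂ : 0 ≤ c₂ * detM w o a₁ a₂ a₃ := by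
    rw [detM, cr₂]; exact detM2_nonneg w o a₁ a₂ a₃
  have n₃ : 0 ≤ c₃ * detM w o a₁ a₂ a₃ := by
    rw [detM, cr₃]; exact detM3_nonneg w o a₁ a₂ a₃
  exact ⟨nonneg_of_mul_nonneg_left n₁ hD, nonneg_of_mul_nonneg_left n₂ hD,
    nonneg_of_mul_nonneg_left n₃ hD⟩

/-- Matrix form: if the tree's `knMatrix w o {a₁, a₂, a₃}` is positive definite (e.g. under the
separating-atom criterion `posDef_knMatrix`) then EVERY solution of the harmonic system is
nonnegative — positive definiteness gives `det M ≠ 0`, i.e. uniqueness.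
[cite: KozmaNitzan2024, §5.2 Thm. 11 (p. 33) — c_a ≥ 0 half] -/
theorem _root_.Literature.Probability.Percolation.KozmaNitzan2024_thm11_nonneg_of_det_pos (o a₁ a₂ a₃ : V)
    (c₁ c₂ c₃ : ℝ)
    (h₁ : c₁ * uMass w o a₁ a₂ a₃ + c₂ * mMass w o a₁ a₂ a₃ a₁ a₂ + c₃ * mMass w o a₁ a₂ a₃ a₁ a₃ =
      rMass w o a₁)
    (h₂ : c₁ * mMass w o a₁ a₂ a₃ a₁ a₂ + c₂ * uMass w o a₁ a₂ a₃ + c₃ * mMass w o a₁ a₂ a₃ a₂ a₃ =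
      rMass w o a₂)
    (h₃ : c₁ * mMass w o a₁ a₂ a₃ a₁ a₃ + c₂ * mMass w o a₁ a₂ a₃ a₂ a₃ + c₃ * uMass w o a₁ a₂ a₃ =
      rMass w o a₃)
    (hdet : 0 < detM w o a₁ a₂ a₃) : 0 ≤ c₁ ∧ 0 ≤ c₂ ∧ 0 ≤ c₃ :=
  KozmaNitzan2024_thm11_nonneg w o a₁ a₂ a₃ c₁ c₂ c₃ h₁ h₂ h₃ hdet.ne'

/-- The Kozma–Nitzan matrix of `A = {a₁, a₂, a₃}` as a `Fin 3`-indexed real matrix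
`M = [[u, m₁₂, m₁₃], [m₁₂, u, m₂₃], [m₁₃, m₂₃, u]]`. [cite: KozmaNitzan2024, §5.2 Thm. 11 (p. 33)] -/
def knMat3 (o a₁ a₂ a₃ : V) : Matrix (Fin 3) (Fin 3) ℝ :=
  !![uMass w o a₁ a₂ a₃, mMass w o a₁ a₂ a₃ a₁ a₂, mMass w o a₁ a₂ a₃ a₁ a₃;
    mMass w o a₁ a₂ a₃ a₁ a₂, uMass w o a₁ a₂ a₃, mMass w o a₁ a₂ a₃ a₂ a₃;
    mMass w o a₁ a₂ a₃ a₁ a₃, mMass w o a₁ a₂ a₃ a₂ a₃, uMass w o a₁ a₂ a₃]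

/-- The right-hand side `(P(0 ↔ a₁), P(0 ↔ a₂), P(0 ↔ a₃))` of the harmonic system. [cite: KozmaNitzan2024, §5.2 Thm. 11 (p. 33)] -/
def rVec3 (o a₁ a₂ a₃ : V) : Fin 3 → ℝ := ![rMass w o a₁, rMass w o a₂, rMass w o a₃]

omit [Fintype V] in
/-- `det (knMat3 …) = detM …` (Sarrus). [folklore] -/
theorem det_knMat3 (o a₁ a₂ a₃ : V) : (knMat3 w o a₁ a₂ a₃).det = detM w o a₁ a₂ a₃ := by
  unfold knMat3 detM
  rw [Matrix.det_fin_three]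
  simp
  ring

/-- **Kozma–Nitzan 2024, Theorem 11, `c_a ≥ 0` half — in the printed "unique solution" form.**  If `c`
solves the harmonic system `M c = r` (`M = knMat3`, `r = rVec3`) and is its only solution, then every
coordinate of `c` is nonnegative.  (Uniqueness forces `det M ≠ 0` via `Matrix.exists_mulVec_eq_zero_iff`;
then `KozmaNitzan2024_thm11_nonneg`.) [cite: KozmaNitzan2024, §5.2 Thm. 11 (p. 33) — c_a ≥ 0 half] -/
theorem _root_.Literature.Probability.Percolation.KozmaNitzan2024_thm11_nonneg_of_unique (o a₁ a₂ a₃ : V)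
    (c : Fin 3 → ℝ) (hc : (knMat3 w o a₁ a₂ a₃).mulVec c = rVec3 w o a₁ a₂ a₃)
    (huniq : ∀ c', (knMat3 w o a₁ a₂ a₃).mulVec c' = rVec3 w o a₁ a₂ a₃ → c' = c) (i : Fin 3) :
    0 ≤ c i := by
  have hdet : detM w o a₁ a₂ a₃ ≠ 0 := by
    rw [← det_knMat3]
    intro hzero
    obtain ⟨v, hv0, hv⟩ := Matrix.exists_mulVec_eq_zero_iff.2 hzero
    have h' := huniq (c + v) (by rw [Matrix.mulVec_add, hv, add_zero, hc])
    exact hv0 (by simpa using h')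
  have h₁ := congrFun hc 0
  have h₂ := congrFun hc 1
  have h₃ := congrFun hc 2
  simp [knMat3, rVec3, Matrix.mulVec, dotProduct, Fin.sum_univ_three] at h₁ h₂ h₃
  obtain ⟨n₁, n₂, n₃⟩ := KozmaNitzan2024_thm11_nonneg w o a₁ a₂ a₃ (c 0) (c 1) (c 2)
    (by linarith) (by linarith) (by linarith) hdet
  fin_cases i
  · exact n₁
  · exact n₂
  · exact n₃

/-- The same with the hypothesis packaged as `∃!`: the unique solution of `M c = r` is (coordinatewise)
nonnegative. [cite: KozmaNitzan2024, §5.2 Thm. 11 (p. 33) — c_a ≥ 0 half] -/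
theorem _root_.Literature.Probability.Percolation.KozmaNitzan2024_thm11_nonneg_of_existsUnique
    (o a₁ a₂ a₃ : V)
    (h : ∃! c : Fin 3 → ℝ, (knMat3 w o a₁ a₂ a₃).mulVec c = rVec3 w o a₁ a₂ a₃) :
    ∃ c : Fin 3 → ℝ, (knMat3 w o a₁ a₂ a₃).mulVec c = rVec3 w o a₁ a₂ a₃ ∧
      (∀ c', (knMat3 w o a₁ a₂ a₃).mulVec c' = rVec3 w o a₁ a₂ a₃ → c' = c) ∧ ∀ i, 0 ≤ c i := by
  obtain ⟨c, hc, huniq⟩ := h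
  exact ⟨c, hc, huniq, KozmaNitzan2024_thm11_nonneg_of_unique w o a₁ a₂ a₃ c hc huniq⟩

end Theorem11

end KNHarmonic

end Literature.Probability.Percolation

end
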